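import Mathlib.Analysis.CStarAlgebra.Matrix
import Literature.MathematicalPhysics.QuantumFieldTheory.SUNBakryEmeryFrame
import Literature.Analysis.Matrix.DetExp
import Literature.MathematicalPhysics.QuantumLattice.GaugeGroupsProofs
import Literature.MathematicalPhysics.QuantumFieldTheory.UnitaryTraceConcentration
import HarnessLib

/-!
# The Bakry–Émery Poincaré inequality on `SU(N)` and the discharge of `shen_zhu_zhu`

This file proves the one-link Poincaré inequality on `SU(N)` — the hypothesis `hLP` of
`Literature.MathematicalPhysics.QuantumFieldTheory.shen_zhu_zhu_of_haarPoincare`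
(`LatticeGaugeDobrushinPoincare.lean`) — and thereby discharges the named fact
`Literature.MathematicalPhysics.QuantumFieldTheory.shen_zhu_zhu` (Shen–Zhu–Zhu, CMP 400 (2023),
Thm. 1.2 and Cor. 1.6 "Mass gap"; `constructive-qft.S16`) as `shen_zhu_zhu_holds`:

* `SUNBakryEmery.haarPoincare_SU` : for `N ≥ 2`, `‖B‖_op < 1/2` and `ψ : SU(N) → ℝ` with
  `|ψ(a) - ψ(b)| ≤ M ‖a - b‖_F`, `Var_{ν_B}(ψ) ≤ M² / (N (1/2 - ‖B‖_op))` for the Gibbs-tilted Haar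
  measure `ν_B(dg) ∝ exp(N Re tr(g B)) dg` (Shen–Zhu–Zhu Assumption 1.1, Lemma 4.1, (4.7)–(4.8),
  Cor. 4.4 (4.11)).
* `shen_zhu_zhu_holds (d N : ℕ) : shen_zhu_zhu d N`.

## The proof (elementary Bakry–Émery: no stochastic analysis, no spectral theorem, no elliptic
regularity)

All the differential geometry of `SU(N)` is done on ambient smooth functions `F : M_N(ℂ) → ℝ` with
the left-invariant derivatives `D_A F(Q) = dF(Q)[QA]` (`matD`) in the Parseval frame `(Y_α)` of
`𝔰𝔲(N)` of `SUNBakryEmeryFrame.lean`; `Γ(F,G) = ∑ D_α F D_α G`, `Δ = ∑ D_α²`, `L_S = Δ + Γ(S,·)`.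

1. *Calculus* (Part B/C): Leibniz, chain rule, `[D_A, D_B] = D_{[A,B]}` (symmetry of second
   derivatives), the flow `d/dt F(Q e^{tA}) = D_A F(Q e^{tA})`; total antisymmetry of the structure
   constants gives `[Δ, D_α] = 0` and **Bochner's formula**
   `Γ₂(u) = ∑_{αβ} (D_αD_βu)² - ∑ D_αu D_βu D_αD_βS` (`Gam2_eq`); the Killing form (`Ric = N/2`,
   `sum_sum_sq_comm_matD`) and the one-link Hessian bound `|Re tr(Q Z² B)| ≤ ‖Z‖_F² ‖B‖_op` give the
   curvature-dimension bound `Γ₂(u) ≥ (N/2 - |c| ‖B‖_op) Γ(u,u)` on `SU(N)` for `S = c Re tr(· B)`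
   (`Gam2_potential_ge`; Shen–Zhu–Zhu Lemma 4.1 and (4.3)–(4.5) for one link).
2. *Integration* (Part D/E): integration by parts `∫ D_Y F dσ = 0` on the Haar probability measure
   `σ` of `SU(N)` (right invariance under `exp(t𝔰𝔲(N)) ⊆ SU(N)`, `det exp = exp tr`), symmetry of
   `L_S` for `e^S σ`, the integrated Bochner inequality `K ∫ e^S Γ(u,u) ≤ ∫ e^S (L_S u)²`, and the
   **Poincaré inequality from approximate solvability of the Poisson equation**
   (`poincare_of_approx`): if `L_S v_k → u - m` in `L²(e^S σ)` then `K ∫ e^S (u-m)² ≤ ∫ e^S Γ(u,u)`.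
3. *Density* (Part F/G, the substitute for elliptic theory): polynomials `𝒫_n` in the real
   coordinates are finite-dimensional, `Δ`-invariant (`D_Y` maps coordinates to linear functions)
   and dense in `L²(σ)` (Stone–Weierstrass); projecting `w ⟂ (Δ - W)𝒫` onto `𝒫_n|_{SU(N)}` gives
   `∫ Γ(p_n,p_n) = -∫ w W p_n` (`exists_proj_seq`). For `W = 0` this forces `p_n` constant
   (vanishing `Γ` + `exp : 𝔰𝔲(N) ↠ SU(N)` via diagonalisation in `SU(N)`), whence
   `(Δ𝒫)^⊥ = constants`, approximate solvability, and the **Poincaré inequality of the Haar measure**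
   with constant `2/N` (`poincare_haar`). For the tilted measure, the ground-state transform
   `L_S(e^{-S/2}p) = e^{-S/2}(Δ - W)p`, `W = ¼Γ(S,S) + ½ΔS` (`genL_groundState`), and `poincare_haar`
   show `((Δ - W)𝒫)^⊥ = ℝ e^{S/2}` (`ae_eq_groundState_of_orthogonal`), whence the **Poincaré inequality
   for the one-link Gibbs measure** (`poincare_pot`, Shen–Zhu–Zhu (4.6) for `Λ = {e}`).
4. *Lipschitz functions* (Part H): McShane extension and mollification preserve the Lipschitz
   constant, and the frame bound gives `Γ ≤ M²` on `SU(N)`; an `ε`-argument transfers `poincare_pot`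
   to `ψ`, in the variance form of `hLP`.

Engineering note: the calculus sections install `matTop` — the topology of `M_N(ℂ)` written as the
Frobenius-norm topology (definitionally the product topology) — with high instance priority, so that
Mathlib's `fderiv` API applies syntactically; exported statements do not depend on it.

## References

* H. Shen, R. Zhu, X. Zhu, *A stochastic analysis approach to lattice Yang–Mills at strong
  coupling*, CMP 400 (2023) 805–851, arXiv:2204.12737 — statement, equation and page numbers in this
  file are those of arXiv v1 (the only arXiv version; the CMP numbering was not checked):
  Assumption 1.1 (p. 4), Thm. 1.2, Rem. 1.3 ff. (p. 5), Cor. 1.6 "Mass gap" (p. 7), §2 (2.3)–(2.4)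
  (p. 10), §2.1 (pp. 11–12), (3.5) (generator, p. 13), §4.1 (pp. 17–20): (4.1)–(4.4) with Lemma 4.1
  (Hessian bound, p. 17), Thm. 4.2 (4.5)–(4.6), (4.7) (Bakry–Émery condition), (4.8) (Ricci
  curvature, after [AGZ10, (F.6)]), Cor. 4.4 (4.11) (log-Sobolev and Poincaré inequalities on `Λ_L`,
  p. 19), Cor. 4.5 (4.12)–(4.13) (p. 20).
* D. Bakry, M. Émery, *Diffusions hypercontractives*, Sém. Probab. XIX, LNM 1123 (1985) 177–206.
* D. Bakry, I. Gentil, M. Ledoux, *Analysis and Geometry of Markov Diffusion Operators*,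
  Grundlehren 348 (2014), §1.16, §4.8 (Prop. 4.8.1).
* T. Bröcker, T. tom Dieck, *Representations of Compact Lie Groups*, GTM 98 (1985), IV (3.1).
-/

noncomputable section

open scoped Matrix ComplexConjugate BigOperators

namespace Literature.MathematicalPhysics.QuantumFieldTheory

namespace SUNBakryEmery

/-! ## Part B: left-invariant derivatives of smooth functions on `M_N(ℂ)` -/


open scoped Matrix.Norms.Frobenius ContDiff Topology
open MeasureTheory

variable {N : ℕ}

/-- The topology of `M_N(ℂ)` written as the topology of the Frobenius norm. It is *definitionally*
the product topology (`matTop_eq`), but syntactically the norm topology, which is what the `fderiv`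
API produces; we install it with high priority in the calculus sections. [folklore] -/
@[reducible] def matTop (N : ℕ) : TopologicalSpace (Matrix (Fin N) (Fin N) ℂ) :=
  (PseudoMetricSpace.toUniformSpace (α := Matrix (Fin N) (Fin N) ℂ)).toTopologicalSpace

/-- `matTop` is the product topology. [folklore] -/
theorem matTop_eq : matTop N = (inferInstance : TopologicalSpace (Matrix (Fin N) (Fin N) ℂ)) := rfl

section Calculus

attribute [local instance 2000] matTop

/-- The **left-invariant derivative** `(D_A F)(Q) = dF(Q)[Q A] = d/dt F(Q e^{tA})|_{t=0}` of a
function on `M_N(ℂ)` in the direction of the left-invariant vector field generated by `A`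
(Shen–Zhu–Zhu §2, p. 10 «Lie groups and algebras», use the right-invariant fields `X̃(Q) = XQ` and
the derivative (2.4); the tangent space of `SU(N)` at `Q` is `𝔰𝔲(N) Q = Q 𝔰𝔲(N)`). [cite: arXiv220412737, §2 (2.4) (p. 10)] -/
def matD (A : Matrix (Fin N) (Fin N) ℂ) (F : Matrix (Fin N) (Fin N) ℂ → ℝ) :
    Matrix (Fin N) (Fin N) ℂ → ℝ :=
  fun Q => fderiv ℝ F Q (Q * A)

/-- Unfolding `matD`. [folklore] -/
theorem matD_apply (A : Matrix (Fin N) (Fin N) ℂ) (F : Matrix (Fin N) (Fin N) ℂ → ℝ)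
    (Q : Matrix (Fin N) (Fin N) ℂ) : matD A F Q = fderiv ℝ F Q (Q * A) := rfl

/-- `D_A` preserves smoothness. [folklore] -/
theorem contDiff_matD {F : Matrix (Fin N) (Fin N) ℂ → ℝ} (hF : ContDiff ℝ ∞ F)
    (A : Matrix (Fin N) (Fin N) ℂ) : ContDiff ℝ ∞ (matD A F) := by
  have h1 : ContDiff ℝ ∞ (fderiv ℝ F) := hF.fderiv_right (m := ∞) le_rfl
  exact h1.clm_apply (contDiff_id.mul contDiff_const)

/-- Smooth functions are continuous (for the product topology). [folklore] -/
theorem continuous_of_contDiff {F : Matrix (Fin N) (Fin N) ℂ → ℝ} (hF : ContDiff ℝ ∞ F) :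
    Continuous F := hF.continuous

/-! #### Linearity in the function -/

/-- `D_A (F + G) = D_A F + D_A G`. [folklore] -/
theorem matD_add {F G : Matrix (Fin N) (Fin N) ℂ → ℝ} (hF : ContDiff ℝ ∞ F) (hG : ContDiff ℝ ∞ G)
    (A : Matrix (Fin N) (Fin N) ℂ) : matD A (F + G) = matD A F + matD A G := by
  funext Q
  have hFd : DifferentiableAt ℝ F Q := hF.differentiable (by simp) Q
  have hGd : DifferentiableAt ℝ G Q := hG.differentiable (by simp) Q
  simp only [matD, Pi.add_apply]
  rw [fderiv_add hFd hGd]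
  rfl

/-- `D_A (F - G) = D_A F - D_A G`. [folklore] -/
theorem matD_sub {F G : Matrix (Fin N) (Fin N) ℂ → ℝ} (hF : ContDiff ℝ ∞ F) (hG : ContDiff ℝ ∞ G)
    (A : Matrix (Fin N) (Fin N) ℂ) : matD A (F - G) = matD A F - matD A G := by
  funext Q
  have hFd : DifferentiableAt ℝ F Q := hF.differentiable (by simp) Q
  have hGd : DifferentiableAt ℝ G Q := hG.differentiable (by simp) Q
  simp only [matD, Pi.sub_apply]
  rw [fderiv_sub hFd hGd]
  rfl

/-- `D_A (c F) = c D_A F`. [folklore] -/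
theorem matD_const_mul {F : Matrix (Fin N) (Fin N) ℂ → ℝ} (hF : ContDiff ℝ ∞ F) (c : ℝ)
    (A : Matrix (Fin N) (Fin N) ℂ) : matD A (fun Q => c * F Q) = fun Q => c * matD A F Q := by
  funext Q
  have hFd : DifferentiableAt ℝ F Q := hF.differentiable (by simp) Q
  simp only [matD]
  rw [fderiv_const_mul hFd]
  rfl

/-- `D_A c = 0`. [folklore] -/
theorem matD_const (c : ℝ) (A : Matrix (Fin N) (Fin N) ℂ) :
    matD A (fun _ : Matrix (Fin N) (Fin N) ℂ => c) = 0 := by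
  funext Q
  simp [matD]

/-- `D_A (∑ᵢ Fᵢ) = ∑ᵢ D_A Fᵢ`. [folklore] -/
theorem matD_sum {ι : Type*} (s : Finset ι) {F : ι → Matrix (Fin N) (Fin N) ℂ → ℝ}
    (hF : ∀ i ∈ s, ContDiff ℝ ∞ (F i)) (A : Matrix (Fin N) (Fin N) ℂ) :
    matD A (fun Q => ∑ i ∈ s, F i Q) = fun Q => ∑ i ∈ s, matD A (F i) Q := by
  funext Q
  have hFd : ∀ i ∈ s, DifferentiableAt ℝ (F i) Q := fun i hi => (hF i hi).differentiable (by simp) Q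
  simp only [matD]
  rw [fderiv_fun_sum hFd, _root_.sum_apply]

/-- **Leibniz rule** `D_A (F G) = F D_A G + G D_A F`. [folklore] -/
theorem matD_mul {F G : Matrix (Fin N) (Fin N) ℂ → ℝ} (hF : ContDiff ℝ ∞ F) (hG : ContDiff ℝ ∞ G)
    (A : Matrix (Fin N) (Fin N) ℂ) : matD A (F * G) = F * matD A G + G * matD A F := by
  funext Q
  have hFd : DifferentiableAt ℝ F Q := hF.differentiable (by simp) Q
  have hGd : DifferentiableAt ℝ G Q := hG.differentiable (by simp) Q
  simp only [matD, Pi.mul_apply, Pi.add_apply]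
  rw [fderiv_mul hFd hGd]
  simp only [_root_.add_apply, FunLike.coe_smul, Pi.smul_apply, smul_eq_mul]

/-- Leibniz rule, lambda form. [folklore] -/
theorem matD_fun_mul {F G : Matrix (Fin N) (Fin N) ℂ → ℝ} (hF : ContDiff ℝ ∞ F) (hG : ContDiff ℝ ∞ G)
    (A : Matrix (Fin N) (Fin N) ℂ) :
    matD A (fun Q => F Q * G Q) = fun Q => F Q * matD A G Q + G Q * matD A F Q :=
  matD_mul hF hG A

/-- Additivity, lambda form. [folklore] -/
theorem matD_fun_add {F G : Matrix (Fin N) (Fin N) ℂ → ℝ} (hF : ContDiff ℝ ∞ F) (hG : ContDiff ℝ ∞ G)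
    (A : Matrix (Fin N) (Fin N) ℂ) :
    matD A (fun Q => F Q + G Q) = fun Q => matD A F Q + matD A G Q :=
  matD_add hF hG A

/-- **Chain rule** with a smooth real function: `D_A (h ∘ F) = h'(F) D_A F`. [folklore] -/
theorem matD_comp {F : Matrix (Fin N) (Fin N) ℂ → ℝ} (hF : ContDiff ℝ ∞ F) {h : ℝ → ℝ}
    (hh : ContDiff ℝ ∞ h) (A : Matrix (Fin N) (Fin N) ℂ) :
    matD A (fun Q => h (F Q)) = fun Q => deriv h (F Q) * matD A F Q := by
  funext Q
  have hFd : DifferentiableAt ℝ F Q := hF.differentiable (by simp) Q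
  have hhd : DifferentiableAt ℝ h (F Q) := hh.differentiable (by simp) _
  have hc := (hhd.hasDerivAt.comp_hasFDerivAt Q hFd.hasFDerivAt).fderiv
  simp only [matD]
  rw [show (fun Q => h (F Q)) = h ∘ F from rfl, hc]
  simp only [FunLike.coe_smul, Pi.smul_apply, smul_eq_mul]

/-- `D_A e^{F} = e^{F} D_A F`. [folklore] -/
theorem matD_exp {F : Matrix (Fin N) (Fin N) ℂ → ℝ} (hF : ContDiff ℝ ∞ F) (A : Matrix (Fin N) (Fin N) ℂ) :
    matD A (fun Q => Real.exp (F Q)) = fun Q => Real.exp (F Q) * matD A F Q := by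
  rw [matD_comp hF Real.contDiff_exp]
  simp only [Real.deriv_exp]

/-! #### Linearity in the direction -/

/-- `D_{A+B} = D_A + D_B`. [folklore] -/
theorem matD_add_dir (A B : Matrix (Fin N) (Fin N) ℂ) (F : Matrix (Fin N) (Fin N) ℂ → ℝ) :
    matD (A + B) F = matD A F + matD B F := by
  funext Q
  simp only [matD, Pi.add_apply, Matrix.mul_add, map_add]

/-- `D_{-A} = -D_A`. [folklore] -/
theorem matD_neg_dir (A : Matrix (Fin N) (Fin N) ℂ) (F : Matrix (Fin N) (Fin N) ℂ → ℝ) :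
    matD (-A) F = -matD A F := by
  funext Q
  simp only [matD, Pi.neg_apply, Matrix.mul_neg, map_neg]

/-- `D_{A-B} = D_A - D_B`. [folklore] -/
theorem matD_sub_dir (A B : Matrix (Fin N) (Fin N) ℂ) (F : Matrix (Fin N) (Fin N) ℂ → ℝ) :
    matD (A - B) F = matD A F - matD B F := by
  rw [sub_eq_add_neg, matD_add_dir, matD_neg_dir, ← sub_eq_add_neg]

/-- `D_{r A} = r D_A` for real `r`. [folklore] -/
theorem matD_smul_dir (r : ℝ) (A : Matrix (Fin N) (Fin N) ℂ) (F : Matrix (Fin N) (Fin N) ℂ → ℝ) :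
    matD (r • A) F = r • matD A F := by
  funext Q
  simp only [matD, Pi.smul_apply, Matrix.mul_smul, map_smul]

/-- `D_{∑ rᵢ Aᵢ} = ∑ rᵢ D_{Aᵢ}`. [folklore] -/
theorem matD_sum_smul_dir {ι : Type*} (s : Finset ι) (r : ι → ℝ) (A : ι → Matrix (Fin N) (Fin N) ℂ)
    (F : Matrix (Fin N) (Fin N) ℂ → ℝ) (Q : Matrix (Fin N) (Fin N) ℂ) :
    matD (∑ i ∈ s, r i • A i) F Q = ∑ i ∈ s, r i * matD (A i) F Q := by
  simp only [matD, Matrix.mul_sum, Matrix.mul_smul, map_sum, map_smul, smul_eq_mul]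

/-! #### The derivative as a linear functional of the direction -/

/-- `A ↦ (D_A F)(Q)` as a real linear functional on `M_N(ℂ)`. [folklore] -/
def dirFun (F : Matrix (Fin N) (Fin N) ℂ → ℝ) (Q : Matrix (Fin N) (Fin N) ℂ) :
    Matrix (Fin N) (Fin N) ℂ →ₗ[ℝ] ℝ :=
  (fderiv ℝ F Q).toLinearMap.comp (LinearMap.mulLeft ℝ Q)

/-- `dirFun F Q A = D_A F Q`. [folklore] -/
@[simp] theorem dirFun_apply (F : Matrix (Fin N) (Fin N) ℂ → ℝ) (Q A : Matrix (Fin N) (Fin N) ℂ) :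
    dirFun F Q A = matD A F Q := rfl

/-- For an `M`-Lipschitz function (Frobenius norm) and unitary `Q`: `|D_A F(Q)| ≤ M ‖A‖_F`. [folklore] -/
theorem abs_matD_le_of_lipschitz {F : Matrix (Fin N) (Fin N) ℂ → ℝ} {M : NNReal}
    (hF : LipschitzWith M F) {Q : Matrix (Fin N) (Fin N) ℂ} (hQ : Q ∈ Matrix.unitaryGroup (Fin N) ℂ)
    (A : Matrix (Fin N) (Fin N) ℂ) : |matD A F Q| ≤ M * frobNorm A := by
  rw [matD_apply, ← Real.norm_eq_abs]
  calc ‖fderiv ℝ F Q (Q * A)‖ ≤ ‖fderiv ℝ F Q‖ * ‖Q * A‖ := ContinuousLinearMap.le_opNorm _ _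
    _ ≤ M * ‖Q * A‖ := mul_le_mul_of_nonneg_right (norm_fderiv_le_of_lipschitz ℝ hF) (norm_nonneg _)
    _ = M * frobNorm A := by rw [← frobNorm_eq_norm, frobNorm_unitary_mul hQ]

/-! #### Linear functions and the potential -/

/-- The real-linear function `Q ↦ Re tr(Q M)` as a continuous linear map. [folklore] -/
def reTrMul (M : Matrix (Fin N) (Fin N) ℂ) : Matrix (Fin N) (Fin N) ℂ →L[ℝ] ℝ :=
  LinearMap.toContinuousLinearMap
    { toFun := fun Q => (Q * M).trace.re
      map_add' := fun Q Q' => by rw [Matrix.add_mul, Matrix.trace_add, Complex.add_re]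
      map_smul' := fun c Q => by
        simp only [Matrix.smul_mul, Matrix.trace_smul, RingHom.id_apply, Complex.smul_re, smul_eq_mul] }

/-- Evaluation of `reTrMul`. [folklore] -/
@[simp] theorem reTrMul_apply (M Q : Matrix (Fin N) (Fin N) ℂ) : reTrMul M Q = (Q * M).trace.re := rfl

/-- `Q ↦ Re tr(Q M)` is smooth. [folklore] -/
theorem contDiff_reTrMul (M : Matrix (Fin N) (Fin N) ℂ) :
    ContDiff ℝ ∞ fun Q : Matrix (Fin N) (Fin N) ℂ => (Q * M).trace.re :=
  (reTrMul M).contDiff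

/-- `D_A Re tr(· M) = Re tr(· A M)`. [folklore] -/
theorem matD_reTrMul (A M : Matrix (Fin N) (Fin N) ℂ) :
    matD A (fun Q => (Q * M).trace.re) = fun Q => (Q * A * M).trace.re := by
  funext Q
  change fderiv ℝ (reTrMul M) Q (Q * A) = _
  rw [(reTrMul M).fderiv, reTrMul_apply, Matrix.mul_assoc]

/-- `Q ↦ c Re tr(Q M)` is smooth. [folklore] -/
theorem contDiff_const_mul_reTrMul (c : ℝ) (M : Matrix (Fin N) (Fin N) ℂ) :
    ContDiff ℝ ∞ fun Q : Matrix (Fin N) (Fin N) ℂ => c * (Q * M).trace.re :=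
  contDiff_const.mul (contDiff_reTrMul M)

/-- `D_A (c Re tr(· M)) = c Re tr(· A M)`. [folklore] -/
theorem matD_const_mul_reTrMul (c : ℝ) (A M : Matrix (Fin N) (Fin N) ℂ) :
    matD A (fun Q => c * (Q * M).trace.re) = fun Q => c * (Q * A * M).trace.re := by
  rw [matD_const_mul (contDiff_reTrMul M), matD_reTrMul]

/-! #### The commutator identity -/

/-- Derivative of `Q ↦ Q B`. [folklore] -/
theorem hasFDerivAt_mul_const (B Q : Matrix (Fin N) (Fin N) ℂ) :
    HasFDerivAt (fun Q : Matrix (Fin N) (Fin N) ℂ => Q * B)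
      (ContinuousLinearMap.mulLeftRight ℝ (Matrix (Fin N) (Fin N) ℂ) 1 B) Q := by
  have : (fun Q : Matrix (Fin N) (Fin N) ℂ => Q * B) =
      fun Q => ContinuousLinearMap.mulLeftRight ℝ (Matrix (Fin N) (Fin N) ℂ) 1 B Q := by
    funext Q; simp
  rw [this]
  exact (ContinuousLinearMap.mulLeftRight ℝ _ 1 B).hasFDerivAt

/-- **Commutator of left-invariant derivatives**: `[D_A, D_B] = D_{[A,B]}` (symmetry of second
derivatives). [folklore] -/
theorem matD_comm {F : Matrix (Fin N) (Fin N) ℂ → ℝ} (hF : ContDiff ℝ ∞ F) (A B : Matrix (Fin N) (Fin N) ℂ) :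
    matD A (matD B F) - matD B (matD A F) = matD (A * B - B * A) F := by
  funext Q
  have hsymm : IsSymmSndFDerivAt ℝ F Q :=
    (hF.contDiffAt).isSymmSndFDerivAt (n := ∞)
      (by rw [minSmoothness_of_isRCLikeNormedField]; exact WithTop.coe_le_coe.2 le_top)
  have h1 : ContDiff ℝ ∞ (fderiv ℝ F) := hF.fderiv_right (m := ∞) le_rfl
  have hd1 : DifferentiableAt ℝ (fderiv ℝ F) Q := h1.differentiable (by simp) Q
  have key : ∀ (B C : Matrix (Fin N) (Fin N) ℂ),
      fderiv ℝ (fun Q => fderiv ℝ F Q (Q * B)) Q C =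
        fderiv ℝ (fderiv ℝ F) Q C (Q * B) + fderiv ℝ F Q (C * B) := by
    intro B C
    have hu : DifferentiableAt ℝ (fun Q : Matrix (Fin N) (Fin N) ℂ => Q * B) Q :=
      (hasFDerivAt_mul_const B Q).differentiableAt
    rw [fderiv_clm_apply hd1 hu]
    simp only [_root_.add_apply, ContinuousLinearMap.comp_apply, ContinuousLinearMap.flip_apply]
    rw [(hasFDerivAt_mul_const B Q).fderiv]
    simp only [ContinuousLinearMap.mulLeftRight_apply, one_mul]
    rw [add_comm]
  simp only [Pi.sub_apply]
  unfold matD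
  rw [key B (Q * A), key A (Q * B), hsymm (Q * A) (Q * B)]
  simp only [Matrix.mul_sub, Matrix.mul_assoc, map_sub]
  ring

/-! #### Derivative along one-parameter subgroups -/

/-- `exp(tA)` commutes with `A`. [folklore] -/
theorem exp_smul_mul_self (A : Matrix (Fin N) (Fin N) ℂ) (t : ℝ) :
    A * NormedSpace.exp (t • A) = NormedSpace.exp (t • A) * A :=
  ((Commute.refl A).smul_right t).exp_right.eq

/-- **Derivative along the flow**: `d/dt F(Q e^{tA}) = (D_A F)(Q e^{tA})`. [folklore] -/
theorem hasDerivAt_comp_mul_exp {F : Matrix (Fin N) (Fin N) ℂ → ℝ} (hF : ContDiff ℝ ∞ F)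
    (Q A : Matrix (Fin N) (Fin N) ℂ) (t : ℝ) :
    HasDerivAt (fun s : ℝ => F (Q * NormedSpace.exp (s • A)))
      (matD A F (Q * NormedSpace.exp (t • A))) t := by
  have h1 : HasDerivAt (fun s : ℝ => Q * NormedSpace.exp (s • A))
      (Q * (A * NormedSpace.exp (t • A))) t :=
    (hasDerivAt_exp_smul_const' (𝕂 := ℝ) A t).const_mul Q
  have hFd : DifferentiableAt ℝ F (Q * NormedSpace.exp (t • A)) := hF.differentiable (by simp) _
  have h2 := hFd.hasFDerivAt.comp_hasDerivAt t h1
  have h3 : fderiv ℝ F (Q * NormedSpace.exp (t • A)) (Q * (A * NormedSpace.exp (t • A))) =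
      matD A F (Q * NormedSpace.exp (t • A)) := by
    rw [matD_apply, exp_smul_mul_self, Matrix.mul_assoc]
  rw [h3] at h2
  exact h2

end Calculus


/-! ## Part C: carré du champ, Laplacian, generator and the Bochner formula in the frame -/


open scoped Matrix.Norms.Frobenius ContDiff Topology
open Matrix Complex Finset

variable {N : ℕ}

/-! ### Hilbert–Schmidt versus operator norm -/

section OpNorm

/-- **`‖B M‖_F ≤ ‖B‖_op ‖M‖_F`** (columnwise). [folklore] -/
theorem frobNorm_mul_le_matrixOpNorm_mul (B M : Matrix (Fin N) (Fin N) ℂ) :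
    frobNorm (B * M) ≤ matrixOpNorm B * frobNorm M := by
  -- columns as Euclidean vectors
  set col : Matrix (Fin N) (Fin N) ℂ → Fin N → EuclideanSpace ℂ (Fin N) :=
    fun A j => (EuclideanSpace.equiv (Fin N) ℂ).symm fun i => A i j with hcol
  have hnorm : ∀ A : Matrix (Fin N) (Fin N) ℂ, frobNorm A ^ 2 = ∑ j, ‖col A j‖ ^ 2 := by
    intro A
    rw [frobNorm_sq, Finset.sum_comm]
    refine sum_congr rfl fun j _ => ?_
    rw [EuclideanSpace.norm_eq, Real.sq_sqrt (sum_nonneg fun i _ => sq_nonneg _)]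
    rfl
  have hcolmul : ∀ j, col (B * M) j = (EuclideanSpace.equiv (Fin N) ℂ).symm (B *ᵥ (col M j).ofLp) := by
    intro j
    simp only [hcol]
    rfl
  have hle : ∀ j, ‖col (B * M) j‖ ≤ matrixOpNorm B * ‖col M j‖ := by
    intro j
    rw [hcolmul, matrixOpNorm]
    open scoped Matrix.Norms.L2Operator in
    exact Matrix.l2_opNorm_mulVec B (col M j)
  have hsq : frobNorm (B * M) ^ 2 ≤ (matrixOpNorm B * frobNorm M) ^ 2 := by
    rw [hnorm, mul_pow, hnorm, mul_sum]
    exact sum_le_sum fun j _ => by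
      rw [← mul_pow]
      exact pow_le_pow_left₀ (norm_nonneg _) (hle j) 2
  exact (pow_le_pow_iff_left₀ (frobNorm_nonneg _)
    (mul_nonneg (matrixOpNorm_nonneg _) (frobNorm_nonneg _)) two_ne_zero).1 hsq

open scoped Matrix.Norms.L2Operator in
/-- `‖Bᴴ‖_op = ‖B‖_op`. [folklore] -/
theorem matrixOpNorm_conjTranspose (B : Matrix (Fin N) (Fin N) ℂ) : matrixOpNorm Bᴴ = matrixOpNorm B := by
  rw [matrixOpNorm_eq_norm, matrixOpNorm_eq_norm, Matrix.l2_opNorm_conjTranspose]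

/-- **`‖M B‖_F ≤ ‖M‖_F ‖B‖_op`** (the one-link Hessian bound of Shen–Zhu–Zhu Lemma 4.1 uses
`|Re tr(Q X² B)| ≤ ‖X‖_F² ‖B‖_op`, which follows). [folklore] -/
theorem frobNorm_mul_le_mul_matrixOpNorm (M B : Matrix (Fin N) (Fin N) ℂ) :
    frobNorm (M * B) ≤ frobNorm M * matrixOpNorm B := by
  rw [← frobNorm_conjTranspose, conjTranspose_mul, mul_comm (frobNorm M), ← frobNorm_conjTranspose M,
    ← matrixOpNorm_conjTranspose]
  exact frobNorm_mul_le_matrixOpNorm_mul _ _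

/-- **One-link Hessian bound** (Shen–Zhu–Zhu Lemma 4.1, case `e = ē`): for unitary `Q`,
`|Re tr(Q Z Z B)| ≤ ‖Z‖_F² ‖B‖_op`. [cite: arXiv220412737, Lemma 4.1] -/
theorem abs_re_trace_unitary_mul_mul_mul_le {Q : Matrix (Fin N) (Fin N) ℂ}
    (hQ : Q ∈ Matrix.unitaryGroup (Fin N) ℂ) (Z B : Matrix (Fin N) (Fin N) ℂ) :
    |(Q * Z * Z * B).trace.re| ≤ frobNorm Z ^ 2 * matrixOpNorm B := by
  rw [Matrix.mul_assoc]
  calc |(Q * Z * (Z * B)).trace.re| ≤ frobNorm (Q * Z) * frobNorm (Z * B) := abs_re_trace_mul_le _ _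
    _ ≤ frobNorm Z * (frobNorm Z * matrixOpNorm B) := by
        rw [frobNorm_unitary_mul hQ]
        exact mul_le_mul_of_nonneg_left (frobNorm_mul_le_mul_matrixOpNorm Z B) (frobNorm_nonneg _)
    _ = frobNorm Z ^ 2 * matrixOpNorm B := by ring

end OpNorm

/-! ### Trilinear trace identities of the frame (total antisymmetry of the structure constants) -/

/-- Cyclic invariance `tr(C [A, B]) = tr(A [B, C])`. [folklore] -/
theorem trace_mul_comm_cycle (A B C : Matrix (Fin N) (Fin N) ℂ) :
    (C * (A * B - B * A)).trace = (A * (B * C - C * B)).trace := by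
  rw [Matrix.mul_sub, Matrix.mul_sub, trace_sub, trace_sub]
  have h1 : (C * (A * B)).trace = (A * (B * C)).trace := by
    rw [trace_mul_comm, Matrix.mul_assoc]
  have h2 : (C * (B * A)).trace = (A * (C * B)).trace := by
    rw [← Matrix.mul_assoc, trace_mul_comm]
  rw [h1, h2]

/-- Antisymmetry `tr(C [A, B]) = -tr(C [B, A])`. [folklore] -/
theorem trace_mul_comm_swap (A B C : Matrix (Fin N) (Fin N) ℂ) :
    (C * (A * B - B * A)).trace = -(C * (B * A - A * B)).trace := by
  rw [← trace_neg, ← Matrix.mul_neg, neg_sub]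

/-- The structure constants of the frame: `c_{αβγ} = ⟨Y_γ, [Y_α, Y_β]⟩ = -Re tr(Y_γ [Y_α, Y_β])`.
[folklore] -/
def strC (α β γ : FrameIdx N) : ℝ :=
  -(frame γ * (frame α * frame β - frame β * frame α)).trace.re

/-- `c_{αβγ} = -c_{βαγ}`. [folklore] -/
theorem strC_swap12 (α β γ : FrameIdx N) : strC α β γ = -strC β α γ := by
  rw [strC, strC, trace_mul_comm_swap, Complex.neg_re, neg_neg]

/-- `c_{αβγ} = c_{βγα}` (cyclic). [folklore] -/
theorem strC_cycle (α β γ : FrameIdx N) : strC α β γ = strC β γ α := by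
  rw [strC, strC, trace_mul_comm_cycle]

/-- `c_{αβγ} = -c_{αγβ}`. [folklore] -/
theorem strC_swap23 (α β γ : FrameIdx N) : strC α β γ = -strC α γ β := by
  rw [strC_cycle, strC_swap12, strC_cycle γ β α, strC_cycle]

/-- `c_{αβγ} = -c_{γβα}`. [folklore] -/
theorem strC_swap13 (α β γ : FrameIdx N) : strC α β γ = -strC γ β α := by
  rw [strC_cycle, strC_swap23 β γ α, ← strC_cycle]

/-- A sum of an antisymmetric kernel against a symmetric one vanishes. [folklore] -/
theorem sum_sum_eq_zero_of_antisymm {c m : FrameIdx N → FrameIdx N → ℝ} (hc : ∀ α γ, c α γ = -c γ α)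
    (hm : ∀ α γ, m α γ = m γ α) : ∑ α, ∑ γ, c α γ * m α γ = 0 := by
  have h : ∑ α, ∑ γ, c α γ * m α γ = -∑ α, ∑ γ, c α γ * m α γ := by
    conv_rhs => rw [sum_comm]
    rw [← sum_neg_distrib]
    refine sum_congr rfl fun α _ => ?_
    rw [← sum_neg_distrib]
    refine sum_congr rfl fun γ _ => ?_
    rw [hc γ α, hm γ α, neg_mul, neg_neg]
  linarith

section Calculus

attribute [local instance 2000] matTop

/-! ### Derivatives in `𝔰𝔲(N)`-directions expanded in the frame -/

/-- `D_X F = ∑_α ⟨Y_α, X⟩ D_{Y_α} F` for `X ∈ 𝔰𝔲(N)`. [folklore] -/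
theorem matD_eq_sum_frame (hN : N ≠ 0) {X : Matrix (Fin N) (Fin N) ℂ} (hX : Xᴴ = -X) (hX0 : X.trace = 0)
    (F : Matrix (Fin N) (Fin N) ℂ → ℝ) (Q : Matrix (Fin N) (Fin N) ℂ) :
    matD X F Q = ∑ α, (-(frame α * X).trace.re) * matD (frame α) F Q := by
  conv_lhs => rw [← sum_re_trace_smul_frame hN hX hX0]
  exact matD_sum_smul_dir _ _ _ F Q

/-- The commutator `[D_{Y_α}, D_{Y_β}]` expanded in the frame:
`D_α D_β F - D_β D_α F = ∑_γ c_{αβγ} D_γ F`. [folklore] -/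
theorem matD_matD_sub_eq_sum_strC (hN : N ≠ 0) {F : Matrix (Fin N) (Fin N) ℂ → ℝ} (hF : ContDiff ℝ ∞ F)
    (α β : FrameIdx N) (Q : Matrix (Fin N) (Fin N) ℂ) :
    matD (frame α) (matD (frame β) F) Q - matD (frame β) (matD (frame α) F) Q =
      ∑ γ, strC α β γ * matD (frame γ) F Q := by
  have h := congrFun (matD_comm hF (frame α) (frame β)) Q
  rw [Pi.sub_apply] at h
  rw [h, matD_eq_sum_frame hN (conjTranspose_comm_of_skew (frame_conjTranspose α) (frame_conjTranspose β))
    (trace_comm _ _)]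
  rfl

/-! ### Carré du champ, Laplacian, generator -/

/-- The **carré du champ** `Γ(F, G) = ∑_α D_α F D_α G = ⟨∇F, ∇G⟩` (Shen–Zhu–Zhu §2.1, p. 12: `∇_e`;
§4.1). [cite: arXiv220412737, §2.1 (p. 12), §4.1] -/
def Gam (F G : Matrix (Fin N) (Fin N) ℂ → ℝ) : Matrix (Fin N) (Fin N) ℂ → ℝ :=
  fun Q => ∑ α, matD (frame α) F Q * matD (frame α) G Q

/-- The **Laplace–Beltrami operator** of `SU(N)` (bi-invariant Hilbert–Schmidt metric), on ambient
functions: `Δ F = ∑_α D_α D_α F`. [cite: arXiv220412737, §2.1 (p. 12)] -/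
def Lap (F : Matrix (Fin N) (Fin N) ℂ → ℝ) : Matrix (Fin N) (Fin N) ℂ → ℝ :=
  fun Q => ∑ α, matD (frame α) (matD (frame α) F) Q

/-- The **Langevin generator** `L_S F = Δ F + Γ(S, F)` of the measure `e^{S} dσ`
(the generator (3.5), p. 13, of Shen–Zhu–Zhu's Langevin dynamic (1.6)/(3.1)). [cite: arXiv220412737, (3.5) (p. 13)] -/
def genL (S F : Matrix (Fin N) (Fin N) ℂ → ℝ) : Matrix (Fin N) (Fin N) ℂ → ℝ :=
  fun Q => Lap F Q + Gam S F Q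

/-- `Γ` is symmetric. [folklore] -/
theorem Gam_comm (F G : Matrix (Fin N) (Fin N) ℂ → ℝ) : Gam F G = Gam G F := by
  funext Q; simp only [Gam, mul_comm]

/-- `Γ(F, F) = ∑_α (D_α F)²`. [folklore] -/
theorem Gam_self_eq_sum_sq (F : Matrix (Fin N) (Fin N) ℂ → ℝ) (Q : Matrix (Fin N) (Fin N) ℂ) :
    Gam F F Q = ∑ α, matD (frame α) F Q ^ 2 := by
  simp only [Gam, sq]

/-- `Γ(F, F) ≥ 0`. [folklore] -/
theorem Gam_self_nonneg (F : Matrix (Fin N) (Fin N) ℂ → ℝ) (Q : Matrix (Fin N) (Fin N) ℂ) : 0 ≤ Gam F F Q := by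
  rw [Gam_self_eq_sum_sq]; exact sum_nonneg fun α _ => sq_nonneg _

/-- **`Γ(F,F) = ‖∇F‖_F²`** with `∇F(Q) = ∑_α D_α F(Q) Y_α ∈ 𝔰𝔲(N)`. [folklore] -/
theorem Gam_self_eq_frobNorm_sq (hN : N ≠ 0) (F : Matrix (Fin N) (Fin N) ℂ → ℝ) (Q : Matrix (Fin N) (Fin N) ℂ) :
    Gam F F Q = frobNorm (frameGrad (dirFun F Q)) ^ 2 := by
  rw [frobNorm_frameGrad_sq hN, Gam_self_eq_sum_sq]
  rfl

/-- **Cauchy–Schwarz for `Γ`**: `|Γ(F, G)| ≤ √Γ(F,F) √Γ(G,G)`. [folklore] -/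
theorem abs_Gam_le (F G : Matrix (Fin N) (Fin N) ℂ → ℝ) (Q : Matrix (Fin N) (Fin N) ℂ) :
    |Gam F G Q| ≤ Real.sqrt (Gam F F Q) * Real.sqrt (Gam G G Q) := by
  rw [Gam_self_eq_sum_sq, Gam_self_eq_sum_sq, Gam]
  have h := Real.sum_mul_le_sqrt_mul_sqrt univ (fun α => matD (frame α) F Q) (fun α => matD (frame α) G Q)
  have h' := Real.sum_mul_le_sqrt_mul_sqrt univ (fun α => -matD (frame α) F Q) (fun α => matD (frame α) G Q)
  simp only [neg_mul, sum_neg_distrib, neg_sq] at h'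
  exact abs_le.2 ⟨by linarith, h⟩

/-- For a Frobenius-`M`-Lipschitz `F` and unitary `Q`: **`Γ(F,F)(Q) ≤ M²`** (the frame bound).
[folklore] -/
theorem Gam_self_le_of_lipschitz (hN : N ≠ 0) {F : Matrix (Fin N) (Fin N) ℂ → ℝ} {M : NNReal}
    (hF : LipschitzWith M F) {Q : Matrix (Fin N) (Fin N) ℂ} (hQ : Q ∈ Matrix.unitaryGroup (Fin N) ℂ) :
    Gam F F Q ≤ (M : ℝ) ^ 2 := by
  rw [Gam_self_eq_sum_sq]
  exact sum_sq_apply_frame_le hN (dirFun F Q) fun A => abs_matD_le_of_lipschitz hF hQ A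

/-! #### Smoothness -/

/-- `Γ(F, G)` is smooth. [folklore] -/
theorem contDiff_Gam {F G : Matrix (Fin N) (Fin N) ℂ → ℝ} (hF : ContDiff ℝ ∞ F) (hG : ContDiff ℝ ∞ G) :
    ContDiff ℝ ∞ (Gam F G) :=
  ContDiff.sum fun _ _ => (contDiff_matD hF _).mul (contDiff_matD hG _)

/-- `Δ F` is smooth. [folklore] -/
theorem contDiff_Lap {F : Matrix (Fin N) (Fin N) ℂ → ℝ} (hF : ContDiff ℝ ∞ F) : ContDiff ℝ ∞ (Lap F) :=
  ContDiff.sum fun _ _ => contDiff_matD (contDiff_matD hF _) _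

/-- `L_S F` is smooth. [folklore] -/
theorem contDiff_genL {S F : Matrix (Fin N) (Fin N) ℂ → ℝ} (hS : ContDiff ℝ ∞ S) (hF : ContDiff ℝ ∞ F) :
    ContDiff ℝ ∞ (genL S F) :=
  (contDiff_Lap hF).add (contDiff_Gam hS hF)

/-! #### Leibniz rules -/

/-- `Γ(F G, H) = F Γ(G, H) + G Γ(F, H)`. [folklore] -/
theorem Gam_mul_left {F G H : Matrix (Fin N) (Fin N) ℂ → ℝ} (hF : ContDiff ℝ ∞ F) (hG : ContDiff ℝ ∞ G)
    (Q : Matrix (Fin N) (Fin N) ℂ) : Gam (F * G) H Q = F Q * Gam G H Q + G Q * Gam F H Q := by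
  simp only [Gam, matD_mul hF hG, Pi.add_apply, Pi.mul_apply, mul_sum, ← sum_add_distrib]
  exact sum_congr rfl fun α _ => by ring

/-- `Δ(F G) = F ΔG + G ΔF + 2 Γ(F, G)`. [folklore] -/
theorem Lap_mul {F G : Matrix (Fin N) (Fin N) ℂ → ℝ} (hF : ContDiff ℝ ∞ F) (hG : ContDiff ℝ ∞ G)
    (Q : Matrix (Fin N) (Fin N) ℂ) : Lap (F * G) Q = F Q * Lap G Q + G Q * Lap F Q + 2 * Gam F G Q := by
  simp only [Lap, Gam]
  have h : ∀ α : FrameIdx N, matD (frame α) (matD (frame α) (F * G)) Q =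
      F Q * matD (frame α) (matD (frame α) G) Q + G Q * matD (frame α) (matD (frame α) F) Q +
        2 * (matD (frame α) F Q * matD (frame α) G Q) := by
    intro α
    rw [matD_mul hF hG, matD_add (F := F * matD (frame α) G) (G := G * matD (frame α) F)
      (hF.mul (contDiff_matD hG _)) (hG.mul (contDiff_matD hF _)),
      matD_mul hF (contDiff_matD hG _), matD_mul hG (contDiff_matD hF _)]
    simp only [Pi.add_apply, Pi.mul_apply]
    ring
  simp only [h, sum_add_distrib, ← mul_sum]

/-- **`L(FG) = F LG + G LF + 2Γ(F,G)`**. [folklore] -/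
theorem genL_mul {S F G : Matrix (Fin N) (Fin N) ℂ → ℝ} (hF : ContDiff ℝ ∞ F)
    (hG : ContDiff ℝ ∞ G) (Q : Matrix (Fin N) (Fin N) ℂ) :
    genL S (F * G) Q = F Q * genL S G Q + G Q * genL S F Q + 2 * Gam F G Q := by
  rw [show genL S (F * G) Q = Lap (F * G) Q + Gam S (F * G) Q from rfl,
    show genL S G Q = Lap G Q + Gam S G Q from rfl, show genL S F Q = Lap F Q + Gam S F Q from rfl,
    Lap_mul hF hG, Gam_comm S (F * G), Gam_mul_left hF hG, Gam_comm G S, Gam_comm F S]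
  ring

/-! #### The Casimir commutes with left-invariant derivatives -/

/-- **`[Δ, D_α] = 0`**: `∑_β D_β D_β D_α F = D_α Δ F` (the Casimir element is central; here from the
total antisymmetry of the structure constants). [folklore] -/
theorem sum_matD_matD_matD_eq_matD_Lap (hN : N ≠ 0) {F : Matrix (Fin N) (Fin N) ℂ → ℝ} (hF : ContDiff ℝ ∞ F)
    (α : FrameIdx N) (Q : Matrix (Fin N) (Fin N) ℂ) :
    ∑ β, matD (frame β) (matD (frame β) (matD (frame α) F)) Q = matD (frame α) (Lap F) Q := by
  -- `D_α Δ F = ∑_β D_α D_β D_β F`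
  have hLap : matD (frame α) (Lap F) Q = ∑ β, matD (frame α) (matD (frame β) (matD (frame β) F)) Q :=
    congrFun (matD_sum univ (F := fun β => matD (frame β) (matD (frame β) F))
      (fun β _ => contDiff_matD (contDiff_matD hF _) _) (frame α)) Q
  rw [hLap, ← sub_eq_zero, ← sum_sub_distrib]
  -- telescope each summand into commutators
  have htel : ∀ β : FrameIdx N,
      matD (frame β) (matD (frame β) (matD (frame α) F)) Q - matD (frame α) (matD (frame β) (matD (frame β) F)) Q =
        ∑ γ, strC β α γ * (matD (frame β) (matD (frame γ) F) Q + matD (frame γ) (matD (frame β) F) Q) := by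
    intro β
    -- `D_β (D_β D_α - D_α D_β) F + (D_β D_α - D_α D_β) (D_β F)`
    have e1 : matD (frame β) (matD (frame β) (matD (frame α) F)) Q - matD (frame β) (matD (frame α) (matD (frame β) F)) Q
        = ∑ γ, strC β α γ * matD (frame β) (matD (frame γ) F) Q := by
      have hfun : matD (frame β) (matD (frame α) F) - matD (frame α) (matD (frame β) F) =
          fun Q => ∑ γ, strC β α γ * matD (frame γ) F Q :=
        funext fun Q => matD_matD_sub_eq_sum_strC hN hF β α Q
      have hsub := congrFun (matD_sub (F := matD (frame β) (matD (frame α) F))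
        (G := matD (frame α) (matD (frame β) F)) (contDiff_matD (contDiff_matD hF _) _)
        (contDiff_matD (contDiff_matD hF _) _) (frame β)) Q
      rw [Pi.sub_apply] at hsub
      rw [← hsub, hfun, matD_sum univ (F := fun γ Q => strC β α γ * matD (frame γ) F Q)
        (fun γ _ => contDiff_const.mul (contDiff_matD hF _))]
      refine sum_congr rfl fun γ _ => ?_
      rw [matD_const_mul (contDiff_matD hF _)]
    have e2 : matD (frame β) (matD (frame α) (matD (frame β) F)) Q - matD (frame α) (matD (frame β) (matD (frame β) F)) Q
        = ∑ γ, strC β α γ * matD (frame γ) (matD (frame β) F) Q :=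
      matD_matD_sub_eq_sum_strC hN (contDiff_matD hF _) β α Q
    calc _ = (matD (frame β) (matD (frame β) (matD (frame α) F)) Q - matD (frame β) (matD (frame α) (matD (frame β) F)) Q)
          + (matD (frame β) (matD (frame α) (matD (frame β) F)) Q - matD (frame α) (matD (frame β) (matD (frame β) F)) Q) := by
          ring
      _ = _ := by rw [e1, e2, ← sum_add_distrib]; exact sum_congr rfl fun γ _ => by ring
  simp_rw [htel]
  exact sum_sum_eq_zero_of_antisymm (fun β γ => strC_swap13 β α γ) fun β γ => by ring

/-! ### The Bochner formula -/

/-- The **iterated carré du champ** `Γ₂(u) = ½ L_S Γ(u,u) - Γ(u, L_S u)` (Bakry–Émery). [folklore] -/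
def Gam2 (S u : Matrix (Fin N) (Fin N) ℂ → ℝ) (Q : Matrix (Fin N) (Fin N) ℂ) : ℝ :=
  (1 / 2) * genL S (Gam u u) Q - Gam u (genL S u) Q

/-- `D_B Γ(u,u) = 2 ∑_α D_α u · D_B D_α u`. [folklore] -/
theorem matD_Gam_self {u : Matrix (Fin N) (Fin N) ℂ → ℝ} (hu : ContDiff ℝ ∞ u) (B : Matrix (Fin N) (Fin N) ℂ)
    (Q : Matrix (Fin N) (Fin N) ℂ) :
    matD B (Gam u u) Q = ∑ α, 2 * matD (frame α) u Q * matD B (matD (frame α) u) Q := by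
  have : Gam u u = fun Q => ∑ α, matD (frame α) u Q * matD (frame α) u Q := rfl
  rw [this, matD_sum univ (F := fun α Q => matD (frame α) u Q * matD (frame α) u Q)
    (fun α _ => (contDiff_matD hu _).mul (contDiff_matD hu _))]
  refine sum_congr rfl fun α _ => ?_
  rw [matD_fun_mul (contDiff_matD hu _) (contDiff_matD hu _)]
  ring

/-- `Δ Γ(u,u) = 2 ∑_{αβ} (D_β D_α u)² + 2 ∑_α D_α u · D_α Δ u`. [folklore] -/
theorem Lap_Gam_self (hN : N ≠ 0) {u : Matrix (Fin N) (Fin N) ℂ → ℝ} (hu : ContDiff ℝ ∞ u)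
    (Q : Matrix (Fin N) (Fin N) ℂ) :
    Lap (Gam u u) Q = 2 * ∑ β, ∑ α, matD (frame β) (matD (frame α) u) Q ^ 2 +
      2 * ∑ α, matD (frame α) u Q * matD (frame α) (Lap u) Q := by
  -- `D_β D_β Γ = ∑_α 2[(D_β D_α u)² + D_α u D_β D_β D_α u]`
  have h1 : ∀ β : FrameIdx N, matD (frame β) (matD (frame β) (Gam u u)) Q =
      ∑ α, 2 * (matD (frame β) (matD (frame α) u) Q ^ 2 +
        matD (frame α) u Q * matD (frame β) (matD (frame β) (matD (frame α) u)) Q) := by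
    intro β
    have hfun : matD (frame β) (Gam u u) =
        fun Q => ∑ α, 2 * (matD (frame α) u Q * matD (frame β) (matD (frame α) u) Q) := by
      funext Q
      rw [matD_Gam_self hu]
      simp only [mul_assoc]
    rw [hfun, matD_sum univ (F := fun α Q => 2 * (matD (frame α) u Q * matD (frame β) (matD (frame α) u) Q))
      (fun α _ => contDiff_const.mul ((contDiff_matD hu _).mul (contDiff_matD (contDiff_matD hu _) _)))]
    refine sum_congr rfl fun α _ => ?_
    rw [matD_const_mul ((contDiff_matD hu _).mul (contDiff_matD (contDiff_matD hu _) _)),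
      matD_fun_mul (contDiff_matD hu _) (contDiff_matD (contDiff_matD hu _) _)]
    ring
  simp only [Lap] at h1 ⊢
  simp_rw [h1, ← mul_sum, sum_add_distrib, mul_add]
  congr 1
  rw [sum_comm]
  simp_rw [← mul_sum, sum_matD_matD_matD_eq_matD_Lap hN hu]

/-- `Γ(u, L_S u) = ∑_α D_α u D_α Δu + ∑_{αβ} D_α u (D_α D_β S · D_β u + D_β S · D_α D_β u)`. [folklore] -/
theorem Gam_genL {S u : Matrix (Fin N) (Fin N) ℂ → ℝ} (hS : ContDiff ℝ ∞ S) (hu : ContDiff ℝ ∞ u)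
    (Q : Matrix (Fin N) (Fin N) ℂ) :
    Gam u (genL S u) Q = ∑ α, matD (frame α) u Q * matD (frame α) (Lap u) Q +
      ∑ α, ∑ β, matD (frame α) u Q *
        (matD (frame α) (matD (frame β) S) Q * matD (frame β) u Q +
          matD (frame β) S Q * matD (frame α) (matD (frame β) u) Q) := by
  have hgen : genL S u = Lap u + Gam S u := by funext Q; rfl
  have hGam : ∀ α : FrameIdx N, matD (frame α) (Gam S u) Q =
      ∑ β, (matD (frame α) (matD (frame β) S) Q * matD (frame β) u Q +
        matD (frame β) S Q * matD (frame α) (matD (frame β) u) Q) := by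
    intro α
    have hfun : Gam S u = fun Q => ∑ β, matD (frame β) S Q * matD (frame β) u Q := rfl
    rw [hfun, matD_sum univ (F := fun β Q => matD (frame β) S Q * matD (frame β) u Q)
      (fun β _ => (contDiff_matD hS _).mul (contDiff_matD hu _))]
    refine sum_congr rfl fun β _ => ?_
    rw [matD_fun_mul (contDiff_matD hS _) (contDiff_matD hu _)]
    ring
  rw [Gam, ← sum_add_distrib]
  refine sum_congr rfl fun α _ => ?_
  rw [hgen, matD_add (contDiff_Lap hu) (contDiff_Gam hS hu), Pi.add_apply, hGam, mul_add, mul_sum]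

/-- **Bochner's formula on `SU(N)` in the frame** (Shen–Zhu–Zhu (4.3) `Hess S(v,v) = v(v(S))` and
(4.7)–(4.8); Bakry–Émery):
`Γ₂(u) = ∑_{αβ} (D_α D_β u)² - ∑_{αβ} D_α u D_β u · D_α D_β S` — the Ricci term is hidden in the
non-commutativity of the `D_α` (`∑ (D_αD_β u)² = |Hess u|² + Ric(∇u,∇u)`). [cite: arXiv220412737, (4.3), (4.7)-(4.8) (pp. 17, 19)] -/
theorem Gam2_eq (hN : N ≠ 0) {S u : Matrix (Fin N) (Fin N) ℂ → ℝ} (hS : ContDiff ℝ ∞ S) (hu : ContDiff ℝ ∞ u)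
    (Q : Matrix (Fin N) (Fin N) ℂ) :
    Gam2 S u Q = ∑ α, ∑ β, matD (frame α) (matD (frame β) u) Q ^ 2 -
      ∑ α, ∑ β, matD (frame α) u Q * matD (frame β) u Q * matD (frame α) (matD (frame β) S) Q := by
  -- the commutator term vanishes (antisymmetry of the structure constants in `(α, γ)`)
  have hcomm : ∑ α, ∑ β, matD (frame β) S Q * matD (frame α) u Q *
      (matD (frame β) (matD (frame α) u) Q - matD (frame α) (matD (frame β) u) Q) = 0 := by
    have h1 : ∀ α β, matD (frame β) (matD (frame α) u) Q - matD (frame α) (matD (frame β) u) Q =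
        ∑ γ, strC β α γ * matD (frame γ) u Q := fun α β => matD_matD_sub_eq_sum_strC hN hu β α Q
    simp_rw [h1, mul_sum]
    rw [sum_comm]
    refine sum_eq_zero fun β _ => ?_
    have : ∑ α, ∑ γ, matD (frame β) S Q * matD (frame α) u Q * (strC β α γ * matD (frame γ) u Q) =
        matD (frame β) S Q * ∑ α, ∑ γ, strC β α γ * (matD (frame α) u Q * matD (frame γ) u Q) := by
      rw [mul_sum]
      refine sum_congr rfl fun α _ => ?_
      rw [mul_sum]
      exact sum_congr rfl fun γ _ => by ring
    rw [this, sum_sum_eq_zero_of_antisymm (fun α γ => strC_swap23 β α γ) (fun α γ => mul_comm _ _), mul_zero]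
  -- `Γ(S, Γ(u,u)) = 2 ∑_{βα} s_β a_α m_{βα}`
  have eC : Gam S (Gam u u) Q =
      2 * ∑ β, ∑ α, matD (frame β) S Q * matD (frame α) u Q * matD (frame β) (matD (frame α) u) Q := by
    show ∑ β, matD (frame β) S Q * matD (frame β) (Gam u u) Q = _
    simp_rw [matD_Gam_self hu, mul_sum]
    refine sum_congr rfl fun β _ => sum_congr rfl fun α _ => ?_
    ring
  -- swap `m_{βα}` for `m_{αβ}` using `hcomm`
  have eSwap : ∑ β, ∑ α, matD (frame β) S Q * matD (frame α) u Q * matD (frame β) (matD (frame α) u) Q =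
      ∑ α, ∑ β, matD (frame β) S Q * matD (frame α) u Q * matD (frame α) (matD (frame β) u) Q := by
    rw [sum_comm]
    have h0 : ∑ α, ∑ β, matD (frame β) S Q * matD (frame α) u Q * matD (frame β) (matD (frame α) u) Q -
        ∑ α, ∑ β, matD (frame β) S Q * matD (frame α) u Q * matD (frame α) (matD (frame β) u) Q = 0 := by
      rw [← sum_sub_distrib]
      simp_rw [← sum_sub_distrib, ← mul_sub]
      exact hcomm
    linarith
  -- regroup `Γ(u, L u)`
  have eB : ∑ α, ∑ β, matD (frame α) u Q *
        (matD (frame α) (matD (frame β) S) Q * matD (frame β) u Q +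
          matD (frame β) S Q * matD (frame α) (matD (frame β) u) Q) =
      ∑ α, ∑ β, matD (frame α) u Q * matD (frame β) u Q * matD (frame α) (matD (frame β) S) Q +
        ∑ α, ∑ β, matD (frame β) S Q * matD (frame α) u Q * matD (frame α) (matD (frame β) u) Q := by
    rw [← sum_add_distrib]
    refine sum_congr rfl fun α _ => ?_
    rw [← sum_add_distrib]
    exact sum_congr rfl fun β _ => by ring
  rw [Gam2, show genL S (Gam u u) Q = Lap (Gam u u) Q + Gam S (Gam u u) Q from rfl, Lap_Gam_self hN hu, eC,
    eSwap, Gam_genL hS hu, eB]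
  ring

/-! ### The curvature-dimension inequality `Γ₂ ≥ K Γ` on `SU(N)` -/

/-- `∑_{αβ} (m_{αβ} - m_{βα})² ≤ 4 ∑_{αβ} m_{αβ}²`. [folklore] -/
theorem sum_sum_sq_sub_swap_le (m : FrameIdx N → FrameIdx N → ℝ) :
    ∑ α, ∑ β, (m α β - m β α) ^ 2 ≤ 4 * ∑ α, ∑ β, m α β ^ 2 := by
  have h : ∀ α β, (m α β - m β α) ^ 2 ≤ 2 * m α β ^ 2 + 2 * m β α ^ 2 := fun α β => by
    nlinarith [sq_nonneg (m α β + m β α)]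
  calc ∑ α, ∑ β, (m α β - m β α) ^ 2 ≤ ∑ α, ∑ β, (2 * m α β ^ 2 + 2 * m β α ^ 2) :=
        sum_le_sum fun α _ => sum_le_sum fun β _ => h α β
    _ = 2 * ∑ α, ∑ β, m α β ^ 2 + 2 * ∑ α, ∑ β, m β α ^ 2 := by
        simp only [sum_add_distrib, mul_sum]
    _ = 4 * ∑ α, ∑ β, m α β ^ 2 := by
        rw [sum_comm (f := fun α β => m β α ^ 2)]
        ring

/-- **The Ricci term**: `∑_{αβ} ([D_α, D_β] u)² = 2N Γ(u,u)` (`Ric_{SU(N)} = N/2` for the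
Hilbert–Schmidt metric, Shen–Zhu–Zhu (4.8) with `α = 2`, after [AGZ10, (F.6)]). [cite: arXiv220412737, (4.8) (p. 19)] -/
theorem sum_sum_sq_comm_matD (hN : N ≠ 0) {u : Matrix (Fin N) (Fin N) ℂ → ℝ} (hu : ContDiff ℝ ∞ u)
    (Q : Matrix (Fin N) (Fin N) ℂ) :
    ∑ α, ∑ β, (matD (frame α) (matD (frame β) u) Q - matD (frame β) (matD (frame α) u) Q) ^ 2 =
      2 * N * Gam u u Q := by
  set Z := frameGrad (dirFun u Q) with hZdef
  have hZ : Zᴴ = -Z := frameGrad_conjTranspose _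
  have hZ0 : Z.trace = 0 := frameGrad_trace hN _
  -- `[D_α, D_β] u (Q) = -Re tr(Y_β W_α)` with `W_α = Z Y_α - Y_α Z`
  have hW : ∀ α β, matD (frame α) (matD (frame β) u) Q - matD (frame β) (matD (frame α) u) Q =
      -(frame β * (Z * frame α - frame α * Z)).trace.re := by
    intro α β
    have h := congrFun (matD_comm hu (frame α) (frame β)) Q
    rw [Pi.sub_apply] at h
    rw [h, ← dirFun_apply, apply_eq_neg_re_trace_mul_frameGrad hN (dirFun u Q)
      (conjTranspose_comm_of_skew (frame_conjTranspose α) (frame_conjTranspose β)) (trace_comm _ _), ← hZdef]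
    congr 2
    rw [Matrix.sub_mul, Matrix.mul_sub, trace_sub, trace_sub]
    have e1 : (frame α * frame β * Z).trace = (frame β * (Z * frame α)).trace := by
      rw [Matrix.mul_assoc, trace_mul_comm, Matrix.mul_assoc]
    have e2 : (frame β * frame α * Z).trace = (frame β * (frame α * Z)).trace := by
      rw [Matrix.mul_assoc]
    rw [e1, e2]
  have hWskew : ∀ α, (Z * frame α - frame α * Z)ᴴ = -(Z * frame α - frame α * Z) := fun α =>
    conjTranspose_comm_of_skew hZ (frame_conjTranspose α)
  simp_rw [hW, neg_sq, sum_sq_re_trace_frame_mul hN (hWskew _) (trace_comm _ _),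
    sum_frobNorm_sq_comm_frame hN hZ hZ0, hZdef, ← Gam_self_eq_frobNorm_sq hN]

/-- The one-link potential `S(Q) = c Re tr(Q B)` and its frame Hessian:
`D_α D_β S (Q) = c Re tr(Q Y_α Y_β B)`. [folklore] -/
theorem matD_matD_potential (c : ℝ) (B : Matrix (Fin N) (Fin N) ℂ) (α β : FrameIdx N)
    (Q : Matrix (Fin N) (Fin N) ℂ) :
    matD (frame α) (matD (frame β) (fun Q => c * (Q * B).trace.re)) Q =
      c * (Q * frame α * frame β * B).trace.re := by
  rw [matD_const_mul_reTrMul]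
  have : (fun Q : Matrix (Fin N) (Fin N) ℂ => c * (Q * frame β * B).trace.re) =
      fun Q => c * (Q * (frame β * B)).trace.re := by
    funext Q; rw [Matrix.mul_assoc]
  rw [this, matD_const_mul_reTrMul, Matrix.mul_assoc]

/-- The potential is smooth. [folklore] -/
theorem contDiff_potential (c : ℝ) (B : Matrix (Fin N) (Fin N) ℂ) :
    ContDiff ℝ ∞ fun Q : Matrix (Fin N) (Fin N) ℂ => c * (Q * B).trace.re :=
  contDiff_const_mul_reTrMul c B

/-- **The Hessian term**: `∑_{αβ} D_α u D_β u D_α D_β S = c Re tr(Q ∇u ∇u B)`. [folklore] -/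
theorem sum_sum_hess_potential (c : ℝ) (B : Matrix (Fin N) (Fin N) ℂ) (u : Matrix (Fin N) (Fin N) ℂ → ℝ)
    (Q : Matrix (Fin N) (Fin N) ℂ) :
    ∑ α, ∑ β, matD (frame α) u Q * matD (frame β) u Q *
        matD (frame α) (matD (frame β) (fun Q => c * (Q * B).trace.re)) Q =
      c * (Q * frameGrad (dirFun u Q) * frameGrad (dirFun u Q) * B).trace.re := by
  simp_rw [matD_matD_potential]
  rw [frameGrad, ← sum_sum_mul_mul_re_trace, mul_sum]
  refine sum_congr rfl fun α _ => ?_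
  rw [mul_sum]
  refine sum_congr rfl fun β _ => ?_
  simp only [dirFun_apply]
  ring

/-- **Bakry–Émery curvature bound for the one-link measure** (Shen–Zhu–Zhu's Bakry–Émery condition
(4.7) with (4.8) and the one-link case of the Hessian bound Lemma 4.1, (4.2)–(4.4)): for
`S(Q) = c Re tr(Q B)` and unitary `Q`,
`Γ₂(u)(Q) ≥ (N/2 - |c| ‖B‖_op) Γ(u,u)(Q)`. [cite: arXiv220412737, Lemma 4.1 (4.2)-(4.4), (4.7)-(4.8)] -/
theorem Gam2_potential_ge (hN : N ≠ 0) (c : ℝ) (B : Matrix (Fin N) (Fin N) ℂ) {u : Matrix (Fin N) (Fin N) ℂ → ℝ}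
    (hu : ContDiff ℝ ∞ u) {Q : Matrix (Fin N) (Fin N) ℂ} (hQ : Q ∈ Matrix.unitaryGroup (Fin N) ℂ) :
    ((N : ℝ) / 2 - |c| * matrixOpNorm B) * Gam u u Q ≤ Gam2 (fun Q => c * (Q * B).trace.re) u Q := by
  rw [Gam2_eq hN (contDiff_potential c B) hu, sum_sum_hess_potential]
  set Z := frameGrad (dirFun u Q)
  have hΓ : Gam u u Q = frobNorm Z ^ 2 := Gam_self_eq_frobNorm_sq hN u Q
  -- Ricci term
  have hRic : (N : ℝ) / 2 * Gam u u Q ≤ ∑ α, ∑ β, matD (frame α) (matD (frame β) u) Q ^ 2 := by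
    have h1 := sum_sum_sq_sub_swap_le (fun α β => matD (frame α) (matD (frame β) u) Q)
    rw [sum_sum_sq_comm_matD hN hu Q] at h1
    linarith
  -- Hessian term
  have hHess : |c * (Q * Z * Z * B).trace.re| ≤ |c| * matrixOpNorm B * Gam u u Q := by
    rw [abs_mul, hΓ]
    have h1 := abs_re_trace_unitary_mul_mul_mul_le hQ Z B
    calc |c| * |(Q * Z * Z * B).trace.re| ≤ |c| * (frobNorm Z ^ 2 * matrixOpNorm B) :=
          mul_le_mul_of_nonneg_left h1 (abs_nonneg c)
      _ = |c| * matrixOpNorm B * frobNorm Z ^ 2 := by ring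
  have hHess' := (abs_le.1 hHess).2
  nlinarith [hRic, hHess', Gam_self_nonneg u Q]

end Calculus


/-! ## Part D: Haar measure on `SU(N)` — integration by parts, symmetry of the generator,
integrated Bochner inequality, and the Poincaré inequality from approximate solvability -/


open scoped Matrix.Norms.Frobenius ContDiff Topology
open Matrix Complex Finset MeasureTheory Filter

variable {N : ℕ}

/-- `SU(N)` as a type. [folklore] -/
abbrev SUN (N : ℕ) : Type := Matrix.specialUnitaryGroup (Fin N) ℂ

/-- Elements of `SU(N)` are unitary. [folklore] -/
theorem SUN.mem_unitaryGroup (g : SUN N) : (g : Matrix (Fin N) (Fin N) ℂ) ∈ Matrix.unitaryGroup (Fin N) ℂ :=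
  Matrix.specialUnitaryGroup_le_unitaryGroup g.2

/-! ### One-parameter subgroups of `SU(N)` -/

/-- `det exp(tY) = 1` for traceless `Y`. [folklore] -/
theorem det_exp_smul_eq_one {Y : Matrix (Fin N) (Fin N) ℂ} (hY0 : Y.trace = 0) (t : ℝ) :
    (NormedSpace.exp (t • Y)).det = 1 := by
  open scoped Matrix.Norms.Operator in
  rw [Literature.Analysis.Matrix.det_exp_eq_exp_trace, trace_smul, hY0, smul_zero, NormedSpace.exp_zero]

/-- The one-parameter subgroup `t ↦ exp(tY)` of `SU(N)` generated by `Y ∈ 𝔰𝔲(N)`. [folklore] -/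
def expSU {Y : Matrix (Fin N) (Fin N) ℂ} (hY : Yᴴ = -Y) (hY0 : Y.trace = 0) (t : ℝ) : SUN N :=
  ⟨NormedSpace.exp (t • Y), Matrix.mem_specialUnitaryGroup_iff.2
    ⟨exp_smul_mem_unitaryGroup hY t, det_exp_smul_eq_one hY0 t⟩⟩

/-- The underlying matrix of `expSU`. [folklore] -/
@[simp] theorem coe_expSU {Y : Matrix (Fin N) (Fin N) ℂ} (hY : Yᴴ = -Y) (hY0 : Y.trace = 0) (t : ℝ) :
    ((expSU hY hY0 t : SUN N) : Matrix (Fin N) (Fin N) ℂ) = NormedSpace.exp (t • Y) := rfl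

/-! ### Integration by parts -/

/-- Continuous functions on `SU(N)` are integrable for finite measures. [folklore] -/
theorem integrable_of_continuous_SUN {φ : SUN N → ℝ} (hφ : Continuous φ) (μ : Measure (SUN N))
    [IsFiniteMeasure μ] : Integrable φ μ :=
  hφ.integrable_of_hasCompactSupport (HasCompactSupport.of_compactSpace _)

/-- Restrictions of smooth ambient functions are continuous on `SU(N)`. [folklore] -/
theorem continuous_restrict {F : Matrix (Fin N) (Fin N) ℂ → ℝ} (hF : ContDiff ℝ ∞ F) :
    Continuous fun g : SUN N => F (g : Matrix (Fin N) (Fin N) ℂ) :=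
  (continuous_of_contDiff hF).comp continuous_subtype_val

/-- **Integration by parts on `SU(N)`**: `∫ D_Y F dσ = 0` for `Y ∈ 𝔰𝔲(N)` and the Haar probability
measure `σ` — right invariance of `σ` under `g ↦ g exp(tY)`, differentiated at `t = 0` under the
integral sign. [folklore] -/
theorem integral_matD_eq_zero {F : Matrix (Fin N) (Fin N) ℂ → ℝ} (hF : ContDiff ℝ ∞ F)
    {Y : Matrix (Fin N) (Fin N) ℂ} (hY : Yᴴ = -Y) (hY0 : Y.trace = 0) :
    ∫ g : SUN N, matD Y F (g : Matrix (Fin N) (Fin N) ℂ) ∂(haarProbability (SUN N)) = 0 := by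
  set μ := haarProbability (SUN N)
  -- the integrand along the flow and its derivative
  set Φ : ℝ → SUN N → ℝ := fun t g => F ((g : Matrix (Fin N) (Fin N) ℂ) * NormedSpace.exp (t • Y)) with hΦ
  set Φ' : ℝ → SUN N → ℝ := fun t g => matD Y F ((g : Matrix (Fin N) (Fin N) ℂ) * NormedSpace.exp (t • Y))
    with hΦ'
  -- `Φ t` is a right translate of `Φ 0`, so its integral is constant
  have hconst : ∀ t, ∫ g, Φ t g ∂μ = ∫ g, Φ 0 g ∂μ := by
    intro t
    have h1 : ∀ g : SUN N, Φ t g = Φ 0 (g * expSU hY hY0 t) := by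
      intro g
      simp only [hΦ, zero_smul, NormedSpace.exp_zero, Matrix.mul_one, Submonoid.coe_mul, coe_expSU]
    simp_rw [h1]
    exact integral_mul_right_eq_self (fun g => Φ 0 g) (expSU hY hY0 t)
  -- continuity
  have hexp : Continuous fun t : ℝ => NormedSpace.exp (t • Y) := by
    open scoped Matrix.Norms.Operator in
    exact NormedSpace.exp_continuous.comp (continuous_id.smul continuous_const)
  have hFc : Continuous F := continuous_of_contDiff hF
  have hDFc : Continuous (matD Y F) := continuous_of_contDiff (contDiff_matD hF Y)
  have hflow : Continuous fun p : ℝ × SUN N => (p.2 : Matrix (Fin N) (Fin N) ℂ) * NormedSpace.exp (p.1 • Y) :=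
    (continuous_subtype_val.comp continuous_snd).mul (hexp.comp continuous_fst)
  have hΦt_cont : ∀ t, Continuous (Φ t) := fun t =>
    hFc.comp (continuous_subtype_val.mul continuous_const)
  have hΦ't_cont : ∀ t, Continuous (Φ' t) := fun t =>
    hDFc.comp (continuous_subtype_val.mul continuous_const)
  have hΦ'_cont : Continuous fun p : ℝ × SUN N => Φ' p.1 p.2 := hDFc.comp hflow
  -- a uniform bound for `Φ'` on `[-1, 1] × SU(N)` by compactness
  obtain ⟨C, hC⟩ : ∃ C, ∀ p ∈ (Metric.closedBall (0 : ℝ) 1) ×ˢ (Set.univ : Set (SUN N)), ‖Φ' p.1 p.2‖ ≤ C :=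
    ((isCompact_closedBall (0 : ℝ) 1).prod isCompact_univ).exists_bound_of_continuousOn hΦ'_cont.continuousOn
  -- pointwise derivative along the flow
  have hderiv : ∀ (g : SUN N) (t : ℝ), HasDerivAt (fun s => Φ s g) (Φ' t g) t := fun g t =>
    hasDerivAt_comp_mul_exp hF (g : Matrix (Fin N) (Fin N) ℂ) Y t
  -- differentiate under the integral sign at `t = 0`
  have hmain := hasDerivAt_integral_of_dominated_loc_of_deriv_le (μ := μ) (F := Φ) (F' := Φ')
    (x₀ := (0 : ℝ)) (s := Metric.ball 0 1) (bound := fun _ => C) (Metric.ball_mem_nhds 0 one_pos)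
    (Eventually.of_forall fun t => (hΦt_cont t).aestronglyMeasurable)
    (integrable_of_continuous_SUN (hΦt_cont 0) μ) (hΦ't_cont 0).aestronglyMeasurable
    (ae_of_all _ fun g t ht => hC (t, g) ⟨Metric.ball_subset_closedBall ht, Set.mem_univ _⟩)
    (integrable_const C) (ae_of_all _ fun g t _ => hderiv g t)
  have hzero : HasDerivAt (fun t => ∫ g, Φ t g ∂μ) 0 0 := by
    have : (fun t => ∫ g, Φ t g ∂μ) = fun _ => ∫ g, Φ 0 g ∂μ := funext hconst
    rw [this]
    exact hasDerivAt_const _ _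
  have heq : ∫ g, Φ' 0 g ∂μ = 0 := hmain.2.unique hzero
  simpa [hΦ'] using heq

/-- IBP for the frame directions. [folklore] -/
theorem integral_matD_frame_eq_zero (hN : N ≠ 0) {F : Matrix (Fin N) (Fin N) ℂ → ℝ} (hF : ContDiff ℝ ∞ F)
    (α : FrameIdx N) :
    ∫ g : SUN N, matD (frame α) F (g : Matrix (Fin N) (Fin N) ℂ) ∂(haarProbability (SUN N)) = 0 :=
  integral_matD_eq_zero hF (frame_conjTranspose α) (frame_trace hN α)

/-! ### Symmetry of the generator with respect to `e^{S} dσ` -/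

section Symmetry

attribute [local instance 2000] matTop

/-- `e^{S} L_S F = ∑_α D_α (e^{S} D_α F)` (pointwise). [folklore] -/
theorem exp_mul_genL_eq_sum {S F : Matrix (Fin N) (Fin N) ℂ → ℝ} (hS : ContDiff ℝ ∞ S) (hF : ContDiff ℝ ∞ F)
    (Q : Matrix (Fin N) (Fin N) ℂ) :
    Real.exp (S Q) * genL S F Q = ∑ α, matD (frame α) (fun Q => Real.exp (S Q) * matD (frame α) F Q) Q := by
  have h : ∀ α : FrameIdx N, matD (frame α) (fun Q => Real.exp (S Q) * matD (frame α) F Q) Q =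
      Real.exp (S Q) * matD (frame α) (matD (frame α) F) Q +
        matD (frame α) F Q * (Real.exp (S Q) * matD (frame α) S Q) := by
    intro α
    rw [matD_fun_mul (hS.exp) (contDiff_matD hF _), matD_exp hS]
  show Real.exp (S Q) * ((∑ α, matD (frame α) (matD (frame α) F) Q) +
    ∑ α, matD (frame α) S Q * matD (frame α) F Q) = _
  simp_rw [h]
  rw [sum_add_distrib, mul_add, mul_sum, mul_sum]
  congr 1
  exact sum_congr rfl fun α _ => by ring

/-- `D_α (F e^{S} D_α G)` summed: `F e^{S} L_S G + e^{S} Γ(F, G)`. [folklore] -/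
theorem mul_exp_mul_genL_add_eq_sum {S F G : Matrix (Fin N) (Fin N) ℂ → ℝ} (hS : ContDiff ℝ ∞ S)
    (hF : ContDiff ℝ ∞ F) (hG : ContDiff ℝ ∞ G) (Q : Matrix (Fin N) (Fin N) ℂ) :
    F Q * (Real.exp (S Q) * genL S G Q) + Real.exp (S Q) * Gam F G Q =
      ∑ α, matD (frame α) (fun Q => F Q * (Real.exp (S Q) * matD (frame α) G Q)) Q := by
  have h : ∀ α : FrameIdx N, matD (frame α) (fun Q => F Q * (Real.exp (S Q) * matD (frame α) G Q)) Q =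
      F Q * matD (frame α) (fun Q => Real.exp (S Q) * matD (frame α) G Q) Q +
        Real.exp (S Q) * matD (frame α) G Q * matD (frame α) F Q := by
    intro α
    rw [matD_fun_mul hF (hS.exp.mul (contDiff_matD hG _))]
  simp only [h, sum_add_distrib, ← mul_sum, ← exp_mul_genL_eq_sum hS hG, Gam]
  rw [mul_sum]
  congr 1
  exact sum_congr rfl fun α _ => by ring

end Symmetry

/-- **`∫ L_S F · e^{S} dσ = 0`**. [folklore] -/
theorem integral_exp_mul_genL_eq_zero (hN : N ≠ 0) {S F : Matrix (Fin N) (Fin N) ℂ → ℝ} (hS : ContDiff ℝ ∞ S)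
    (hF : ContDiff ℝ ∞ F) :
    ∫ g : SUN N, Real.exp (S g) * genL S F g ∂(haarProbability (SUN N)) = 0 := by
  simp_rw [exp_mul_genL_eq_sum hS hF]
  rw [integral_finsetSum _ fun α _ => integrable_of_continuous_SUN
    (continuous_restrict (contDiff_matD (hS.exp.mul (contDiff_matD hF _)) _)) _]
  exact sum_eq_zero fun α _ => integral_matD_frame_eq_zero hN (hS.exp.mul (contDiff_matD hF _)) α

/-- **Symmetry / integration by parts for `L_S`**:
`∫ F · L_S G · e^{S} dσ = -∫ Γ(F, G) e^{S} dσ`. [folklore] -/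
theorem integral_mul_exp_mul_genL (hN : N ≠ 0) {S F G : Matrix (Fin N) (Fin N) ℂ → ℝ} (hS : ContDiff ℝ ∞ S)
    (hF : ContDiff ℝ ∞ F) (hG : ContDiff ℝ ∞ G) :
    ∫ g : SUN N, F g * (Real.exp (S g) * genL S G g) ∂(haarProbability (SUN N)) =
      -∫ g : SUN N, Real.exp (S g) * Gam F G g ∂(haarProbability (SUN N)) := by
  rw [eq_neg_iff_add_eq_zero, ← integral_add]
  · simp_rw [mul_exp_mul_genL_add_eq_sum hS hF hG]
    rw [integral_finsetSum _ fun α _ => integrable_of_continuous_SUN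
      (continuous_restrict (contDiff_matD (hF.mul (hS.exp.mul (contDiff_matD hG _))) _)) _]
    exact sum_eq_zero fun α _ => integral_matD_frame_eq_zero hN (hF.mul (hS.exp.mul (contDiff_matD hG _))) α
  · exact integrable_of_continuous_SUN (continuous_restrict (hF.mul (hS.exp.mul (contDiff_genL hS hG)))) _
  · exact integrable_of_continuous_SUN (continuous_restrict (hS.exp.mul (contDiff_Gam hF hG))) _

/-- **Integrated Bochner formula**: `∫ (L_S u)² e^{S} dσ = ∫ Γ₂(u) e^{S} dσ`. [folklore] -/
theorem integral_exp_mul_genL_sq (hN : N ≠ 0) {S u : Matrix (Fin N) (Fin N) ℂ → ℝ} (hS : ContDiff ℝ ∞ S)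
    (hu : ContDiff ℝ ∞ u) :
    ∫ g : SUN N, Real.exp (S g) * genL S u g ^ 2 ∂(haarProbability (SUN N)) =
      ∫ g : SUN N, Real.exp (S g) * Gam2 S u g ∂(haarProbability (SUN N)) := by
  have h1 : ∫ g : SUN N, Real.exp (S g) * genL S (Gam u u) g ∂(haarProbability (SUN N)) = 0 :=
    integral_exp_mul_genL_eq_zero hN hS (contDiff_Gam hu hu)
  have h2 := integral_mul_exp_mul_genL hN hS (contDiff_genL hS hu) hu
  have h3 : ∫ g : SUN N, Real.exp (S g) * Gam2 S u g ∂(haarProbability (SUN N)) =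
      (1 / 2) * ∫ g : SUN N, Real.exp (S g) * genL S (Gam u u) g ∂(haarProbability (SUN N)) -
        ∫ g : SUN N, Real.exp (S g) * Gam (genL S u) u g ∂(haarProbability (SUN N)) := by
    rw [← integral_const_mul, ← integral_sub]
    · refine integral_congr_ae (ae_of_all _ fun g => ?_)
      simp only [Gam2, Gam_comm u (genL S u)]
      ring
    · exact (integrable_of_continuous_SUN (continuous_restrict (hS.exp.mul (contDiff_genL hS
        (contDiff_Gam hu hu)))) _).const_mul _
    · exact integrable_of_continuous_SUN (continuous_restrict (hS.exp.mul (contDiff_Gam (contDiff_genL hS hu) hu))) _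
  rw [h3, h1, mul_zero, zero_sub, ← h2]
  refine integral_congr_ae (ae_of_all _ fun g => ?_)
  simp only
  ring

/-- **Integrated curvature-dimension inequality** for the one-link potential `S(Q) = c Re tr(Q B)`:
`(N/2 - |c| ‖B‖_op) ∫ Γ(u,u) e^{S} dσ ≤ ∫ (L_S u)² e^{S} dσ` (the integrated form of Shen–Zhu–Zhu's
Bakry–Émery condition (4.7) for `Λ = {e}`).
[cite: arXiv220412737, (4.7) (p. 19)] -/
theorem integral_exp_mul_Gam_le (hN : N ≠ 0) (c : ℝ) (B : Matrix (Fin N) (Fin N) ℂ) {u : Matrix (Fin N) (Fin N) ℂ → ℝ}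
    (hu : ContDiff ℝ ∞ u) :
    ((N : ℝ) / 2 - |c| * matrixOpNorm B) *
        ∫ g : SUN N, Real.exp (c * ((g : Matrix (Fin N) (Fin N) ℂ) * B).trace.re) * Gam u u g ∂(haarProbability (SUN N)) ≤
      ∫ g : SUN N, Real.exp (c * ((g : Matrix (Fin N) (Fin N) ℂ) * B).trace.re) *
        genL (fun Q => c * (Q * B).trace.re) u g ^ 2 ∂(haarProbability (SUN N)) := by
  have hS := contDiff_potential (N := N) c B
  rw [integral_exp_mul_genL_sq hN hS hu, ← integral_const_mul]
  refine integral_mono ?_ ?_ fun g => ?_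
  · exact (integrable_of_continuous_SUN (continuous_restrict (hS.exp.mul (contDiff_Gam hu hu))) _).const_mul _
  · have hc : ContDiff ℝ ∞ (Gam2 (fun Q => c * (Q * B).trace.re) u) := by
      have : Gam2 (fun Q => c * (Q * B).trace.re) u =
          fun Q => (1 / 2) * genL (fun Q => c * (Q * B).trace.re) (Gam u u) Q -
            Gam u (genL (fun Q => c * (Q * B).trace.re) u) Q := rfl
      rw [this]
      exact (contDiff_const.mul (contDiff_genL hS (contDiff_Gam hu hu))).sub
        (contDiff_Gam hu (contDiff_genL hS hu))
    exact integrable_of_continuous_SUN (continuous_restrict (hS.exp.mul hc)) _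
  · have h := Gam2_potential_ge hN c B hu (SUN.mem_unitaryGroup g)
    have hpos := Real.exp_pos (c * ((g : Matrix (Fin N) (Fin N) ℂ) * B).trace.re)
    calc ((N : ℝ) / 2 - |c| * matrixOpNorm B) * (Real.exp (c * ((g : Matrix (Fin N) (Fin N) ℂ) * B).trace.re) * Gam u u g)
        = Real.exp (c * ((g : Matrix (Fin N) (Fin N) ℂ) * B).trace.re) *
            (((N : ℝ) / 2 - |c| * matrixOpNorm B) * Gam u u g) := by ring
      _ ≤ Real.exp (c * ((g : Matrix (Fin N) (Fin N) ℂ) * B).trace.re) * Gam2 (fun Q => c * (Q * B).trace.re) u g :=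
          mul_le_mul_of_nonneg_left h hpos.le


/-! ## Part E: Cauchy–Schwarz and the Poincaré inequality from approximate solvability -/


open scoped Matrix.Norms.Frobenius ContDiff Topology
open Matrix Complex Finset MeasureTheory Filter

variable {N : ℕ}

/-- **Cauchy–Schwarz** for integrals of continuous functions on `SU(N)`:
`|∫ f g| ≤ (∫ f²)^{1/2} (∫ g²)^{1/2}`. [folklore] -/
theorem abs_integral_mul_le_sqrt {f g : SUN N → ℝ} (hf : Continuous f) (hg : Continuous g)
    (μ : Measure (SUN N)) [IsFiniteMeasure μ] :
    |∫ x, f x * g x ∂μ| ≤ Real.sqrt (∫ x, f x ^ 2 ∂μ) * Real.sqrt (∫ x, g x ^ 2 ∂μ) := by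
  set A := ∫ x, f x ^ 2 ∂μ with hA
  set Bi := ∫ x, g x ^ 2 ∂μ with hB
  have hA0 : 0 ≤ A := integral_nonneg fun x => sq_nonneg _
  have hB0 : 0 ≤ Bi := integral_nonneg fun x => sq_nonneg _
  have hfi : Integrable (fun x => f x ^ 2) μ := integrable_of_continuous_SUN (hf.pow 2) μ
  have hgi : Integrable (fun x => g x ^ 2) μ := integrable_of_continuous_SUN (hg.pow 2) μ
  have hfgi : Integrable (fun x => f x * g x) μ := integrable_of_continuous_SUN (hf.mul hg) μ
  -- AM–GM for every `t > 0`
  have hamgm : ∀ t : ℝ, 0 < t → 2 * |∫ x, f x * g x ∂μ| ≤ t * A + Bi / t := by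
    intro t ht
    calc 2 * |∫ x, f x * g x ∂μ| ≤ 2 * ∫ x, |f x * g x| ∂μ := by
          have := abs_integral_le_integral_abs (f := fun x => f x * g x) (μ := μ)
          linarith
      _ = ∫ x, 2 * |f x * g x| ∂μ := (integral_const_mul _ _).symm
      _ ≤ ∫ x, (t * f x ^ 2 + g x ^ 2 / t) ∂μ := by
          refine integral_mono (hfgi.abs.const_mul 2) ((hfi.const_mul t).add (hgi.div_const t)) fun x => ?_
          exact two_mul_abs_mul_le ht (f x) (g x)
      _ = t * A + Bi / t := by
          rw [integral_add (hfi.const_mul t) (hgi.div_const t), integral_const_mul, integral_div]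
  -- the degenerate cases
  by_cases hA1 : A = 0
  · have hf0 : (fun x => f x ^ 2) =ᵐ[μ] 0 := (integral_eq_zero_iff_of_nonneg (fun x => sq_nonneg _) hfi).1 hA1
    have hfg0 : (fun x => f x * g x) =ᵐ[μ] 0 := hf0.mono fun x hx => by
      have : f x = 0 := pow_eq_zero_iff (n := 2) (by norm_num) |>.1 hx
      simp [this]
    rw [integral_congr_ae hfg0]
    simp only [Pi.zero_apply, integral_zero, abs_zero]
    positivity
  by_cases hB1 : Bi = 0
  · have hg0 : (fun x => g x ^ 2) =ᵐ[μ] 0 := (integral_eq_zero_iff_of_nonneg (fun x => sq_nonneg _) hgi).1 hB1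
    have hfg0 : (fun x => f x * g x) =ᵐ[μ] 0 := hg0.mono fun x hx => by
      have : g x = 0 := pow_eq_zero_iff (n := 2) (by norm_num) |>.1 hx
      simp [this]
    rw [integral_congr_ae hfg0]
    simp only [Pi.zero_apply, integral_zero, abs_zero]
    positivity
  -- optimise `t = √B / √A`
  have hApos : 0 < A := lt_of_le_of_ne hA0 (Ne.symm hA1)
  have hBpos : 0 < Bi := lt_of_le_of_ne hB0 (Ne.symm hB1)
  have hsA : 0 < Real.sqrt A := Real.sqrt_pos.2 hApos
  have hsB : 0 < Real.sqrt Bi := Real.sqrt_pos.2 hBpos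
  have h := hamgm (Real.sqrt Bi / Real.sqrt A) (div_pos hsB hsA)
  have hAne : Real.sqrt A ≠ 0 := hsA.ne'
  have hBne : Real.sqrt Bi ≠ 0 := hsB.ne'
  have hAA : A = Real.sqrt A * Real.sqrt A := (Real.mul_self_sqrt hA0).symm
  have hBB : Bi = Real.sqrt Bi * Real.sqrt Bi := (Real.mul_self_sqrt hB0).symm
  have e1 : Real.sqrt Bi / Real.sqrt A * A = Real.sqrt A * Real.sqrt Bi := by
    calc Real.sqrt Bi / Real.sqrt A * A = Real.sqrt Bi / Real.sqrt A * (Real.sqrt A * Real.sqrt A) := by rw [← hAA]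
      _ = Real.sqrt A * Real.sqrt Bi := by field_simp
  have e2 : Bi / (Real.sqrt Bi / Real.sqrt A) = Real.sqrt A * Real.sqrt Bi := by
    calc Bi / (Real.sqrt Bi / Real.sqrt A) = Real.sqrt Bi * Real.sqrt Bi / (Real.sqrt Bi / Real.sqrt A) := by
          rw [← hBB]
      _ = Real.sqrt A * Real.sqrt Bi := by field_simp
  rw [e1, e2] at h
  linarith

/-- Square root of the weight. [folklore] -/
theorem sqrt_exp_mul_self (x : ℝ) : Real.sqrt (Real.exp x) * Real.sqrt (Real.exp x) = Real.exp x :=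
  Real.mul_self_sqrt (Real.exp_pos x).le

/-- **Weighted Cauchy–Schwarz**: `|∫ w f g| ≤ (∫ w f²)^{1/2} (∫ w g²)^{1/2}` for the weight
`w = e^{S}`. [folklore] -/
theorem abs_integral_exp_mul_mul_le {S : SUN N → ℝ} {f g : SUN N → ℝ} (hS : Continuous S) (hf : Continuous f)
    (hg : Continuous g) (μ : Measure (SUN N)) [IsFiniteMeasure μ] :
    |∫ x, Real.exp (S x) * (f x * g x) ∂μ| ≤
      Real.sqrt (∫ x, Real.exp (S x) * f x ^ 2 ∂μ) * Real.sqrt (∫ x, Real.exp (S x) * g x ^ 2 ∂μ) := by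
  have hw : Continuous fun x => Real.sqrt (Real.exp (S x)) := Real.continuous_sqrt.comp (Real.continuous_exp.comp hS)
  have h := abs_integral_mul_le_sqrt (f := fun x => Real.sqrt (Real.exp (S x)) * f x)
    (g := fun x => Real.sqrt (Real.exp (S x)) * g x) (hw.mul hf) (hw.mul hg) μ
  have e0 : (fun x => Real.exp (S x) * (f x * g x)) =
      fun x => Real.sqrt (Real.exp (S x)) * f x * (Real.sqrt (Real.exp (S x)) * g x) := by
    funext x
    linear_combination (-(f x * g x)) * sqrt_exp_mul_self (S x)
  have e1 : (fun x => Real.exp (S x) * f x ^ 2) = fun x => (Real.sqrt (Real.exp (S x)) * f x) ^ 2 := by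
    funext x; rw [mul_pow, Real.sq_sqrt (Real.exp_pos _).le]
  have e2 : (fun x => Real.exp (S x) * g x ^ 2) = fun x => (Real.sqrt (Real.exp (S x)) * g x) ^ 2 := by
    funext x; rw [mul_pow, Real.sq_sqrt (Real.exp_pos _).le]
  rw [e0, e1, e2]
  exact h

/-- **Weighted Cauchy–Schwarz for `Γ`**: `|∫ w Γ(u,v)| ≤ (∫ w Γ(u,u))^{1/2} (∫ w Γ(v,v))^{1/2}`. [folklore] -/
theorem abs_integral_exp_mul_Gam_le {S u v : Matrix (Fin N) (Fin N) ℂ → ℝ} (hS : ContDiff ℝ ∞ S)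
    (hu : ContDiff ℝ ∞ u) (hv : ContDiff ℝ ∞ v) (μ : Measure (SUN N)) [IsFiniteMeasure μ] :
    |∫ g : SUN N, Real.exp (S g) * Gam u v g ∂μ| ≤
      Real.sqrt (∫ g : SUN N, Real.exp (S g) * Gam u u g ∂μ) *
        Real.sqrt (∫ g : SUN N, Real.exp (S g) * Gam v v g ∂μ) := by
  have hSc := continuous_restrict hS
  have hwu : Continuous fun g : SUN N => Real.sqrt (Real.exp (S g) * Gam u u g) :=
    Real.continuous_sqrt.comp ((Real.continuous_exp.comp hSc).mul (continuous_restrict (contDiff_Gam hu hu)))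
  have hwv : Continuous fun g : SUN N => Real.sqrt (Real.exp (S g) * Gam v v g) :=
    Real.continuous_sqrt.comp ((Real.continuous_exp.comp hSc).mul (continuous_restrict (contDiff_Gam hv hv)))
  have h := abs_integral_mul_le_sqrt hwu hwv μ
  have hnu : ∀ g : SUN N, 0 ≤ Real.exp (S g) * Gam u u g := fun g =>
    mul_nonneg (Real.exp_pos _).le (Gam_self_nonneg _ _)
  have hnv : ∀ g : SUN N, 0 ≤ Real.exp (S g) * Gam v v g := fun g =>
    mul_nonneg (Real.exp_pos _).le (Gam_self_nonneg _ _)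
  simp only [Real.sq_sqrt (hnu _), Real.sq_sqrt (hnv _)] at h
  refine le_trans ?_ ((le_abs_self _).trans h)
  -- `|∫ w Γ(u,v)| ≤ ∫ √(wΓ(u,u)) √(wΓ(v,v))`
  calc |∫ g : SUN N, Real.exp (S g) * Gam u v g ∂μ| ≤ ∫ g : SUN N, |Real.exp (S g) * Gam u v g| ∂μ :=
        abs_integral_le_integral_abs
    _ ≤ ∫ g : SUN N, Real.sqrt (Real.exp (S g) * Gam u u g) * Real.sqrt (Real.exp (S g) * Gam v v g) ∂μ := by
        refine integral_mono (integrable_of_continuous_SUN ((Real.continuous_exp.comp hSc).mul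
          (continuous_restrict (contDiff_Gam hu hv))).abs μ) (integrable_of_continuous_SUN (hwu.mul hwv) μ)
          fun g => ?_
        rw [← Real.sqrt_mul (hnu g), abs_mul, abs_of_pos (Real.exp_pos _)]
        have hG := abs_Gam_le u v (g : Matrix (Fin N) (Fin N) ℂ)
        rw [← Real.sqrt_mul (Gam_self_nonneg _ _)] at hG
        calc Real.exp (S g) * |Gam u v g| ≤ Real.exp (S g) * Real.sqrt (Gam u u g * Gam v v g) :=
              mul_le_mul_of_nonneg_left hG (Real.exp_pos _).le
          _ = Real.sqrt (Real.exp (S g) * Gam u u g * (Real.exp (S g) * Gam v v g)) := by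
              rw [show Real.exp (S ↑g) * Gam u u ↑g * (Real.exp (S ↑g) * Gam v v ↑g) =
                  (Real.exp (S g)) ^ 2 * (Gam u u g * Gam v v g) by ring,
                Real.sqrt_mul (sq_nonneg _), Real.sqrt_sq (Real.exp_pos _).le]

/-- **Poincaré inequality from approximate solvability of the Poisson equation** (the duality
argument replacing the spectral theorem): let `S(Q) = c Re tr(Q B)`, `K = N/2 - |c| ‖B‖_op > 0`,
`w = e^{S}`, `u` smooth, `m` a constant (necessarily its `w dσ`-mean), and suppose there are smooth
`v_k` with `∫ w (L_S v_k - (u - m))² dσ → 0`. Then `K ∫ w (u - m)² dσ ≤ ∫ w Γ(u,u) dσ`.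
Proof: `‖u₀‖² = -∫ w Γ(u, v_k) + ⟨u₀, u₀ - L v_k⟩`, Cauchy–Schwarz, and the integrated Bochner
inequality `K ∫ w Γ(v_k, v_k) ≤ ∫ w (L v_k)²`. [folklore] -/
theorem poincare_of_approx (hN : N ≠ 0) (c : ℝ) (B : Matrix (Fin N) (Fin N) ℂ)
    (hK : 0 < (N : ℝ) / 2 - |c| * matrixOpNorm B) {u : Matrix (Fin N) (Fin N) ℂ → ℝ} (hu : ContDiff ℝ ∞ u) (m : ℝ)
    (v : ℕ → Matrix (Fin N) (Fin N) ℂ → ℝ) (hv : ∀ k, ContDiff ℝ ∞ (v k))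
    (hconv : Tendsto (fun k => ∫ g : SUN N, Real.exp (c * ((g : Matrix (Fin N) (Fin N) ℂ) * B).trace.re) *
      (genL (fun Q => c * (Q * B).trace.re) (v k) g - (u g - m)) ^ 2 ∂(haarProbability (SUN N))) atTop (𝓝 0)) :
    ((N : ℝ) / 2 - |c| * matrixOpNorm B) *
        ∫ g : SUN N, Real.exp (c * ((g : Matrix (Fin N) (Fin N) ℂ) * B).trace.re) * (u g - m) ^ 2
          ∂(haarProbability (SUN N)) ≤
      ∫ g : SUN N, Real.exp (c * ((g : Matrix (Fin N) (Fin N) ℂ) * B).trace.re) * Gam u u g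
        ∂(haarProbability (SUN N)) := by
  set σ := haarProbability (SUN N) with hσ
  set S : Matrix (Fin N) (Fin N) ℂ → ℝ := fun Q => c * (Q * B).trace.re with hSdef
  set K : ℝ := (N : ℝ) / 2 - |c| * matrixOpNorm B with hKdef
  have hS : ContDiff ℝ ∞ S := contDiff_potential c B
  have hSc : Continuous fun g : SUN N => S g := continuous_restrict hS
  have hu0 : ContDiff ℝ ∞ (fun Q => u Q - m) := hu.sub contDiff_const
  -- the quantities
  set A : ℝ := ∫ g : SUN N, Real.exp (S g) * (u g - m) ^ 2 ∂σ with hAdef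
  set G : ℝ := ∫ g : SUN N, Real.exp (S g) * Gam u u g ∂σ with hGdef
  set e : ℕ → ℝ := fun k => ∫ g : SUN N, Real.exp (S g) * (genL S (v k) g - (u g - m)) ^ 2 ∂σ with hedef
  have hA0 : 0 ≤ A := integral_nonneg fun g => mul_nonneg (Real.exp_pos _).le (sq_nonneg _)
  have hG0 : 0 ≤ G := integral_nonneg fun g => mul_nonneg (Real.exp_pos _).le (Gam_self_nonneg _ _)
  have he0 : ∀ k, 0 ≤ e k := fun k => integral_nonneg fun g => mul_nonneg (Real.exp_pos _).le (sq_nonneg _)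
  change K * A ≤ G
  -- the key estimate for each `k`
  have hkey : ∀ k, A ≤ Real.sqrt (G / K) * (Real.sqrt A + Real.sqrt (e k)) + Real.sqrt A * Real.sqrt (e k) := by
    intro k
    have hvk := hv k
    have hLc : Continuous fun g : SUN N => genL S (v k) g := continuous_restrict (contDiff_genL hS hvk)
    have huc : Continuous fun g : SUN N => u g - m := continuous_restrict hu0
    have hwc : Continuous fun g : SUN N => Real.exp (S g) := Real.continuous_exp.comp hSc
    -- Step 1: `A = ∫ w (u-m) L v_k + ∫ w (u-m) ((u-m) - L v_k)`
    have i1 : Integrable (fun g : SUN N => Real.exp (S g) * ((u g - m) * genL S (v k) g)) σ :=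
      integrable_of_continuous_SUN (hwc.mul (huc.mul hLc)) σ
    have i2 : Integrable (fun g : SUN N => Real.exp (S g) * ((u g - m) * ((u g - m) - genL S (v k) g))) σ :=
      integrable_of_continuous_SUN (hwc.mul (huc.mul (huc.sub hLc))) σ
    have hsplit : A = ∫ g : SUN N, Real.exp (S g) * ((u g - m) * genL S (v k) g) ∂σ +
        ∫ g : SUN N, Real.exp (S g) * ((u g - m) * ((u g - m) - genL S (v k) g)) ∂σ := by
      rw [← integral_add i1 i2]
      refine integral_congr_ae (ae_of_all _ fun g => ?_)
      ring
    -- Step 2: `∫ w (u-m) L v_k = -∫ w Γ(u, v_k)` (symmetry, `∫ w L v_k = 0`, and `D(u - m) = D u`)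
    have hstep2 : ∫ g : SUN N, Real.exp (S g) * ((u g - m) * genL S (v k) g) ∂σ =
        -∫ g : SUN N, Real.exp (S g) * Gam u (v k) g ∂σ := by
      have h1 := integral_mul_exp_mul_genL hN hS hu hvk
      have h2 := integral_exp_mul_genL_eq_zero hN hS hvk
      have : ∫ g : SUN N, Real.exp (S g) * ((u g - m) * genL S (v k) g) ∂σ =
          ∫ g : SUN N, u g * (Real.exp (S g) * genL S (v k) g) ∂σ -
            m * ∫ g : SUN N, Real.exp (S g) * genL S (v k) g ∂σ := by
        have i3 : Integrable (fun g : SUN N => u g * (Real.exp (S g) * genL S (v k) g)) σ :=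
          integrable_of_continuous_SUN ((continuous_restrict hu).mul (hwc.mul hLc)) σ
        have i4 : Integrable (fun g : SUN N => m * (Real.exp (S g) * genL S (v k) g)) σ :=
          (integrable_of_continuous_SUN (hwc.mul hLc) σ).const_mul m
        rw [← integral_const_mul, ← integral_sub i3 i4]
        refine integral_congr_ae (ae_of_all _ fun g => ?_)
        ring
      rw [this, h1, h2, mul_zero, sub_zero]
    -- Step 3 & 4: `|∫ w Γ(u,v_k)| ≤ √G √(∫ w Γ(v_k,v_k)) ≤ √G √((1/K) ∫ w (L v_k)²)`
    have hstep3 := abs_integral_exp_mul_Gam_le hS hu hvk σ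
    have hstep4 : ∫ g : SUN N, Real.exp (S g) * Gam (v k) (v k) g ∂σ ≤
        (1 / K) * ∫ g : SUN N, Real.exp (S g) * genL S (v k) g ^ 2 ∂σ := by
      have h := integral_exp_mul_Gam_le hN c B hvk
      rw [← hKdef] at h
      rw [one_div, ← div_eq_inv_mul, le_div_iff₀ hK, mul_comm]
      exact h
    -- Step 5: `|∫ w (u-m)((u-m) - L v_k)| ≤ √A √(e k)`
    have hstep5 : |∫ g : SUN N, Real.exp (S g) * ((u g - m) * ((u g - m) - genL S (v k) g)) ∂σ| ≤
        Real.sqrt A * Real.sqrt (e k) := by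
      have h := abs_integral_exp_mul_mul_le (f := fun g : SUN N => u g - m)
        (g := fun g : SUN N => (u g - m) - genL S (v k) g) hSc huc (huc.sub hLc) σ
      have : ∫ g : SUN N, Real.exp (S g) * ((u g - m) - genL S (v k) g) ^ 2 ∂σ = e k := by
        simp only [hedef]
        refine integral_congr_ae (ae_of_all _ fun g => ?_)
        ring
      rwa [this] at h
    -- Step 6: `∫ w (L v_k)² ≤ (√A + √(e k))²`
    have hstep6 : ∫ g : SUN N, Real.exp (S g) * genL S (v k) g ^ 2 ∂σ ≤ (Real.sqrt A + Real.sqrt (e k)) ^ 2 := by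
      have hcs := abs_integral_exp_mul_mul_le (f := fun g : SUN N => u g - m)
        (g := fun g : SUN N => genL S (v k) g - (u g - m)) hSc huc (hLc.sub huc) σ
      have hek : ∫ g : SUN N, Real.exp (S g) * (genL S (v k) g - (u g - m)) ^ 2 ∂σ = e k := rfl
      rw [hek] at hcs
      have hexp : ∫ g : SUN N, Real.exp (S g) * genL S (v k) g ^ 2 ∂σ =
          A + 2 * ∫ g : SUN N, Real.exp (S g) * ((u g - m) * (genL S (v k) g - (u g - m))) ∂σ +
            ∫ g : SUN N, Real.exp (S g) * (genL S (v k) g - (u g - m)) ^ 2 ∂σ := by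
        have j1 : Integrable (fun g : SUN N => Real.exp (S g) * (u g - m) ^ 2) σ :=
          integrable_of_continuous_SUN (hwc.mul (huc.pow 2)) σ
        have j2 : Integrable (fun g : SUN N => 2 * (Real.exp (S g) * ((u g - m) * (genL S (v k) g - (u g - m))))) σ :=
          (integrable_of_continuous_SUN (hwc.mul (huc.mul (hLc.sub huc))) σ).const_mul 2
        have j12 : Integrable (fun g : SUN N => Real.exp (S g) * (u g - m) ^ 2 +
            2 * (Real.exp (S g) * ((u g - m) * (genL S (v k) g - (u g - m))))) σ := j1.add j2
        have j3 : Integrable (fun g : SUN N => Real.exp (S g) * (genL S (v k) g - (u g - m)) ^ 2) σ :=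
          integrable_of_continuous_SUN (hwc.mul ((hLc.sub huc).pow 2)) σ
        rw [← integral_const_mul, hAdef, ← integral_add j1 j2, ← integral_add j12 j3]
        refine integral_congr_ae (ae_of_all _ fun g => ?_)
        ring
      have hek : ∫ g : SUN N, Real.exp (S g) * (genL S (v k) g - (u g - m)) ^ 2 ∂σ = e k := rfl
      rw [hexp, hek, add_sq, Real.sq_sqrt hA0, Real.sq_sqrt (he0 k)]
      have := (abs_le.1 hcs).2
      nlinarith
    -- combine
    have h34 : |∫ g : SUN N, Real.exp (S g) * Gam u (v k) g ∂σ| ≤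
        Real.sqrt G * Real.sqrt ((1 / K) * (Real.sqrt A + Real.sqrt (e k)) ^ 2) := by
      refine hstep3.trans (mul_le_mul_of_nonneg_left (Real.sqrt_le_sqrt (hstep4.trans ?_)) (Real.sqrt_nonneg _))
      exact mul_le_mul_of_nonneg_left hstep6 (by positivity)
    have hsqrt : Real.sqrt ((1 / K) * (Real.sqrt A + Real.sqrt (e k)) ^ 2) =
        Real.sqrt (1 / K) * (Real.sqrt A + Real.sqrt (e k)) := by
      rw [Real.sqrt_mul (by positivity), Real.sqrt_sq (by positivity)]
    rw [hsqrt] at h34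
    have hGK : Real.sqrt G * (Real.sqrt (1 / K) * (Real.sqrt A + Real.sqrt (e k))) =
        Real.sqrt (G / K) * (Real.sqrt A + Real.sqrt (e k)) := by
      rw [← mul_assoc, ← Real.sqrt_mul hG0, ← div_eq_mul_one_div]
    rw [hGK] at h34
    have h2' := (abs_le.1 h34).1
    have h5' := (abs_le.1 hstep5).2
    linarith [hsplit, hstep2, h2', h5']
  -- pass to the limit `e k → 0`
  have hlim : Tendsto (fun k => Real.sqrt (G / K) * (Real.sqrt A + Real.sqrt (e k)) + Real.sqrt A * Real.sqrt (e k))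
      atTop (𝓝 (Real.sqrt (G / K) * (Real.sqrt A + Real.sqrt 0) + Real.sqrt A * Real.sqrt 0)) := by
    have hse : Tendsto (fun k => Real.sqrt (e k)) atTop (𝓝 (Real.sqrt 0)) :=
      (Real.continuous_sqrt.tendsto 0).comp hconv
    exact ((tendsto_const_nhds.add hse).const_mul _).add (hse.const_mul _)
  rw [Real.sqrt_zero, add_zero, mul_zero, add_zero] at hlim
  have hAle : A ≤ Real.sqrt (G / K) * Real.sqrt A := ge_of_tendsto' hlim hkey
  -- `A ≤ √(G/K) √A ⇒ K A ≤ G`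
  by_cases hA1 : Real.sqrt A = 0
  · have : A = 0 := by rwa [Real.sqrt_eq_zero hA0] at hA1
    rw [this, mul_zero]; exact hG0
  · have hsApos : 0 < Real.sqrt A := lt_of_le_of_ne (Real.sqrt_nonneg A) (Ne.symm hA1)
    have h1 : Real.sqrt A * Real.sqrt A ≤ Real.sqrt (G / K) * Real.sqrt A := by rwa [Real.mul_self_sqrt hA0]
    have h2 : Real.sqrt A ≤ Real.sqrt (G / K) := le_of_mul_le_mul_right h1 hsApos
    have h3 : A ≤ G / K := by
      calc A = Real.sqrt A ^ 2 := (Real.sq_sqrt hA0).symm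
        _ ≤ Real.sqrt (G / K) ^ 2 := pow_le_pow_left₀ (Real.sqrt_nonneg A) h2 2
        _ = G / K := Real.sq_sqrt (div_nonneg hG0 hK.le)
    rwa [le_div_iff₀ hK, mul_comm] at h3


/-! ## Part F: polynomial functions on `M_N(ℂ)` (finite-dimensional `Δ`-invariant subspaces) -/


open scoped Matrix.Norms.Frobenius ContDiff Topology
open Matrix Complex Finset MeasureTheory Filter

variable {N : ℕ}

/-! ### Real coordinates -/

/-- Index set of the real coordinates `Re Q_{ab}`, `Im Q_{ab}` of `M_N(ℂ)`. [folklore] -/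
abbrev CoordIdx (N : ℕ) : Type := Fin N × Fin N × Bool

/-- The matrix `M_κ` with `coordinate_κ(Q) = Re tr(Q M_κ)`. [folklore] -/
def coordMat : CoordIdx N → Matrix (Fin N) (Fin N) ℂ
  | (a, b, true) => E b a
  | (a, b, false) => (-I) • E b a

/-- The real coordinate functions `Q ↦ Re Q_{ab}`, `Q ↦ Im Q_{ab}`, written as `Re tr(Q M_κ)`. [folklore] -/
def coordFn (κ : CoordIdx N) : Matrix (Fin N) (Fin N) ℂ → ℝ := fun Q => (Q * coordMat κ).trace.re

/-- `Re tr(Q E_{ba}) = Re Q_{ab}`. [folklore] -/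
theorem coordFn_true (a b : Fin N) (Q : Matrix (Fin N) (Fin N) ℂ) : coordFn (a, b, true) Q = (Q a b).re := by
  simp [coordFn, coordMat, Matrix.trace_mul_single]

/-- `Re tr(Q (-i E_{ba})) = Im Q_{ab}`. [folklore] -/
theorem coordFn_false (a b : Fin N) (Q : Matrix (Fin N) (Fin N) ℂ) : coordFn (a, b, false) Q = (Q a b).im := by
  simp [coordFn, coordMat, Matrix.trace_mul_single, Complex.mul_re]

/-- `Re tr(Q M)` in coordinates. [folklore] -/
theorem re_trace_mul_eq_sum (Q M : Matrix (Fin N) (Fin N) ℂ) :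
    (Q * M).trace.re = ∑ a, ∑ b, ((Q a b).re * (M b a).re - (Q a b).im * (M b a).im) := by
  simp only [Matrix.trace, Matrix.diag_apply, Matrix.mul_apply, Complex.re_sum, Complex.mul_re]

/-- The span of the coordinate functions: all `Q ↦ Re tr(Q M)`. [folklore] -/
theorem reTrMul_mem_span_coordFn (M : Matrix (Fin N) (Fin N) ℂ) :
    (fun Q : Matrix (Fin N) (Fin N) ℂ => (Q * M).trace.re) ∈ Submodule.span ℝ (Set.range (coordFn (N := N))) := by
  have h : (fun Q : Matrix (Fin N) (Fin N) ℂ => (Q * M).trace.re) =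
      ∑ a, ∑ b, ((M b a).re • coordFn (a, b, true) + (-(M b a).im) • coordFn (a, b, false)) := by
    funext Q
    rw [re_trace_mul_eq_sum]
    simp only [Finset.sum_apply, Pi.add_apply, Pi.smul_apply, smul_eq_mul, coordFn_true, coordFn_false]
    exact sum_congr rfl fun a _ => sum_congr rfl fun b _ => by ring
  rw [h]
  refine Submodule.sum_mem _ fun a _ => Submodule.sum_mem _ fun b _ => Submodule.add_mem _ ?_ ?_
  · exact Submodule.smul_mem _ _ (Submodule.subset_span ⟨(a, b, true), rfl⟩)
  · exact Submodule.smul_mem _ _ (Submodule.subset_span ⟨(a, b, false), rfl⟩)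

section Calculus

attribute [local instance 2000] matTop

/-- Coordinate functions are smooth. [folklore] -/
theorem contDiff_coordFn (κ : CoordIdx N) : ContDiff ℝ ∞ (coordFn κ) := contDiff_reTrMul _

/-- `D_Y` of a coordinate function is a linear function. [folklore] -/
theorem matD_coordFn (Y : Matrix (Fin N) (Fin N) ℂ) (κ : CoordIdx N) :
    matD Y (coordFn κ) = fun Q => (Q * (Y * coordMat κ)).trace.re := by
  show matD Y (fun Q => (Q * coordMat κ).trace.re) = _
  rw [matD_reTrMul]
  funext Q; rw [Matrix.mul_assoc]

end Calculus

/-! ### Monomials and the spaces `𝒫_n` -/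

/-- The monomial `∏ᵢ coordinate_{κ i}`. [folklore] -/
def monom {k : ℕ} (κs : Fin k → CoordIdx N) : Matrix (Fin N) (Fin N) ℂ → ℝ := fun Q => ∏ i, coordFn (κs i) Q

/-- **`𝒫_n`**: the real span of the monomials of degree `≤ n` in the real coordinates of `M_N(ℂ)`
(restricted to `SU(N)` these are the polynomial, i.e. `SU(N)`-finite, functions). [folklore] -/
def polySpace (N n : ℕ) : Submodule ℝ (Matrix (Fin N) (Fin N) ℂ → ℝ) :=
  Submodule.span ℝ (Set.range fun p : (Σ k : Fin (n + 1), (Fin k → CoordIdx N)) => monom p.2)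

/-- `𝒫_n` is finite-dimensional. [folklore] -/
instance polySpace.finiteDimensional (N n : ℕ) : FiniteDimensional ℝ (polySpace N n) :=
  FiniteDimensional.span_of_finite ℝ (Set.finite_range _)

/-- Monomials of degree `k ≤ n` lie in `𝒫_n`. [folklore] -/
theorem monom_mem {n k : ℕ} (hk : k ≤ n) (κs : Fin k → CoordIdx N) : monom κs ∈ polySpace N n :=
  Submodule.subset_span ⟨⟨⟨k, Nat.lt_succ_of_le hk⟩, κs⟩, rfl⟩

/-- `𝒫_n ⊆ 𝒫_{n'}` for `n ≤ n'`. [folklore] -/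
theorem polySpace_mono {n n' : ℕ} (h : n ≤ n') : polySpace N n ≤ polySpace N n' := by
  refine Submodule.span_le.2 ?_
  rintro _ ⟨⟨k, κs⟩, rfl⟩
  exact monom_mem ((Nat.lt_succ_iff.1 k.2).trans h) κs

/-- `𝒫` is monotone. [folklore] -/
theorem monotone_polySpace : Monotone (polySpace N) := fun _ _ h => polySpace_mono h

/-- Constants lie in `𝒫_n`. [folklore] -/
theorem const_mem_polySpace (n : ℕ) (c : ℝ) : (fun _ : Matrix (Fin N) (Fin N) ℂ => c) ∈ polySpace N n := by
  have h1 : (fun _ : Matrix (Fin N) (Fin N) ℂ => (1 : ℝ)) ∈ polySpace N n := by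
    have h := monom_mem (n := n) (Nat.zero_le n) (Fin.elim0 : Fin 0 → CoordIdx N)
    have e : monom (Fin.elim0 : Fin 0 → CoordIdx N) = fun _ => (1 : ℝ) := by
      funext Q; simp [monom]
    rwa [e] at h
  have : (fun _ : Matrix (Fin N) (Fin N) ℂ => c) = c • fun _ : Matrix (Fin N) (Fin N) ℂ => (1 : ℝ) := by
    funext Q; simp
  rw [this]
  exact Submodule.smul_mem _ c h1

/-- Coordinate functions lie in `𝒫_n`, `n ≥ 1`. [folklore] -/
theorem coordFn_mem_polySpace {n : ℕ} (hn : 1 ≤ n) (κ : CoordIdx N) : coordFn κ ∈ polySpace N n := by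
  have h := monom_mem (n := n) hn (fun _ : Fin 1 => κ)
  have e : monom (fun _ : Fin 1 => κ) = coordFn κ := by
    funext Q; simp [monom]
  rwa [e] at h

/-- Linear functions `Q ↦ Re tr(Q M)` lie in `𝒫_n`, `n ≥ 1`. [folklore] -/
theorem reTrMul_mem_polySpace {n : ℕ} (hn : 1 ≤ n) (M : Matrix (Fin N) (Fin N) ℂ) :
    (fun Q : Matrix (Fin N) (Fin N) ℂ => (Q * M).trace.re) ∈ polySpace N n := by
  refine (Submodule.span_le.2 ?_) (reTrMul_mem_span_coordFn M)
  rintro _ ⟨κ, rfl⟩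
  exact coordFn_mem_polySpace hn κ

/-- Elements of `𝒫_n` are smooth. [folklore] -/
theorem contDiff_of_mem_polySpace {n : ℕ} {f : Matrix (Fin N) (Fin N) ℂ → ℝ} (hf : f ∈ polySpace N n) :
    ContDiff ℝ ∞ f := by
  induction hf using Submodule.span_induction with
  | mem x hx =>
      obtain ⟨⟨k, κs⟩, rfl⟩ := hx
      exact contDiff_prod fun i _ => contDiff_coordFn (κs i)
  | zero => exact contDiff_const
  | add x y _ _ hx hy => exact hx.add hy
  | smul c x _ hx => exact hx.const_smul c

/-- Products of monomials are monomials. [folklore] -/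
theorem monom_mul_monom {k k' : ℕ} (κs : Fin k → CoordIdx N) (κs' : Fin k' → CoordIdx N) :
    monom κs * monom κs' = monom (Fin.append κs κs') := by
  funext Q
  simp only [Pi.mul_apply, monom, Fin.prod_univ_add, Fin.append_left, Fin.append_right]

/-- **`𝒫_a · 𝒫_b ⊆ 𝒫_{a+b}`**. [folklore] -/
theorem mul_mem_polySpace {a b : ℕ} {f g : Matrix (Fin N) (Fin N) ℂ → ℝ} (hf : f ∈ polySpace N a)
    (hg : g ∈ polySpace N b) : f * g ∈ polySpace N (a + b) := by
  induction hf using Submodule.span_induction with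
  | mem x hx =>
      obtain ⟨⟨k, κs⟩, rfl⟩ := hx
      induction hg using Submodule.span_induction with
      | mem y hy =>
          obtain ⟨⟨k', κs'⟩, rfl⟩ := hy
          rw [monom_mul_monom]
          exact monom_mem (Nat.add_le_add (Nat.lt_succ_iff.1 k.2) (Nat.lt_succ_iff.1 k'.2)) _
      | zero => rw [mul_zero]; exact Submodule.zero_mem _
      | add y z _ _ hy hz => rw [mul_add]; exact Submodule.add_mem _ hy hz
      | smul c y _ hy => rw [mul_smul_comm]; exact Submodule.smul_mem _ c hy
  | zero => rw [zero_mul]; exact Submodule.zero_mem _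
  | add x y _ _ hx hy => rw [add_mul]; exact Submodule.add_mem _ hx hy
  | smul c x _ hx => rw [smul_mul_assoc]; exact Submodule.smul_mem _ c hx

/-- `𝒫_n` is closed under products with `𝒫_0`-like reindexing: `f ∈ 𝒫_a`, `a + b ≤ n`. [folklore] -/
theorem mul_mem_polySpace_of_le {a b n : ℕ} (h : a + b ≤ n) {f g : Matrix (Fin N) (Fin N) ℂ → ℝ}
    (hf : f ∈ polySpace N a) (hg : g ∈ polySpace N b) : f * g ∈ polySpace N n :=
  polySpace_mono h (mul_mem_polySpace hf hg)

section Calculus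

attribute [local instance 2000] matTop

/-- A punctured monomial times a linear function lies in `𝒫_n`. [folklore] -/
theorem erase_prod_mul_mem {n k : ℕ} (hk : k ≤ n) (κs : Fin k → CoordIdx N) (i : Fin k)
    {ℓ : Matrix (Fin N) (Fin N) ℂ → ℝ} (hℓ : ℓ ∈ Submodule.span ℝ (Set.range (coordFn (N := N)))) :
    (fun Q => (∏ j ∈ univ.erase i, coordFn (κs j) Q) * ℓ Q) ∈ polySpace N n := by
  induction hℓ using Submodule.span_induction with
  | mem x hx =>
      obtain ⟨κ', rfl⟩ := hx
      have : (fun Q => (∏ j ∈ univ.erase i, coordFn (κs j) Q) * coordFn κ' Q) = monom (Function.update κs i κ') := by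
        funext Q
        have hupd : ∀ l, coordFn (Function.update κs i κ' l) Q =
            Function.update (fun l => coordFn (κs l) Q) i (coordFn κ' Q) l := fun l => by
          rw [Function.apply_update (fun _ κ => coordFn κ Q) κs i κ' l]
        simp only [monom, hupd, Finset.prod_update_of_mem (mem_univ i), Finset.sdiff_singleton_eq_erase]
        ring
      rw [this]
      exact monom_mem hk _
  | zero => simp only [Pi.zero_apply, mul_zero]; exact Submodule.zero_mem _
  | add x y _ _ hx hy =>
      have : (fun Q => (∏ j ∈ univ.erase i, coordFn (κs j) Q) * (x + y) Q) =
          (fun Q => (∏ j ∈ univ.erase i, coordFn (κs j) Q) * x Q) + fun Q => (∏ j ∈ univ.erase i, coordFn (κs j) Q) * y Q := by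
        funext Q; simp only [Pi.add_apply]; ring
      rw [this]; exact Submodule.add_mem _ hx hy
  | smul c x _ hx =>
      have : (fun Q => (∏ j ∈ univ.erase i, coordFn (κs j) Q) * (c • x) Q) =
          c • fun Q => (∏ j ∈ univ.erase i, coordFn (κs j) Q) * x Q := by
        funext Q; simp only [Pi.smul_apply, smul_eq_mul]; ring
      rw [this]; exact Submodule.smul_mem _ c hx

/-- `D_Y` of a monomial. [folklore] -/
theorem matD_monom {k : ℕ} (Y : Matrix (Fin N) (Fin N) ℂ) (κs : Fin k → CoordIdx N) :
    matD Y (monom κs) = fun Q => ∑ i, (∏ j ∈ univ.erase i, coordFn (κs j) Q) * matD Y (coordFn (κs i)) Q := by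
  funext Q
  rw [matD_apply, show monom κs = (∏ i ∈ univ, coordFn (κs i) ·) from rfl,
    fderiv_finsetProd fun i _ => ((contDiff_coordFn (κs i)).differentiable (by simp)) Q]
  rw [_root_.sum_apply]
  refine sum_congr rfl fun i _ => ?_
  rw [_root_.smul_apply, smul_eq_mul, matD_apply]

/-- **`𝒫_n` is invariant under every `D_Y`** (a left-invariant derivative lowers no degree: it maps
coordinates to linear functions). [folklore] -/
theorem matD_mem_polySpace {n : ℕ} (Y : Matrix (Fin N) (Fin N) ℂ) {f : Matrix (Fin N) (Fin N) ℂ → ℝ}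
    (hf : f ∈ polySpace N n) : matD Y f ∈ polySpace N n := by
  -- carry smoothness through the induction
  suffices h : ContDiff ℝ ∞ f ∧ matD Y f ∈ polySpace N n from h.2
  induction hf using Submodule.span_induction with
  | mem x hx =>
      obtain ⟨⟨k, κs⟩, rfl⟩ := hx
      refine ⟨contDiff_of_mem_polySpace (monom_mem (n := k) le_rfl κs), ?_⟩
      rw [matD_monom]
      have hfn : (fun Q => ∑ i, (∏ j ∈ univ.erase i, coordFn (κs j) Q) * matD Y (coordFn (κs i)) Q) =
          ∑ i, fun Q => (∏ j ∈ univ.erase i, coordFn (κs j) Q) * matD Y (coordFn (κs i)) Q := by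
        funext Q; simp only [Finset.sum_apply]
      rw [hfn]
      refine Submodule.sum_mem _ fun i _ => ?_
      have hk : (k : ℕ) ≤ n := Nat.lt_succ_iff.1 k.2
      have hlin : matD Y (coordFn (κs i)) ∈ Submodule.span ℝ (Set.range (coordFn (N := N))) := by
        rw [matD_coordFn]
        exact reTrMul_mem_span_coordFn _
      exact erase_prod_mul_mem hk κs i hlin
  | zero =>
      refine ⟨contDiff_const, ?_⟩
      have h0 : matD Y (0 : Matrix (Fin N) (Fin N) ℂ → ℝ) = 0 := matD_const 0 Y
      rw [h0]
      exact Submodule.zero_mem _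
  | add x y _ _ hx hy =>
      exact ⟨hx.1.add hy.1, by rw [matD_add hx.1 hy.1]; exact Submodule.add_mem _ hx.2 hy.2⟩
  | smul c x _ hx =>
      refine ⟨hx.1.const_smul c, ?_⟩
      have : matD Y (c • x) = c • matD Y x := by
        show matD Y (fun Q => c * x Q) = fun Q => c * matD Y x Q
        exact matD_const_mul hx.1 c Y
      rw [this]
      exact Submodule.smul_mem _ c hx.2

/-- `Δ 𝒫_n ⊆ 𝒫_n`. [folklore] -/
theorem Lap_mem_polySpace {n : ℕ} {f : Matrix (Fin N) (Fin N) ℂ → ℝ} (hf : f ∈ polySpace N n) :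
    Lap f ∈ polySpace N n := by
  have : Lap f = ∑ α : FrameIdx N, matD (frame α) (matD (frame α) f) := by
    funext Q; simp only [Lap, Finset.sum_apply]
  rw [this]
  exact Submodule.sum_mem _ fun α _ => matD_mem_polySpace _ (matD_mem_polySpace _ hf)

/-- `Γ(𝒫_a, 𝒫_b) ⊆ 𝒫_{a+b}`. [folklore] -/
theorem Gam_mem_polySpace {a b : ℕ} {f g : Matrix (Fin N) (Fin N) ℂ → ℝ} (hf : f ∈ polySpace N a)
    (hg : g ∈ polySpace N b) : Gam f g ∈ polySpace N (a + b) := by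
  have : Gam f g = ∑ α : FrameIdx N, matD (frame α) f * matD (frame α) g := by
    funext Q; simp only [Gam, Finset.sum_apply, Pi.mul_apply]
  rw [this]
  exact Submodule.sum_mem _ fun α _ => mul_mem_polySpace (matD_mem_polySpace _ hf) (matD_mem_polySpace _ hg)

end Calculus

/-! ### The potential, its Schrödinger weight `W = ¼Γ(S,S) + ½ΔS`, and the ground-state transform -/

/-- The one-link potential `S(Q) = c Re tr(Q B)`. [folklore] -/
def pot (c : ℝ) (B : Matrix (Fin N) (Fin N) ℂ) : Matrix (Fin N) (Fin N) ℂ → ℝ := fun Q => c * (Q * B).trace.re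

/-- The potential is smooth. [folklore] -/
theorem contDiff_pot (c : ℝ) (B : Matrix (Fin N) (Fin N) ℂ) : ContDiff ℝ ∞ (pot (N := N) c B) :=
  contDiff_potential c B

/-- The potential lies in `𝒫_1`. [folklore] -/
theorem pot_mem_polySpace (c : ℝ) (B : Matrix (Fin N) (Fin N) ℂ) {n : ℕ} (hn : 1 ≤ n) : pot c B ∈ polySpace N n := by
  have : pot (N := N) c B = c • fun Q : Matrix (Fin N) (Fin N) ℂ => (Q * B).trace.re := by
    funext Q; simp [pot]
  rw [this]
  exact Submodule.smul_mem _ c (reTrMul_mem_polySpace hn B)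

/-- The **Schrödinger weight** `W = ¼ Γ(S,S) + ½ ΔS` of the ground-state transform
`e^{S/2} L_S e^{-S/2} = Δ - W`. [folklore] -/
def schW (c : ℝ) (B : Matrix (Fin N) (Fin N) ℂ) : Matrix (Fin N) (Fin N) ℂ → ℝ :=
  fun Q => (1 / 4) * Gam (pot c B) (pot c B) Q + (1 / 2) * Lap (pot c B) Q

/-- `W ∈ 𝒫_2`. [folklore] -/
theorem schW_mem_polySpace (c : ℝ) (B : Matrix (Fin N) (Fin N) ℂ) : schW c B ∈ polySpace N 2 := by
  have h1 : Gam (pot c B) (pot c B) ∈ polySpace N (1 + 1) :=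
    Gam_mem_polySpace (a := 1) (b := 1) (pot_mem_polySpace c B le_rfl) (pot_mem_polySpace c B le_rfl)
  have h2 : Lap (pot c B) ∈ polySpace N 2 := Lap_mem_polySpace (pot_mem_polySpace c B (by norm_num))
  have : schW (N := N) c B = (1 / 4 : ℝ) • Gam (pot c B) (pot c B) + (1 / 2 : ℝ) • Lap (pot c B) := by
    funext Q; simp [schW]
  rw [this]
  exact Submodule.add_mem _ (Submodule.smul_mem _ _ h1) (Submodule.smul_mem _ _ h2)

/-- `W` is smooth. [folklore] -/
theorem contDiff_schW (c : ℝ) (B : Matrix (Fin N) (Fin N) ℂ) : ContDiff ℝ ∞ (schW (N := N) c B) :=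
  contDiff_of_mem_polySpace (schW_mem_polySpace c B)

/-- `(Δ - W) p ∈ 𝒫_{n+2}` for `p ∈ 𝒫_n`. [folklore] -/
theorem Lap_sub_schW_mul_mem {n : ℕ} (c : ℝ) (B : Matrix (Fin N) (Fin N) ℂ) {p : Matrix (Fin N) (Fin N) ℂ → ℝ}
    (hp : p ∈ polySpace N n) : Lap p - schW c B * p ∈ polySpace N (n + 2) := by
  refine Submodule.sub_mem _ (polySpace_mono (Nat.le_add_right n 2) (Lap_mem_polySpace hp)) ?_
  have h := mul_mem_polySpace (a := 2) (b := n) (schW_mem_polySpace c B) hp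
  rwa [add_comm] at h

section Calculus

attribute [local instance 2000] matTop

/-- `D_α (e^{-S/2} p) = e^{-S/2} (D_α p - ½ p D_α S)`. [folklore] -/
theorem matD_groundState {S p : Matrix (Fin N) (Fin N) ℂ → ℝ} (hS : ContDiff ℝ ∞ S) (hp : ContDiff ℝ ∞ p)
    (A : Matrix (Fin N) (Fin N) ℂ) :
    matD A (fun Q => Real.exp (-S Q / 2) * p Q) =
      fun Q => Real.exp (-S Q / 2) * (matD A p Q - (1 / 2) * p Q * matD A S Q) := by
  have hS' : ContDiff ℝ ∞ (fun Q => -S Q / 2) := by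
    have : (fun Q => -S Q / 2) = fun Q => (-(1 / 2) : ℝ) * S Q := by funext Q; ring
    rw [this]; exact contDiff_const.mul hS
  rw [matD_fun_mul hS'.exp hp, matD_exp hS']
  have hD : matD A (fun Q => -S Q / 2) = fun Q => (-(1 / 2) : ℝ) * matD A S Q := by
    have : (fun Q => -S Q / 2) = fun Q => (-(1 / 2) : ℝ) * S Q := by funext Q; ring
    rw [this, matD_const_mul hS]
  rw [hD]
  funext Q
  ring

/-- Smoothness of the ground-state transform. [folklore] -/
theorem contDiff_groundState {S p : Matrix (Fin N) (Fin N) ℂ → ℝ} (hS : ContDiff ℝ ∞ S) (hp : ContDiff ℝ ∞ p) :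
    ContDiff ℝ ∞ (fun Q => Real.exp (-S Q / 2) * p Q) := by
  have hS' : ContDiff ℝ ∞ (fun Q => -S Q / 2) := by
    have : (fun Q => -S Q / 2) = fun Q => (-(1 / 2) : ℝ) * S Q := by funext Q; ring
    rw [this]; exact contDiff_const.mul hS
  exact hS'.exp.mul hp

/-- **Ground-state transform of the carré du champ**:
`e^{S} Γ(e^{-S/2}p, e^{-S/2}p) = Γ(p,p) - p Γ(S,p) + ¼ p² Γ(S,S)`. [folklore] -/
theorem exp_mul_Gam_groundState {S p : Matrix (Fin N) (Fin N) ℂ → ℝ} (hS : ContDiff ℝ ∞ S) (hp : ContDiff ℝ ∞ p)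
    (Q : Matrix (Fin N) (Fin N) ℂ) :
    Real.exp (S Q) * Gam (fun Q => Real.exp (-S Q / 2) * p Q) (fun Q => Real.exp (-S Q / 2) * p Q) Q =
      Gam p p Q - p Q * Gam S p Q + (1 / 4) * p Q ^ 2 * Gam S S Q := by
  simp only [Gam, matD_groundState hS hp, mul_sum]
  rw [← sum_sub_distrib, ← sum_add_distrib]
  refine sum_congr rfl fun α _ => ?_
  have he : Real.exp (S Q) * (Real.exp (-S Q / 2) * Real.exp (-S Q / 2)) = 1 := by
    rw [← Real.exp_add, ← Real.exp_add, show S Q + (-S Q / 2 + -S Q / 2) = 0 by ring, Real.exp_zero]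
  calc Real.exp (S Q) * (Real.exp (-S Q / 2) * (matD (frame α) p Q - 1 / 2 * p Q * matD (frame α) S Q) *
        (Real.exp (-S Q / 2) * (matD (frame α) p Q - 1 / 2 * p Q * matD (frame α) S Q)))
      = Real.exp (S Q) * (Real.exp (-S Q / 2) * Real.exp (-S Q / 2)) *
          (matD (frame α) p Q - 1 / 2 * p Q * matD (frame α) S Q) ^ 2 := by ring
    _ = _ := by rw [he]; ring

/-- **Ground-state transform of the generator**: `L_S (e^{-S/2} p) = e^{-S/2} (Δp - W p)` with
`W = ¼ Γ(S,S) + ½ ΔS`. [folklore] -/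
theorem genL_groundState {S p : Matrix (Fin N) (Fin N) ℂ → ℝ} (hS : ContDiff ℝ ∞ S) (hp : ContDiff ℝ ∞ p)
    (Q : Matrix (Fin N) (Fin N) ℂ) :
    genL S (fun Q => Real.exp (-S Q / 2) * p Q) Q =
      Real.exp (-S Q / 2) * (Lap p Q - ((1 / 4) * Gam S S Q + (1 / 2) * Lap S Q) * p Q) := by
  -- `r_α = D_α p - ½ p D_α S`, so that `D_α (e^{-S/2} p) = e^{-S/2} r_α`
  set r : FrameIdx N → Matrix (Fin N) (Fin N) ℂ → ℝ :=
    fun α Q => matD (frame α) p Q - (1 / 2) * p Q * matD (frame α) S Q with hr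
  have hrc : ∀ α, ContDiff ℝ ∞ (r α) := fun α =>
    (contDiff_matD hp _).sub ((contDiff_const.mul hp).mul (contDiff_matD hS _))
  have hq1 : ∀ α, matD (frame α) (fun Q => Real.exp (-S Q / 2) * p Q) = fun Q => Real.exp (-S Q / 2) * r α Q :=
    fun α => matD_groundState hS hp _
  have hq2 : ∀ α, matD (frame α) (matD (frame α) (fun Q => Real.exp (-S Q / 2) * p Q)) Q =
      Real.exp (-S Q / 2) * (matD (frame α) (r α) Q - (1 / 2) * r α Q * matD (frame α) S Q) := fun α => by
    rw [hq1, matD_groundState hS (hrc α)]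
  have hr2 : ∀ α, matD (frame α) (r α) Q = matD (frame α) (matD (frame α) p) Q -
      (1 / 2) * (matD (frame α) p Q * matD (frame α) S Q + p Q * matD (frame α) (matD (frame α) S) Q) := by
    intro α
    have e1 := congrFun (matD_sub (F := matD (frame α) p) (G := fun Q => 1 / 2 * p Q * matD (frame α) S Q)
      (contDiff_matD hp _) ((contDiff_const.mul hp).mul (contDiff_matD hS _)) (frame α)) Q
    simp only [Pi.sub_apply] at e1
    have e2 : matD (frame α) (fun Q => 1 / 2 * p Q * matD (frame α) S Q) Q =
        (1 / 2) * (matD (frame α) p Q * matD (frame α) S Q + p Q * matD (frame α) (matD (frame α) S) Q) := by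
      have : (fun Q => 1 / 2 * p Q * matD (frame α) S Q) = fun Q => (1 / 2 : ℝ) * (p Q * matD (frame α) S Q) := by
        funext Q; ring
      rw [this, matD_const_mul (hp.mul (contDiff_matD hS _)), matD_fun_mul hp (contDiff_matD hS _)]
      ring
    have e3 : r α = (matD (frame α) p - fun Q => 1 / 2 * p Q * matD (frame α) S Q) := rfl
    rw [e3, e1, e2]
  -- both sides as one sum
  have hL : genL S (fun Q => Real.exp (-S Q / 2) * p Q) Q =
      ∑ α, Real.exp (-S Q / 2) * (matD (frame α) (matD (frame α) p) Q
        - (1 / 2) * p Q * matD (frame α) (matD (frame α) S) Q - (1 / 4) * p Q * matD (frame α) S Q ^ 2) := by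
    show (∑ α, matD (frame α) (matD (frame α) (fun Q => Real.exp (-S Q / 2) * p Q)) Q) +
      ∑ α, matD (frame α) S Q * matD (frame α) (fun Q => Real.exp (-S Q / 2) * p Q) Q = _
    rw [← sum_add_distrib]
    refine sum_congr rfl fun α _ => ?_
    rw [hq2, hq1, hr2]
    simp only [hr]
    ring
  have hR : Real.exp (-S Q / 2) * (Lap p Q - ((1 / 4) * Gam S S Q + (1 / 2) * Lap S Q) * p Q) =
      ∑ α, Real.exp (-S Q / 2) * (matD (frame α) (matD (frame α) p) Q
        - (1 / 2) * p Q * matD (frame α) (matD (frame α) S) Q - (1 / 4) * p Q * matD (frame α) S Q ^ 2) := by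
    simp only [Lap, Gam]
    rw [Finset.mul_sum, Finset.mul_sum, ← sum_add_distrib, Finset.sum_mul, ← sum_sub_distrib, Finset.mul_sum]
    refine sum_congr rfl fun α _ => ?_
    ring
  rw [hL, hR]

end Calculus


/-! ### Every element of `SU(N)` is an exponential; functions with `Γ = 0` are constant -/

/-- **`exp : 𝔰𝔲(N) → SU(N)` is onto** (diagonalise in `SU(N)` — `exists_conj_eq_diagonal`, Bröcker–tom
Dieck IV (3.1) — and take logarithms of the eigenvalues with total phase `0`). [cite: BrockerTomDieck1985, IV (3.1)] -/
theorem exists_skew_traceless_exp_eq (hN : N ≠ 0) (g : SUN N) :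
    ∃ Y : Matrix (Fin N) (Fin N) ℂ, Yᴴ = -Y ∧ Y.trace = 0 ∧ NormedSpace.exp Y = (g : Matrix (Fin N) (Fin N) ℂ) := by
  haveI : Nonempty (Fin N) := ⟨⟨0, Nat.pos_of_ne_zero hN⟩⟩
  obtain ⟨u, D, d, hD, hx⟩ := Literature.MathematicalPhysics.QuantumLattice.exists_conj_eq_diagonal (n := Fin N) g
  have hd1 : ∀ i, ‖d i‖ = 1 := Literature.MathematicalPhysics.QuantumLattice.norm_eq_one_of_coe_eq_diagonal hD
  have hprod : ∏ i, d i = 1 := Literature.MathematicalPhysics.QuantumLattice.prod_eq_one_of_coe_eq_diagonal hD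
  -- phases
  set θ : Fin N → ℝ := fun i => (d i).arg with hθ
  have hdexp : ∀ i, Complex.exp (θ i * I) = d i := fun i => by
    have h := Complex.norm_mul_exp_arg_mul_I (d i)
    rwa [hd1 i, Complex.ofReal_one, one_mul] at h
  set s : ℝ := ∑ i, θ i with hs
  have hsexp : Complex.exp (s * I) = 1 := by
    rw [hs, Complex.ofReal_sum, sum_mul, Complex.exp_sum]
    simp_rw [hdexp]
    exact hprod
  -- corrected phases with total phase zero
  obtain ⟨i₀⟩ := ‹Nonempty (Fin N)›
  set θ' : Fin N → ℝ := fun i => θ i - if i = i₀ then s else 0 with hθ'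
  have hθ'sum : ∑ i, θ' i = 0 := by
    simp only [hθ', sum_sub_distrib, sum_ite_eq', mem_univ, if_true]
    rw [hs]; ring
  have hdexp' : ∀ i, Complex.exp (θ' i * I) = d i := by
    intro i
    simp only [hθ']
    split_ifs with hi
    · rw [Complex.ofReal_sub, sub_mul, Complex.exp_sub, hsexp, div_one, hdexp]
    · rw [sub_zero, hdexp]
  -- the logarithm
  set U : Matrix (Fin N) (Fin N) ℂ := (u : Matrix (Fin N) (Fin N) ℂ) with hU
  have hUu : U ∈ Matrix.unitaryGroup (Fin N) ℂ := SUN.mem_unitaryGroup u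
  have hUstar : star U * U = 1 := Unitary.star_mul_self_of_mem hUu
  have hUstar' : U * star U = 1 := Unitary.mul_star_self_of_mem hUu
  have hUunit : IsUnit U := ⟨⟨U, star U, hUstar', hUstar⟩, rfl⟩
  have hUinv : U⁻¹ = star U := Matrix.inv_eq_left_inv hUstar
  set Dθ : Matrix (Fin N) (Fin N) ℂ := diagonal fun i => (θ' i : ℂ) * I with hDθ
  refine ⟨U * Dθ * star U, ?_, ?_, ?_⟩
  · -- skew-Hermitian
    have hDθ' : Dθᴴ = -Dθ := by
      rw [hDθ, diagonal_conjTranspose, diagonal_neg]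
      congr 1
      funext i
      simp [Complex.conj_ofReal, Complex.conj_I]
    rw [conjTranspose_mul, conjTranspose_mul, hDθ', Matrix.star_eq_conjTranspose, conjTranspose_conjTranspose]
    simp [Matrix.mul_assoc]
  · -- traceless
    rw [Matrix.mul_assoc, trace_mul_comm, Matrix.mul_assoc, Matrix.star_eq_conjTranspose,
      show (U)ᴴ * U = 1 from hUstar, Matrix.mul_one, hDθ, trace_diagonal, ← sum_mul, ← Complex.ofReal_sum,
      hθ'sum, Complex.ofReal_zero, zero_mul]
  · -- exponential
    rw [← hUinv, Matrix.exp_conj U Dθ hUunit, hDθ, Matrix.exp_diagonal, hUinv]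
    have hexpd : NormedSpace.exp (fun i => (θ' i : ℂ) * I) = d := by
      rw [Pi.exp_def]
      funext i
      rw [← Complex.exp_eq_exp_ℂ, hdexp']
    rw [hexpd, ← hD, hx]
    simp only [Submonoid.coe_mul, hU]
    rfl

section FlowConst

attribute [local instance 2000] matTop

/-- **Vanishing carré du champ forces constancy on `SU(N)`**: if `Γ(F,F) = 0` on `SU(N)` then
`F(g) = F(1)` for all `g ∈ SU(N)` (connectedness of `SU(N)` via the exponential map). [folklore] -/
theorem eq_of_Gam_eq_zero (hN : N ≠ 0) {F : Matrix (Fin N) (Fin N) ℂ → ℝ} (hF : ContDiff ℝ ∞ F)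
    (hΓ : ∀ g : SUN N, Gam F F g = 0) (g : SUN N) : F g = F (1 : Matrix (Fin N) (Fin N) ℂ) := by
  obtain ⟨Y, hY, hY0, hYg⟩ := exists_skew_traceless_exp_eq hN g
  -- every frame derivative of `F` vanishes on `SU(N)`, hence so does `D_Y F`
  have hDα : ∀ (h : SUN N) (α : FrameIdx N), matD (frame α) F h = 0 := by
    intro h α
    have hs : ∑ β, matD (frame β) F h ^ 2 = 0 := by rw [← Gam_self_eq_sum_sq]; exact hΓ h
    have := (sum_eq_zero_iff_of_nonneg fun β _ => sq_nonneg (matD (frame β) F (h : Matrix (Fin N) (Fin N) ℂ))).1 hs α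
      (mem_univ α)
    exact pow_eq_zero_iff (n := 2) (by norm_num) |>.1 this
  have hDY : ∀ h : SUN N, matD Y F h = 0 := fun h => by
    rw [matD_eq_sum_frame hN hY hY0]
    exact sum_eq_zero fun α _ => by rw [hDα h α, mul_zero]
  -- `t ↦ F(exp(tY))` has zero derivative
  set φ : ℝ → ℝ := fun t => F ((1 : Matrix (Fin N) (Fin N) ℂ) * NormedSpace.exp (t • Y)) with hφ
  have hderiv : ∀ t, HasDerivAt φ 0 t := by
    intro t
    have h := hasDerivAt_comp_mul_exp hF (1 : Matrix (Fin N) (Fin N) ℂ) Y t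
    have hmem : (1 : Matrix (Fin N) (Fin N) ℂ) * NormedSpace.exp (t • Y) = (expSU hY hY0 t : SUN N) := by
      rw [Matrix.one_mul]; rfl
    rw [hmem, hDY] at h
    exact h
  have hconst := is_const_of_deriv_eq_zero (fun t => (hderiv t).differentiableAt) (fun t => (hderiv t).deriv) 1 0
  simp only [hφ, one_smul, zero_smul, NormedSpace.exp_zero, Matrix.one_mul] at hconst
  rw [← hYg]
  exact hconst

end FlowConst


/-! ## Part G: the Hilbert space `L²(SU(N), σ)`, polynomial subspaces, density, and the Poincaré
inequalities -/


open scoped Matrix.Norms.Frobenius ContDiff Topology InnerProductSpace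
open Matrix Complex Finset MeasureTheory Filter

variable {N : ℕ}

/-! ### Topological and measure-theoretic instances on `SU(N)` -/

/-- `SU(N) ⊆ M_N(ℂ)` is second countable. [folklore] -/
instance SUN.secondCountableTopology : SecondCountableTopology (SUN N) := by
  haveI : SecondCountableTopology (Matrix (Fin N) (Fin N) ℂ) :=
    inferInstanceAs (SecondCountableTopology (Fin N → Fin N → ℂ))
  exact Topology.IsEmbedding.subtypeVal.secondCountableTopology

/-- The Haar probability measure on `SU(N)`. [folklore] -/
abbrev haarSU (N : ℕ) : Measure (SUN N) := haarProbability (SUN N)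

/-- `σ` is a probability measure. [folklore] -/
instance haarSU.isProbabilityMeasure : IsProbabilityMeasure (haarSU N) := by
  unfold haarSU; infer_instance

/-- `σ` is regular. [folklore] -/
instance haarSU.regular : (haarSU N).Regular := by
  unfold haarSU haarProbability; infer_instance

/-- `σ` charges open sets. [folklore] -/
instance haarSU.isOpenPosMeasure : (haarSU N).IsOpenPosMeasure := by
  unfold haarSU; infer_instance

/-! ### Continuous functions as elements of `L²(σ)` -/

/-- The restriction of a continuous ambient function to `SU(N)` as a bundled continuous map. [folklore] -/
def resCM (F : Matrix (Fin N) (Fin N) ℂ → ℝ) (hF : Continuous fun g : SUN N => F g) : C(SUN N, ℝ) :=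
  ⟨fun g => F g, hF⟩

/-- The embedding `C(SU(N), ℝ) → L²(σ)`. [folklore] -/
abbrev toL2 : C(SUN N, ℝ) →L[ℝ] Lp ℝ 2 (haarSU N) := ContinuousMap.toLp 2 (haarSU N) ℝ

/-- Inner products of continuous functions in `L²(σ)` are integrals. [folklore] -/
theorem inner_toL2_toL2 (φ ψ : C(SUN N, ℝ)) :
    ⟪toL2 φ, toL2 ψ⟫_ℝ = ∫ g, φ g * ψ g ∂(haarSU N) := by
  rw [MeasureTheory.L2.inner_def]
  refine integral_congr_ae ?_
  filter_upwards [ContinuousMap.coeFn_toLp (p := 2) (μ := haarSU N) (𝕜 := ℝ) φ,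
    ContinuousMap.coeFn_toLp (p := 2) (μ := haarSU N) (𝕜 := ℝ) ψ] with g hφ hψ
  rw [hφ, hψ, Real.inner_apply]

/-- Inner product of a continuous function with an arbitrary element of `L²(σ)`. [folklore] -/
theorem inner_toL2_left (φ : C(SUN N, ℝ)) (x : Lp ℝ 2 (haarSU N)) :
    ⟪toL2 φ, x⟫_ℝ = ∫ g, φ g * x g ∂(haarSU N) := by
  rw [MeasureTheory.L2.inner_def]
  refine integral_congr_ae ?_
  filter_upwards [ContinuousMap.coeFn_toLp (p := 2) (μ := haarSU N) (𝕜 := ℝ) φ] with g hφ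
  rw [hφ, Real.inner_apply]

/-- The norm in `L²(σ)` is the square root of the integral of the square. [folklore] -/
theorem norm_sq_eq_integral (x : Lp ℝ 2 (haarSU N)) : ‖x‖ ^ 2 = ∫ g, x g ^ 2 ∂(haarSU N) := by
  rw [← real_inner_self_eq_norm_sq, MeasureTheory.L2.inner_def]
  refine integral_congr_ae (ae_of_all _ fun g => ?_)
  simp only [Real.inner_apply, sq]

/-- `‖toL2 φ - x‖² = ∫ (φ - x)²`. [folklore] -/
theorem norm_toL2_sub_sq (φ : C(SUN N, ℝ)) (x : Lp ℝ 2 (haarSU N)) :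
    ‖toL2 φ - x‖ ^ 2 = ∫ g, (φ g - x g) ^ 2 ∂(haarSU N) := by
  rw [norm_sq_eq_integral]
  refine integral_congr_ae ?_
  filter_upwards [Lp.coeFn_sub (toL2 φ) x, ContinuousMap.coeFn_toLp (p := 2) (μ := haarSU N) (𝕜 := ℝ) φ]
    with g hsub hφ
  rw [hsub, Pi.sub_apply, hφ]

/-- Elements of `L²(σ)` are integrable (probability space). [folklore] -/
theorem integrable_L2 (x : Lp ℝ 2 (haarSU N)) : Integrable (fun g => x g) (haarSU N) :=
  (Lp.memLp x).integrable one_le_two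

/-- Elements of `L²(σ)` are square integrable. [folklore] -/
theorem integrable_sq_L2 (x : Lp ℝ 2 (haarSU N)) : Integrable (fun g => x g ^ 2) (haarSU N) := by
  have := (Lp.memLp x).integrable_sq
  exact this

/-- Products of a continuous function with an element of `L²(σ)` are integrable. [folklore] -/
theorem integrable_continuous_mul_L2 {φ : SUN N → ℝ} (hφ : Continuous φ) (x : Lp ℝ 2 (haarSU N)) :
    Integrable (fun g => φ g * x g) (haarSU N) := by
  obtain ⟨C, hC⟩ := (isCompact_univ (X := SUN N)).exists_bound_of_continuousOn hφ.continuousOn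
  exact (integrable_L2 x).bdd_mul hφ.aestronglyMeasurable (ae_of_all _ fun g => hC g (Set.mem_univ _))

/-- `‖toL2 φ - toL2 ψ‖² = ∫ (φ - ψ)²`. [folklore] -/
theorem norm_toL2_sub_toL2_sq (φ ψ : C(SUN N, ℝ)) :
    ‖toL2 φ - toL2 ψ‖ ^ 2 = ∫ g, (φ g - ψ g) ^ 2 ∂(haarSU N) := by
  rw [norm_toL2_sub_sq]
  refine integral_congr_ae ?_
  filter_upwards [ContinuousMap.coeFn_toLp (p := 2) (μ := haarSU N) (𝕜 := ℝ) ψ] with g hψ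
  rw [hψ]

/-- `‖toL2 φ‖² = ∫ φ²`. [folklore] -/
theorem norm_toL2_sq (φ : C(SUN N, ℝ)) : ‖toL2 φ‖ ^ 2 = ∫ g, φ g ^ 2 ∂(haarSU N) := by
  rw [← real_inner_self_eq_norm_sq, inner_toL2_toL2]
  exact integral_congr_ae (ae_of_all _ fun g => by ring)

/-- **Cauchy–Schwarz against `L²(σ)`**: `|∫ φ x| ≤ (∫ φ²)^{1/2} ‖x‖`. [folklore] -/
theorem abs_integral_mul_L2_le (φ : C(SUN N, ℝ)) (x : Lp ℝ 2 (haarSU N)) :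
    |∫ g, φ g * x g ∂(haarSU N)| ≤ Real.sqrt (∫ g, φ g ^ 2 ∂(haarSU N)) * ‖x‖ := by
  rw [← inner_toL2_left, ← norm_toL2_sq, Real.sqrt_sq (norm_nonneg _)]
  exact abs_real_inner_le_norm _ _

/-! ### The Haar-symmetric form of the Laplacian -/

section HaarSymm

attribute [local instance 2000] matTop

/-- `Γ(c, G) = 0` for a constant `c`. [folklore] -/
theorem Gam_const_left (c : ℝ) (G : Matrix (Fin N) (Fin N) ℂ → ℝ) : Gam (fun _ => c) G = 0 := by
  funext Q
  simp [Gam, matD_const]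

/-- `Δ c = 0` for a constant. [folklore] -/
theorem Lap_const (c : ℝ) : Lap (fun _ : Matrix (Fin N) (Fin N) ℂ => c) = 0 := by
  funext Q
  simp only [Lap, Pi.zero_apply]
  refine sum_eq_zero fun α _ => ?_
  rw [matD_const c]
  have : matD (frame α) (0 : Matrix (Fin N) (Fin N) ℂ → ℝ) = 0 := matD_const 0 _
  rw [this, Pi.zero_apply]

/-- `Δ (F + G) = ΔF + ΔG`. [folklore] -/
theorem Lap_add {F G : Matrix (Fin N) (Fin N) ℂ → ℝ} (hF : ContDiff ℝ ∞ F) (hG : ContDiff ℝ ∞ G) :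
    Lap (F + G) = Lap F + Lap G := by
  funext Q
  simp only [Lap, Pi.add_apply, ← sum_add_distrib]
  refine sum_congr rfl fun α _ => ?_
  rw [matD_add hF hG, matD_add (contDiff_matD hF _) (contDiff_matD hG _), Pi.add_apply]

/-- `Δ (r F) = r ΔF`. [folklore] -/
theorem Lap_smul (r : ℝ) {F : Matrix (Fin N) (Fin N) ℂ → ℝ} (hF : ContDiff ℝ ∞ F) : Lap (r • F) = r • Lap F := by
  funext Q
  simp only [Lap, Pi.smul_apply, smul_eq_mul, mul_sum]
  refine sum_congr rfl fun α _ => ?_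
  have h1 : matD (frame α) (r • F) = fun Q => r * matD (frame α) F Q := by
    show matD (frame α) (fun Q => r * F Q) = _
    exact matD_const_mul hF r _
  rw [h1, matD_const_mul (contDiff_matD hF _)]

/-- `L_c G = Δ G` for a constant potential. [folklore] -/
theorem genL_const (c : ℝ) (G : Matrix (Fin N) (Fin N) ℂ → ℝ) : genL (fun _ => c) G = Lap G := by
  funext Q
  rw [genL, Gam_const_left]
  simp

end HaarSymm

/-- **`∫ F ΔG dσ = -∫ Γ(F,G) dσ`** on `SU(N)`. [folklore] -/
theorem integral_mul_Lap (hN : N ≠ 0) {F G : Matrix (Fin N) (Fin N) ℂ → ℝ} (hF : ContDiff ℝ ∞ F) (hG : ContDiff ℝ ∞ G) :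
    ∫ g : SUN N, F g * Lap G g ∂(haarSU N) = -∫ g : SUN N, Gam F G g ∂(haarSU N) := by
  have h := integral_mul_exp_mul_genL hN (S := fun _ => (0 : ℝ)) contDiff_const hF hG
  simp only [Real.exp_zero, one_mul, genL_const] at h
  exact h

/-- `∫ ΔG dσ = 0`. [folklore] -/
theorem integral_Lap (hN : N ≠ 0) {G : Matrix (Fin N) (Fin N) ℂ → ℝ} (hG : ContDiff ℝ ∞ G) :
    ∫ g : SUN N, Lap G g ∂(haarSU N) = 0 := by
  have h := integral_mul_Lap hN (F := fun _ => (1 : ℝ)) contDiff_const hG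
  simp only [one_mul, Gam_const_left, Pi.zero_apply, integral_zero, neg_zero] at h
  exact h

/-! ### The subspaces `V_n = 𝒫_n|_{SU(N)} ⊂ L²(σ)` and their density -/

/-- Restriction `𝒫_n → C(SU(N), ℝ)`. [folklore] -/
def resPoly (n : ℕ) : polySpace N n →ₗ[ℝ] C(SUN N, ℝ) where
  toFun p := resCM p.1 (continuous_restrict (contDiff_of_mem_polySpace p.2))
  map_add' p q := by ext g; rfl
  map_smul' c p := by ext g; rfl

/-- Evaluation of `resPoly`. [folklore] -/
@[simp] theorem resPoly_apply {n : ℕ} (p : polySpace N n) (g : SUN N) : resPoly n p g = p.1 g := rfl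

/-- `𝒫_n → L²(σ)`. [folklore] -/
def TPoly (n : ℕ) : polySpace N n →ₗ[ℝ] Lp ℝ 2 (haarSU N) := (toL2 (N := N)).toLinearMap.comp (resPoly n)

/-- `TPoly n p = toL2 (resPoly n p)`. [folklore] -/
theorem TPoly_apply {n : ℕ} (p : polySpace N n) : TPoly n p = toL2 (resPoly n p) := rfl

/-- **`V_n`**: the image of `𝒫_n` in `L²(σ)`, a finite-dimensional subspace. [folklore] -/
def VPoly (N n : ℕ) : Submodule ℝ (Lp ℝ 2 (haarSU N)) := LinearMap.range (TPoly (N := N) n)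

/-- `V_n` is finite-dimensional. [folklore] -/
instance VPoly.finiteDimensional (N n : ℕ) : FiniteDimensional ℝ (VPoly N n) :=
  LinearMap.finiteDimensional_range _

/-- `V_n` is complete. [folklore] -/
instance VPoly.completeSpace (N n : ℕ) : CompleteSpace (VPoly N n) := FiniteDimensional.complete ℝ _

/-- `V` is monotone. [folklore] -/
theorem monotone_VPoly : Monotone (VPoly N) := by
  intro n n' h x hx
  obtain ⟨p, rfl⟩ := hx
  exact ⟨⟨p.1, polySpace_mono h p.2⟩, rfl⟩

/-- The coordinate functions as continuous maps on `SU(N)`. [folklore] -/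
def coordCM (κ : CoordIdx N) : C(SUN N, ℝ) := resCM (coordFn κ) (continuous_restrict (contDiff_coordFn κ))

/-- The polynomial subalgebra of `C(SU(N), ℝ)`. [folklore] -/
def polyAlg (N : ℕ) : Subalgebra ℝ C(SUN N, ℝ) := Algebra.adjoin ℝ (Set.range (coordCM (N := N)))

/-- The polynomial subalgebra separates points. [folklore] -/
theorem polyAlg_separatesPoints : (polyAlg N).SeparatesPoints := by
  intro g h hgh
  have hne : (g : Matrix (Fin N) (Fin N) ℂ) ≠ (h : Matrix (Fin N) (Fin N) ℂ) := fun e => hgh (Subtype.ext e)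
  obtain ⟨a, b, hab⟩ : ∃ a b, (g : Matrix (Fin N) (Fin N) ℂ) a b ≠ (h : Matrix (Fin N) (Fin N) ℂ) a b := by
    by_contra hc
    push Not at hc
    exact hne (Matrix.ext fun a b => hc a b)
  by_cases hre : ((g : Matrix (Fin N) (Fin N) ℂ) a b).re = ((h : Matrix (Fin N) (Fin N) ℂ) a b).re
  · have him : ((g : Matrix (Fin N) (Fin N) ℂ) a b).im ≠ ((h : Matrix (Fin N) (Fin N) ℂ) a b).im :=
      fun e => hab (Complex.ext hre e)
    refine ⟨coordCM (a, b, false), ⟨coordCM (a, b, false), Algebra.subset_adjoin ⟨(a, b, false), rfl⟩, rfl⟩, ?_⟩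
    simpa [coordCM, resCM, coordFn_false] using him
  · refine ⟨coordCM (a, b, true), ⟨coordCM (a, b, true), Algebra.subset_adjoin ⟨(a, b, true), rfl⟩, rfl⟩, ?_⟩
    simpa [coordCM, resCM, coordFn_true] using hre

/-- Every polynomial on `SU(N)` is the restriction of an element of some `𝒫_n`. [folklore] -/
theorem exists_resPoly_eq_of_mem_polyAlg {f : C(SUN N, ℝ)} (hf : f ∈ polyAlg N) :
    ∃ (n : ℕ) (p : polySpace N n), resPoly n p = f := by
  induction hf using Algebra.adjoin_induction with
  | mem x hx =>
      obtain ⟨κ, rfl⟩ := hx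
      exact ⟨1, ⟨coordFn κ, coordFn_mem_polySpace le_rfl κ⟩, rfl⟩
  | algebraMap r =>
      refine ⟨0, ⟨fun _ => r, const_mem_polySpace 0 r⟩, ?_⟩
      ext g
      simp [Algebra.algebraMap_eq_smul_one]
  | add x y _ _ hx hy =>
      obtain ⟨n, p, rfl⟩ := hx
      obtain ⟨n', q, rfl⟩ := hy
      refine ⟨max n n', ⟨p.1 + q.1, Submodule.add_mem _ (polySpace_mono (le_max_left _ _) p.2)
        (polySpace_mono (le_max_right _ _) q.2)⟩, ?_⟩
      ext g; rfl
  | mul x y _ _ hx hy =>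
      obtain ⟨n, p, rfl⟩ := hx
      obtain ⟨n', q, rfl⟩ := hy
      refine ⟨n + n', ⟨p.1 * q.1, mul_mem_polySpace p.2 q.2⟩, ?_⟩
      ext g; rfl

/-- **Density of the polynomial subspaces in `L²(σ)`** (Stone–Weierstrass on the compact group `SU(N)` and
density of continuous functions in `L²`). [folklore] -/
theorem top_le_closure_iSup_VPoly : ⊤ ≤ (⨆ n, VPoly N n).topologicalClosure := by
  -- Stone–Weierstrass
  have hSW : (polyAlg N).topologicalClosure = ⊤ :=
    ContinuousMap.subalgebra_topologicalClosure_eq_top_of_separatesPoints _ polyAlg_separatesPoints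
  have hdenseA : Dense ((polyAlg N : Set C(SUN N, ℝ))) := by
    rw [dense_iff_closure_eq, ← Subalgebra.topologicalClosure_coe, hSW]
    rfl
  -- the image of the polynomial algebra lies in `⨆ V_n`
  have hsub : (toL2 (N := N)) '' (polyAlg N : Set C(SUN N, ℝ)) ⊆ ↑(⨆ n, VPoly N n) := by
    rintro _ ⟨f, hf, rfl⟩
    obtain ⟨n, p, rfl⟩ := exists_resPoly_eq_of_mem_polyAlg hf
    exact (le_iSup (VPoly N) n) ⟨p, rfl⟩
  have hdense : Dense ((toL2 (N := N)) '' (polyAlg N : Set C(SUN N, ℝ))) :=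
    (ContinuousMap.toLp_denseRange ℝ (haarSU N) ℝ (p := 2) ENNReal.ofNat_ne_top).dense_image
      (toL2 (N := N)).continuous hdenseA
  rw [← Submodule.dense_iff_topologicalClosure_eq_top.1 (hdense.mono hsub)]

/-! ### Orthogonality to `(Δ - W)𝒫` : the projection argument -/

/-- **The projection argument** (the finite-dimensional substitute for elliptic regularity): if
`w ∈ L²(σ)` is orthogonal to `(Δ - W)p` for every polynomial `p`, then the projections `p_n` of `w`
onto `V_n` satisfy `p_n → w` in `L²`, `‖p_n‖ ≤ ‖w‖`, and `∫ Γ(p_n,p_n) dσ = -∫ w W p_n dσ`. [folklore] -/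
theorem exists_proj_seq (hN : N ≠ 0) (c : ℝ) (B : Matrix (Fin N) (Fin N) ℂ) (w : Lp ℝ 2 (haarSU N))
    (hw : ∀ n, ∀ p ∈ polySpace N n,
      ∫ g : SUN N, w g * (Lap p g - schW c B g * p g) ∂(haarSU N) = 0) :
    ∃ p : ℕ → Matrix (Fin N) (Fin N) ℂ → ℝ, (∀ n, p n ∈ polySpace N n) ∧
      Tendsto (fun n => ∫ g : SUN N, (p n g - w g) ^ 2 ∂(haarSU N)) atTop (𝓝 0) ∧
      (∀ n, ∫ g : SUN N, p n g ^ 2 ∂(haarSU N) ≤ ‖w‖ ^ 2) ∧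
      ∀ n, ∫ g : SUN N, Gam (p n) (p n) g ∂(haarSU N) =
        -∫ g : SUN N, w g * (schW c B g * p n g) ∂(haarSU N) := by
  -- projections
  set wn : ℕ → Lp ℝ 2 (haarSU N) := fun n => (VPoly N n).starProjection w with hwn
  have hwn_mem : ∀ n, wn n ∈ VPoly N n := fun n => by
    rw [hwn]
    simp only [Submodule.starProjection_apply]
    exact Submodule.coe_mem _
  have hq : ∀ n, ∃ q : polySpace N n, TPoly n q = wn n := fun n => LinearMap.mem_range.1 (hwn_mem n)
  choose q hq using hq
  refine ⟨fun n => (q n).1, fun n => (q n).2, ?_, ?_, ?_⟩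
  · -- convergence
    have ht : Tendsto (fun n => wn n) atTop (𝓝 w) :=
      Submodule.starProjection_tendsto_self (VPoly N) monotone_VPoly w top_le_closure_iSup_VPoly
    have ht' : Tendsto (fun n => ‖wn n - w‖ ^ 2) atTop (𝓝 0) := by
      have h1 : Tendsto (fun n => ‖wn n - w‖) atTop (𝓝 0) := tendsto_iff_norm_sub_tendsto_zero.1 ht
      simpa using h1.pow 2
    refine ht'.congr fun n => ?_
    rw [← hq n, TPoly_apply, norm_toL2_sub_sq]
    rfl
  · -- norm bound
    intro n
    have h1 : ‖wn n‖ ≤ ‖w‖ := Submodule.norm_starProjection_apply_le (VPoly N n) w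
    have h2 : ∫ g : SUN N, (q n).1 g ^ 2 ∂(haarSU N) = ‖wn n‖ ^ 2 := by
      rw [← hq n, TPoly_apply, norm_toL2_sq]; rfl
    rw [h2]
    exact pow_le_pow_left₀ (norm_nonneg _) h1 2
  · -- the identity
    intro n
    set pn : Matrix (Fin N) (Fin N) ℂ → ℝ := (q n).1 with hpn
    have hpn_mem : pn ∈ polySpace N n := (q n).2
    have hpc : ContDiff ℝ ∞ pn := contDiff_of_mem_polySpace hpn_mem
    -- `ΔPn ∈ V_n`
    set Lq : Lp ℝ 2 (haarSU N) := TPoly n ⟨Lap pn, Lap_mem_polySpace hpn_mem⟩ with hLq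
    have hLq_mem : Lq ∈ VPoly N n := ⟨_, rfl⟩
    have h1 : ⟪w - wn n, Lq⟫_ℝ = 0 := Submodule.starProjection_inner_eq_zero w Lq hLq_mem
    have h2 : ⟪wn n, Lq⟫_ℝ = -∫ g : SUN N, Gam pn pn g ∂(haarSU N) := by
      rw [← hq n, TPoly_apply, hLq, TPoly_apply, inner_toL2_toL2]
      exact integral_mul_Lap hN hpc hpc
    have h3 : ⟪w, Lq⟫_ℝ = ∫ g : SUN N, w g * Lap pn g ∂(haarSU N) := by
      rw [real_inner_comm, hLq, TPoly_apply, inner_toL2_left]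
      refine integral_congr_ae (ae_of_all _ fun g => ?_)
      simp only [resPoly_apply]
      ring
    have h4 : ⟪w, Lq⟫_ℝ = ⟪wn n, Lq⟫_ℝ := by
      have : w = (w - wn n) + wn n := by abel
      rw [this, inner_add_left, h1, zero_add]
    -- the hypothesis
    have h5 := hw n pn hpn_mem
    have hWc : Continuous fun g : SUN N => schW c B g * pn g :=
      (continuous_restrict (contDiff_schW c B)).mul (continuous_restrict hpc)
    have i1 : Integrable (fun g : SUN N => w g * Lap pn g) (haarSU N) := by
      have := integrable_continuous_mul_L2 (continuous_restrict (contDiff_Lap hpc)) w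
      exact this.congr (ae_of_all _ fun g => mul_comm _ _)
    have i2 : Integrable (fun g : SUN N => w g * (schW c B g * pn g)) (haarSU N) := by
      have := integrable_continuous_mul_L2 hWc w
      exact this.congr (ae_of_all _ fun g => mul_comm _ _)
    have h6 : ∫ g : SUN N, w g * Lap pn g ∂(haarSU N) = ∫ g : SUN N, w g * (schW c B g * pn g) ∂(haarSU N) := by
      have : ∫ g : SUN N, w g * (Lap pn g - schW c B g * pn g) ∂(haarSU N) =
          ∫ g : SUN N, w g * Lap pn g ∂(haarSU N) - ∫ g : SUN N, w g * (schW c B g * pn g) ∂(haarSU N) := by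
        rw [← integral_sub i1 i2]
        exact integral_congr_ae (ae_of_all _ fun g => by ring)
      rw [this] at h5
      linarith
    linarith [h2, h3, h4, h6]

/-- `W = 0` for the zero potential. [folklore] -/
theorem schW_zero (B : Matrix (Fin N) (Fin N) ℂ) : schW (N := N) 0 B = 0 := by
  have hpot : pot (N := N) 0 B = fun _ => (0 : ℝ) := by funext Q; simp [pot]
  funext Q
  simp only [schW, hpot, Gam_const_left, Lap_const, Pi.zero_apply, mul_zero, zero_add]

/-- **THM(IV)₀**: an element of `L²(σ)` orthogonal to `Δ𝒫` is a.e. constant (the projections have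
`∫ Γ = 0`, hence are constant on the connected group `SU(N)`, and constants form a closed line).
[folklore] -/
theorem ae_eq_const_of_orthogonal_Lap (hN : N ≠ 0) (w : Lp ℝ 2 (haarSU N))
    (hw : ∀ n, ∀ p ∈ polySpace N n, ∫ g : SUN N, w g * Lap p g ∂(haarSU N) = 0) :
    ∃ m : ℝ, (fun g => w g) =ᵐ[haarSU N] fun _ => m := by
  have hw' : ∀ n, ∀ p ∈ polySpace N n,
      ∫ g : SUN N, w g * (Lap p g - schW 0 (0 : Matrix (Fin N) (Fin N) ℂ) g * p g) ∂(haarSU N) = 0 := by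
    intro n p hp
    simpa [schW_zero] using hw n p hp
  obtain ⟨p, hp, hconv, -, hid⟩ := exists_proj_seq hN 0 0 w hw'
  -- each `p n` is constant on `SU(N)`
  have hconst : ∀ n (g : SUN N), p n g = p n (1 : Matrix (Fin N) (Fin N) ℂ) := by
    intro n
    have hpc : ContDiff ℝ ∞ (p n) := contDiff_of_mem_polySpace (hp n)
    have hint : ∫ g : SUN N, Gam (p n) (p n) g ∂(haarSU N) = 0 := by
      rw [hid n]; simp [schW_zero]
    have hcont : Continuous fun g : SUN N => Gam (p n) (p n) g := continuous_restrict (contDiff_Gam hpc hpc)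
    have hae : (fun g : SUN N => Gam (p n) (p n) g) =ᵐ[haarSU N] 0 :=
      (integral_eq_zero_iff_of_nonneg (fun g => Gam_self_nonneg _ _) (integrable_of_continuous_SUN hcont (haarSU N))).1 hint
    have hzero : (fun g : SUN N => Gam (p n) (p n) g) = 0 := (hcont.ae_eq_iff_eq (haarSU N) continuous_const).1 hae
    exact eq_of_Gam_eq_zero hN hpc (fun g => congrFun hzero g)
  -- constants in `L²`
  set cL : ℝ → Lp ℝ 2 (haarSU N) := fun r => toL2 (ContinuousMap.const (SUN N) r) with hcL
  set C1 : Submodule ℝ (Lp ℝ 2 (haarSU N)) := Submodule.span ℝ {cL 1} with hC1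
  have hcL_mem : ∀ r, cL r ∈ C1 := fun r => by
    have : cL r = r • cL 1 := by
      rw [hcL]
      simp only
      rw [← map_smul]
      congr 1
      ext g; simp
    rw [this]
    exact Submodule.smul_mem _ r (Submodule.mem_span_singleton_self _)
  have hclosed : IsClosed (C1 : Set (Lp ℝ 2 (haarSU N))) := Submodule.closed_of_finiteDimensional C1
  have hlim : Tendsto (fun n => cL (p n 1)) atTop (𝓝 w) := by
    rw [tendsto_iff_norm_sub_tendsto_zero]
    have h0 : Tendsto (fun n => ‖cL (p n 1) - w‖ ^ 2) atTop (𝓝 0) := by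
      refine hconv.congr fun n => ?_
      rw [hcL]
      simp only
      rw [norm_toL2_sub_sq]
      refine integral_congr_ae (ae_of_all _ fun g => ?_)
      simp [hconst n g]
    have h1 : Tendsto (fun n => Real.sqrt (‖cL (p n 1) - w‖ ^ 2)) atTop (𝓝 (Real.sqrt 0)) :=
      (Real.continuous_sqrt.tendsto 0).comp h0
    rw [Real.sqrt_zero] at h1
    exact h1.congr fun n => Real.sqrt_sq (norm_nonneg _)
  have hwC : w ∈ C1 := hclosed.mem_of_tendsto hlim (Eventually.of_forall fun n => hcL_mem _)
  rw [hC1, Submodule.mem_span_singleton] at hwC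
  obtain ⟨m, hm⟩ := hwC
  refine ⟨m, ?_⟩
  have : w = cL m := by
    rw [← hm, hcL]
    simp only
    rw [← map_smul]
    congr 1
    ext g; simp
  rw [this, hcL]
  filter_upwards [ContinuousMap.coeFn_toLp (p := 2) (μ := haarSU N) (𝕜 := ℝ) (ContinuousMap.const (SUN N) m)] with g hg
  rw [hg]
  rfl

/-! ### From THM(IV) to the Poincaré inequality: approximate solutions of the Poisson equation -/

/-- `p ↦ (Δ - W)p|_{SU(N)}` as a linear map `𝒫_n → C(SU(N), ℝ)`. [folklore] -/
def gsCM (c : ℝ) (B : Matrix (Fin N) (Fin N) ℂ) (n : ℕ) : polySpace N n →ₗ[ℝ] C(SUN N, ℝ) where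
  toFun p := resCM (fun Q => Lap p.1 Q - schW c B Q * p.1 Q)
    (continuous_restrict ((contDiff_Lap (contDiff_of_mem_polySpace p.2)).sub
      ((contDiff_schW c B).mul (contDiff_of_mem_polySpace p.2))))
  map_add' p q := by
    ext g
    simp only [resCM, ContinuousMap.coe_mk, ContinuousMap.add_apply, Submodule.coe_add]
    rw [Lap_add (contDiff_of_mem_polySpace p.2) (contDiff_of_mem_polySpace q.2)]
    simp only [Pi.add_apply]
    ring
  map_smul' r p := by
    ext g
    simp only [resCM, ContinuousMap.coe_mk, ContinuousMap.smul_apply, Submodule.coe_smul, RingHom.id_apply,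
      smul_eq_mul]
    rw [Lap_smul r (contDiff_of_mem_polySpace p.2)]
    simp only [Pi.smul_apply, smul_eq_mul]
    ring

/-- Evaluation of `gsCM`. [folklore] -/
@[simp] theorem gsCM_apply (c : ℝ) (B : Matrix (Fin N) (Fin N) ℂ) {n : ℕ} (p : polySpace N n) (g : SUN N) :
    gsCM c B n p g = Lap p.1 g - schW c B g * p.1 g := rfl

/-- `p ↦ (Δ - W)p` into `L²(σ)`. [folklore] -/
def AnPoly (c : ℝ) (B : Matrix (Fin N) (Fin N) ℂ) (n : ℕ) : polySpace N n →ₗ[ℝ] Lp ℝ 2 (haarSU N) :=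
  (toL2 (N := N)).toLinearMap.comp (gsCM c B n)

/-- `AnPoly c B n p = toL2 (gsCM c B n p)`. [folklore] -/
theorem AnPoly_apply (c : ℝ) (B : Matrix (Fin N) (Fin N) ℂ) {n : ℕ} (p : polySpace N n) :
    AnPoly c B n p = toL2 (gsCM c B n p) := rfl

/-- The ranges of `AnPoly` are monotone in the degree. [folklore] -/
theorem monotone_range_AnPoly (c : ℝ) (B : Matrix (Fin N) (Fin N) ℂ) :
    Monotone fun n => LinearMap.range (AnPoly (N := N) c B n) := by
  intro n n' h x hx
  obtain ⟨p, rfl⟩ := hx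
  exact ⟨⟨p.1, polySpace_mono h p.2⟩, rfl⟩

/-- `e^{S} = e^{S/2} e^{S/2}` and `e^{S/2} e^{-S/2} = 1`, pointwise helpers. [folklore] -/
theorem exp_half_mul_exp_half (x : ℝ) : Real.exp (x / 2) * Real.exp (x / 2) = Real.exp x := by
  rw [← Real.exp_add]; congr 1; ring

/-- `e^{x/2} e^{-x/2} = 1`. [folklore] -/
theorem exp_half_mul_exp_neg_half (x : ℝ) : Real.exp (x / 2) * Real.exp (-x / 2) = 1 := by
  rw [← Real.exp_add, show x / 2 + -x / 2 = 0 by ring, Real.exp_zero]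

/-- **Poincaré inequality from THM(IV)** (duality + double orthogonal complement: the class
`{e^{-S/2} p : p polynomial}` solves the Poisson equation `L_S v = u - m` approximately in `L²(e^S σ)`).
For `S = c Re tr(· B)`, `K = N/2 - |c| ‖B‖_op > 0` and smooth `u` with `e^S σ`-mean `m`:
`K ∫ e^S (u - m)² dσ ≤ ∫ e^S Γ(u,u) dσ`. [folklore] -/
theorem poincare_of_thm4 (hN : N ≠ 0) (c : ℝ) (B : Matrix (Fin N) (Fin N) ℂ)
    (hK : 0 < (N : ℝ) / 2 - |c| * matrixOpNorm B)
    (hthm : ∀ w : Lp ℝ 2 (haarSU N), (∀ n, ∀ p ∈ polySpace N n,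
      ∫ g : SUN N, w g * (Lap p g - schW c B g * p g) ∂(haarSU N) = 0) →
      ∃ m : ℝ, (fun g => w g) =ᵐ[haarSU N] fun g => m * Real.exp (pot c B g / 2))
    {u : Matrix (Fin N) (Fin N) ℂ → ℝ} (hu : ContDiff ℝ ∞ u) :
    ((N : ℝ) / 2 - |c| * matrixOpNorm B) *
        ∫ g : SUN N, Real.exp (pot c B g) * (u g -
          (∫ g : SUN N, Real.exp (pot c B g) * u g ∂(haarSU N)) / (∫ g : SUN N, Real.exp (pot c B g) ∂(haarSU N))) ^ 2
          ∂(haarSU N) ≤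
      ∫ g : SUN N, Real.exp (pot c B g) * Gam u u g ∂(haarSU N) := by
  set S : Matrix (Fin N) (Fin N) ℂ → ℝ := pot c B with hSdef
  have hS : ContDiff ℝ ∞ S := contDiff_pot c B
  have hSc : Continuous fun g : SUN N => S g := continuous_restrict hS
  have hwc : Continuous fun g : SUN N => Real.exp (S g) := Real.continuous_exp.comp hSc
  set Z : ℝ := ∫ g : SUN N, Real.exp (S g) ∂(haarSU N) with hZ
  have hZpos : 0 < Z := integral_exp_pos (integrable_of_continuous_SUN hwc _)
  set m : ℝ := (∫ g : SUN N, Real.exp (S g) * u g ∂(haarSU N)) / Z with hmdef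
  have huc : Continuous fun g : SUN N => u g := continuous_restrict hu
  have hm0 : ∫ g : SUN N, Real.exp (S g) * (u g - m) ∂(haarSU N) = 0 := by
    have i1 : Integrable (fun g : SUN N => Real.exp (S g) * u g) (haarSU N) := integrable_of_continuous_SUN (hwc.mul huc) _
    have i2 : Integrable (fun g : SUN N => Real.exp (S g) * m) (haarSU N) := integrable_of_continuous_SUN (hwc.mul continuous_const) _
    have : ∫ g : SUN N, Real.exp (S g) * (u g - m) ∂(haarSU N) =
        ∫ g : SUN N, Real.exp (S g) * u g ∂(haarSU N) - ∫ g : SUN N, Real.exp (S g) * m ∂(haarSU N) := by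
      rw [← integral_sub i1 i2]; exact integral_congr_ae (ae_of_all _ fun g => by ring)
    rw [this, integral_mul_const, hmdef, ← hZ]
    field_simp
    ring
  -- the target vector `y = e^{S/2}(u - m)` and the range `R` of `(Δ - W)` on polynomials
  have hyc : Continuous fun g : SUN N => Real.exp (S g / 2) * (u g - m) :=
    (Real.continuous_exp.comp (hSc.div_const 2)).mul (huc.sub continuous_const)
  set y : Lp ℝ 2 (haarSU N) := toL2 (resCM (fun Q => Real.exp (S Q / 2) * (u Q - m)) hyc) with hydef
  set R : Submodule ℝ (Lp ℝ 2 (haarSU N)) := ⨆ n, LinearMap.range (AnPoly (N := N) c B n) with hRdef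
  -- `y ⟂ Rᗮ`
  have hyRR : y ∈ Rᗮᗮ := by
    rw [Submodule.mem_orthogonal]
    intro z hz
    -- `z` is orthogonal to all `(Δ - W)p`
    have hz' : ∀ n, ∀ p ∈ polySpace N n,
        ∫ g : SUN N, z g * (Lap p g - schW c B g * p g) ∂(haarSU N) = 0 := by
      intro n p hp
      have hmem : AnPoly c B n ⟨p, hp⟩ ∈ R := (le_iSup (fun n => LinearMap.range (AnPoly (N := N) c B n)) n) ⟨_, rfl⟩
      have h0 : ⟪AnPoly c B n ⟨p, hp⟩, z⟫_ℝ = 0 := (Submodule.mem_orthogonal R z).1 hz _ hmem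
      rw [AnPoly_apply, inner_toL2_left] at h0
      rw [← h0]
      refine integral_congr_ae (ae_of_all _ fun g => ?_)
      simp only [gsCM_apply]
      ring
    obtain ⟨mz, hmz⟩ := hthm z hz'
    rw [real_inner_comm, hydef, inner_toL2_left]
    have : ∫ g : SUN N, (resCM (fun Q => Real.exp (S Q / 2) * (u Q - m)) hyc) g * z g ∂(haarSU N) =
        ∫ g : SUN N, mz * (Real.exp (S g) * (u g - m)) ∂(haarSU N) := by
      refine integral_congr_ae ?_
      filter_upwards [hmz] with g hg
      rw [hg]
      simp only [resCM, ContinuousMap.coe_mk]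
      rw [← exp_half_mul_exp_half (S g)]
      simp only [hSdef]
      ring
    rw [this, integral_const_mul, hm0, mul_zero]
  -- hence `y` lies in the closure of `R`
  have hyclos : y ∈ R.topologicalClosure := by
    rw [← Submodule.orthogonal_orthogonal_eq_closure]; exact hyRR
  have hyclos' : y ∈ closure (R : Set (Lp ℝ 2 (haarSU N))) := by
    rw [← Submodule.topologicalClosure_coe]; exact hyclos
  obtain ⟨r, hrR, hrlim⟩ := mem_closure_iff_seq_limit.1 hyclos'
  -- extract polynomials
  have hdir : Directed (· ≤ ·) fun n => LinearMap.range (AnPoly (N := N) c B n) :=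
    (monotone_range_AnPoly c B).directed_le
  have hex : ∀ k, ∃ (n : ℕ) (p : polySpace N n), AnPoly c B n p = r k := fun k => by
    obtain ⟨n, hn⟩ := (Submodule.mem_iSup_of_directed _ hdir).1 (hrR k)
    obtain ⟨p, hp⟩ := LinearMap.mem_range.1 hn
    exact ⟨n, p, hp⟩
  choose nk pk hpk using hex
  -- the approximate solutions `v_k = e^{-S/2} p_k`
  set v : ℕ → Matrix (Fin N) (Fin N) ℂ → ℝ := fun k Q => Real.exp (-S Q / 2) * (pk k).1 Q with hvdef
  have hv : ∀ k, ContDiff ℝ ∞ (v k) := fun k => contDiff_groundState hS (contDiff_of_mem_polySpace (pk k).2)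
  have hconv : Tendsto (fun k => ∫ g : SUN N, Real.exp (S g) * (genL S (v k) g - (u g - m)) ^ 2 ∂(haarSU N))
      atTop (𝓝 0) := by
    have h1 : Tendsto (fun k => ‖r k - y‖ ^ 2) atTop (𝓝 0) := by
      have := tendsto_iff_norm_sub_tendsto_zero.1 hrlim
      simpa using this.pow 2
    refine h1.congr fun k => ?_
    rw [← hpk k, AnPoly_apply, hydef, norm_toL2_sub_toL2_sq]
    refine integral_congr_ae (ae_of_all _ fun g => ?_)
    simp only [gsCM_apply, resCM, ContinuousMap.coe_mk, hvdef]
    rw [genL_groundState hS (contDiff_of_mem_polySpace (pk k).2)]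
    have e1 := exp_half_mul_exp_half (S g)
    have e2 := exp_half_mul_exp_neg_half (S g)
    have hW : schW c B g = (1 / 4) * Gam S S g + (1 / 2) * Lap S g := rfl
    rw [hW]
    linear_combination ((Real.exp (-S g / 2) * (Lap (pk k).1 g - ((1 / 4) * Gam S S g + (1 / 2) * Lap S g) *
      (pk k).1 g) - (u g - m)) ^ 2) * e1 +
      (-((Lap (pk k).1 g - ((1 / 4) * Gam S S g + (1 / 2) * Lap S g) * (pk k).1 g) *
        ((Lap (pk k).1 g - ((1 / 4) * Gam S S g + (1 / 2) * Lap S g) * (pk k).1 g) *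
          (1 + Real.exp (S g / 2) * Real.exp (-S g / 2)) - 2 * Real.exp (S g / 2) * (u g - m)))) * e2
  have key := poincare_of_approx hN c B hK hu m v hv hconv
  exact key

/-- **Poincaré inequality for the Haar measure on `SU(N)`** with the Bakry–Émery constant `2/N`
(`Ric = N/2`): `(N/2) Var_σ(u) ≤ ∫ Γ(u,u) dσ` for smooth `u`. [folklore] -/
theorem poincare_haar (hN : N ≠ 0) {u : Matrix (Fin N) (Fin N) ℂ → ℝ} (hu : ContDiff ℝ ∞ u) :
    (N : ℝ) / 2 * ∫ g : SUN N, (u g - ∫ g : SUN N, u g ∂(haarSU N)) ^ 2 ∂(haarSU N) ≤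
      ∫ g : SUN N, Gam u u g ∂(haarSU N) := by
  have hK : 0 < (N : ℝ) / 2 - |(0 : ℝ)| * matrixOpNorm (0 : Matrix (Fin N) (Fin N) ℂ) := by
    simp only [abs_zero, zero_mul, sub_zero]
    exact div_pos (Nat.cast_pos.2 (Nat.pos_of_ne_zero hN)) two_pos
  have hthm : ∀ w : Lp ℝ 2 (haarSU N), (∀ n, ∀ p ∈ polySpace N n,
      ∫ g : SUN N, w g * (Lap p g - schW 0 (0 : Matrix (Fin N) (Fin N) ℂ) g * p g) ∂(haarSU N) = 0) →
      ∃ m : ℝ, (fun g => w g) =ᵐ[haarSU N] fun g => m * Real.exp (pot 0 (0 : Matrix (Fin N) (Fin N) ℂ) g / 2) := by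
    intro w hw
    have hw' : ∀ n, ∀ p ∈ polySpace N n, ∫ g : SUN N, w g * Lap p g ∂(haarSU N) = 0 := by
      intro n p hp; simpa [schW_zero] using hw n p hp
    obtain ⟨m, hm⟩ := ae_eq_const_of_orthogonal_Lap hN w hw'
    exact ⟨m, hm.trans (ae_of_all _ fun g => by simp [pot])⟩
  have h := poincare_of_thm4 hN 0 0 hK hthm hu
  simp only [pot, zero_mul, Real.exp_zero, one_mul, abs_zero, sub_zero, integral_const, smul_eq_mul,
    probReal_univ, div_one] at h
  exact h

/-! ### Constants in `L²(σ)` -/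

/-- The constant function `r` as an element of `L²(σ)`. [folklore] -/
def cL (r : ℝ) : Lp ℝ 2 (haarSU N) := toL2 (ContinuousMap.const (SUN N) r)

/-- `cL r = r • cL 1`. [folklore] -/
theorem cL_eq_smul (r : ℝ) : cL (N := N) r = r • cL 1 := by
  rw [cL, cL, ← map_smul]
  congr 1
  ext g; simp

/-- **Limits of constants are constants**: if `cL r_n → x` in `L²(σ)` then `x` is a.e. constant. [folklore] -/
theorem ae_eq_const_of_tendsto_cL (x : Lp ℝ 2 (haarSU N)) (rs : ℕ → ℝ)
    (h : Tendsto (fun n => cL (rs n)) atTop (𝓝 x)) : ∃ m : ℝ, (fun g => x g) =ᵐ[haarSU N] fun _ => m := by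
  set C1 : Submodule ℝ (Lp ℝ 2 (haarSU N)) := Submodule.span ℝ {cL (N := N) 1} with hC1
  have hmem : ∀ r, cL (N := N) r ∈ C1 := fun r => by
    rw [cL_eq_smul]; exact Submodule.smul_mem _ r (Submodule.mem_span_singleton_self _)
  have hclosed : IsClosed (C1 : Set (Lp ℝ 2 (haarSU N))) := Submodule.closed_of_finiteDimensional C1
  have hxC : x ∈ C1 := hclosed.mem_of_tendsto h (Eventually.of_forall fun n => hmem _)
  rw [hC1, Submodule.mem_span_singleton] at hxC
  obtain ⟨m, hm⟩ := hxC
  refine ⟨m, ?_⟩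
  rw [← hm, ← cL_eq_smul, cL]
  filter_upwards [ContinuousMap.coeFn_toLp (p := 2) (μ := haarSU N) (𝕜 := ℝ) (ContinuousMap.const (SUN N) m)]
    with g hg
  rw [hg]
  rfl

/-- `‖toL2 φ - cL r‖² = ∫ (φ - r)²`. [folklore] -/
theorem norm_toL2_sub_cL_sq (φ : C(SUN N, ℝ)) (r : ℝ) :
    ‖toL2 φ - cL r‖ ^ 2 = ∫ g, (φ g - r) ^ 2 ∂(haarSU N) := by
  rw [cL, norm_toL2_sub_toL2_sq]; rfl

/-! ### THM(IV) for the tilted measure -/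

/-- **THM(IV)_S**: if `w ∈ L²(σ)` is orthogonal to `(Δ - W)p` for all polynomials `p`
(`W = ¼Γ(S,S) + ½ΔS`, `S = c Re tr(· B)`), then `w = m e^{S/2}` a.e. — the ground state is the only
`L²` solution of the Schrödinger equation, proved without elliptic regularity: project, transform by
`e^{-S/2}`, and use the Poincaré inequality of the Haar measure. [folklore] -/
theorem ae_eq_groundState_of_orthogonal (hN : N ≠ 0) (c : ℝ) (B : Matrix (Fin N) (Fin N) ℂ) (w : Lp ℝ 2 (haarSU N))
    (hw : ∀ n, ∀ p ∈ polySpace N n,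
      ∫ g : SUN N, w g * (Lap p g - schW c B g * p g) ∂(haarSU N) = 0) :
    ∃ m : ℝ, (fun g => w g) =ᵐ[haarSU N] fun g => m * Real.exp (pot c B g / 2) := by
  set S : Matrix (Fin N) (Fin N) ℂ → ℝ := pot c B with hSdef
  have hS : ContDiff ℝ ∞ S := contDiff_pot c B
  have hSc : Continuous fun g : SUN N => S g := continuous_restrict hS
  obtain ⟨p, hp, hconv, hbd, hid⟩ := exists_proj_seq hN c B w hw
  have hpc : ∀ n, ContDiff ℝ ∞ (p n) := fun n => contDiff_of_mem_polySpace (hp n)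
  -- bounds on `e^{-S}` and `W` over the compact group
  obtain ⟨CS, hCS⟩ : ∃ C, ∀ g : SUN N, Real.exp (-S g) ≤ C := by
    obtain ⟨C, hC⟩ := (isCompact_univ (X := SUN N)).exists_bound_of_continuousOn
      ((Real.continuous_exp.comp hSc.neg).continuousOn)
    exact ⟨C, fun g => (Real.le_norm_self _).trans (hC g (Set.mem_univ _))⟩
  have hCS0 : 0 ≤ CS := (Real.exp_pos _).le.trans (hCS 1)
  obtain ⟨CW, hCW⟩ : ∃ C, ∀ g : SUN N, |schW c B g| ≤ C := by
    obtain ⟨C, hC⟩ := (isCompact_univ (X := SUN N)).exists_bound_of_continuousOn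
      ((continuous_restrict (contDiff_schW c B)).continuousOn)
    exact ⟨C, fun g => (hC g (Set.mem_univ _))⟩
  have hCW0 : 0 ≤ CW := (abs_nonneg _).trans (hCW 1)
  -- the transformed projections
  set q : ℕ → Matrix (Fin N) (Fin N) ℂ → ℝ := fun n Q => Real.exp (-S Q / 2) * p n Q with hqdef
  have hq : ∀ n, ContDiff ℝ ∞ (q n) := fun n => contDiff_groundState hS (hpc n)
  -- (d) the ground-state identity, integrated
  have hd : ∀ n, ∫ g : SUN N, Real.exp (S g) * Gam (q n) (q n) g ∂(haarSU N) =
      ∫ g : SUN N, Gam (p n) (p n) g ∂(haarSU N) + ∫ g : SUN N, schW c B g * p n g ^ 2 ∂(haarSU N) := by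
    intro n
    have hpn := hpc n
    have h1 : ∫ g : SUN N, p n g ^ 2 * Lap S g ∂(haarSU N) =
        -∫ g : SUN N, 2 * (p n g * Gam S (p n) g) ∂(haarSU N) := by
      have h := integral_mul_Lap hN (F := fun Q => p n Q * p n Q) (hpn.mul hpn) hS
      have e : ∀ g : SUN N, Gam (fun Q => p n Q * p n Q) S g = 2 * (p n g * Gam S (p n) g) := fun g => by
        show Gam (p n * p n) S g = _
        rw [Gam_mul_left (F := p n) (G := p n) hpn hpn, Gam_comm (p n) S]; ring
      simp only [e] at h
      rw [← h]
      exact integral_congr_ae (ae_of_all _ fun g => by ring)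
    have i1 : Integrable (fun g : SUN N => Gam (p n) (p n) g) (haarSU N) :=
      integrable_of_continuous_SUN (continuous_restrict (contDiff_Gam hpn hpn)) _
    have i2 : Integrable (fun g : SUN N => p n g * Gam S (p n) g) (haarSU N) :=
      integrable_of_continuous_SUN ((continuous_restrict hpn).mul (continuous_restrict (contDiff_Gam hS hpn))) _
    have i3 : Integrable (fun g : SUN N => 1 / 4 * p n g ^ 2 * Gam S S g) (haarSU N) :=
      integrable_of_continuous_SUN ((continuous_const.mul ((continuous_restrict hpn).pow 2)).mul
        (continuous_restrict (contDiff_Gam hS hS))) _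
    have i4 : Integrable (fun g : SUN N => p n g ^ 2 * Lap S g) (haarSU N) :=
      integrable_of_continuous_SUN (((continuous_restrict hpn).pow 2).mul (continuous_restrict (contDiff_Lap hS))) _
    have i12 : Integrable (fun g : SUN N => Gam (p n) (p n) g - p n g * Gam S (p n) g) (haarSU N) := i1.sub i2
    calc ∫ g : SUN N, Real.exp (S g) * Gam (q n) (q n) g ∂(haarSU N)
        = ∫ g : SUN N, (Gam (p n) (p n) g - p n g * Gam S (p n) g + 1 / 4 * p n g ^ 2 * Gam S S g) ∂(haarSU N) :=
          integral_congr_ae (ae_of_all _ fun g => exp_mul_Gam_groundState hS hpn _)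
      _ = ∫ g : SUN N, Gam (p n) (p n) g ∂(haarSU N) - ∫ g : SUN N, p n g * Gam S (p n) g ∂(haarSU N) +
            ∫ g : SUN N, 1 / 4 * p n g ^ 2 * Gam S S g ∂(haarSU N) := by
          rw [integral_add i12 i3, integral_sub i1 i2]
      _ = ∫ g : SUN N, Gam (p n) (p n) g ∂(haarSU N) + ∫ g : SUN N, schW c B g * p n g ^ 2 ∂(haarSU N) := by
          have e2 : ∫ g : SUN N, p n g * Gam S (p n) g ∂(haarSU N) =
              -(1 / 2) * ∫ g : SUN N, p n g ^ 2 * Lap S g ∂(haarSU N) := by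
            rw [h1, integral_const_mul]; ring
          have e3 : ∫ g : SUN N, schW c B g * p n g ^ 2 ∂(haarSU N) =
              ∫ g : SUN N, 1 / 4 * p n g ^ 2 * Gam S S g ∂(haarSU N) +
                (1 / 2) * ∫ g : SUN N, p n g ^ 2 * Lap S g ∂(haarSU N) := by
            rw [← integral_const_mul, ← integral_add i3 (i4.const_mul _)]
            refine integral_congr_ae (ae_of_all _ fun g => ?_)
            show schW c B g * p n g ^ 2 = _
            simp only [schW, hSdef]
            ring
          rw [e2, e3]; ring
  -- (e)+(f): it tends to zero
  have hT0 : ∀ n, 0 ≤ ∫ g : SUN N, Real.exp (S g) * Gam (q n) (q n) g ∂(haarSU N) := fun n =>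
    integral_nonneg fun g => mul_nonneg (Real.exp_pos _).le (Gam_self_nonneg _ _)
  have hTle : ∀ n, ∫ g : SUN N, Real.exp (S g) * Gam (q n) (q n) g ∂(haarSU N) ≤
      CW * ‖w‖ * Real.sqrt (∫ g : SUN N, (p n g - w g) ^ 2 ∂(haarSU N)) := by
    intro n
    have hpn := hpc n
    set φ : C(SUN N, ℝ) := resCM (fun Q => schW c B Q * p n Q)
      (continuous_restrict ((contDiff_schW c B).mul hpn)) with hφ
    set x : Lp ℝ 2 (haarSU N) := toL2 (resPoly n ⟨p n, hp n⟩) - w with hx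
    have hWp : ∫ g : SUN N, schW c B g * p n g ^ 2 ∂(haarSU N) - ∫ g : SUN N, w g * (schW c B g * p n g) ∂(haarSU N)
        = ∫ g : SUN N, φ g * x g ∂(haarSU N) := by
      have i1 : Integrable (fun g : SUN N => schW c B g * p n g ^ 2) (haarSU N) :=
        integrable_of_continuous_SUN ((continuous_restrict (contDiff_schW c B)).mul ((continuous_restrict hpn).pow 2)) _
      have i2 : Integrable (fun g : SUN N => w g * (schW c B g * p n g)) (haarSU N) := by
        have := integrable_continuous_mul_L2 ((continuous_restrict (contDiff_schW c B)).mul (continuous_restrict hpn)) w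
        exact this.congr (ae_of_all _ fun g => mul_comm _ _)
      rw [← integral_sub i1 i2]
      refine integral_congr_ae ?_
      filter_upwards [Lp.coeFn_sub (toL2 (resPoly n ⟨p n, hp n⟩)) w,
        ContinuousMap.coeFn_toLp (p := 2) (μ := haarSU N) (𝕜 := ℝ) (resPoly n ⟨p n, hp n⟩)] with g hsub hres
      rw [hx, hsub, Pi.sub_apply, hres, resPoly_apply, hφ]
      simp only [resCM, ContinuousMap.coe_mk]
      ring
    have hcs := abs_integral_mul_L2_le φ x
    have hφbd : Real.sqrt (∫ g : SUN N, φ g ^ 2 ∂(haarSU N)) ≤ CW * ‖w‖ := by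
      have h2 : ∫ g : SUN N, φ g ^ 2 ∂(haarSU N) ≤ CW ^ 2 * ∫ g : SUN N, p n g ^ 2 ∂(haarSU N) := by
        rw [← integral_const_mul]
        refine integral_mono (integrable_of_continuous_SUN (φ.continuous.pow 2) _)
          ((integrable_of_continuous_SUN ((continuous_restrict hpn).pow 2) _).const_mul _) fun g => ?_
        simp only [hφ, resCM, ContinuousMap.coe_mk, mul_pow]
        exact mul_le_mul_of_nonneg_right (by
          rw [← sq_abs]; exact pow_le_pow_left₀ (abs_nonneg _) (hCW g) 2) (sq_nonneg _)
      calc Real.sqrt (∫ g : SUN N, φ g ^ 2 ∂(haarSU N)) ≤ Real.sqrt (CW ^ 2 * ‖w‖ ^ 2) :=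
            Real.sqrt_le_sqrt (h2.trans (mul_le_mul_of_nonneg_left (hbd n) (sq_nonneg _)))
        _ = CW * ‖w‖ := by rw [Real.sqrt_mul (sq_nonneg _), Real.sqrt_sq hCW0, Real.sqrt_sq (norm_nonneg _)]
    have hxn : ‖x‖ = Real.sqrt (∫ g : SUN N, (p n g - w g) ^ 2 ∂(haarSU N)) := by
      rw [hx, ← Real.sqrt_sq (norm_nonneg (toL2 (resPoly n ⟨p n, hp n⟩) - w)), norm_toL2_sub_sq]; rfl
    rw [hd n, hid n]
    calc -∫ g : SUN N, w g * (schW c B g * p n g) ∂(haarSU N) + ∫ g : SUN N, schW c B g * p n g ^ 2 ∂(haarSU N)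
        = ∫ g : SUN N, φ g * x g ∂(haarSU N) := by rw [← hWp]; ring
      _ ≤ |∫ g : SUN N, φ g * x g ∂(haarSU N)| := le_abs_self _
      _ ≤ Real.sqrt (∫ g : SUN N, φ g ^ 2 ∂(haarSU N)) * ‖x‖ := hcs
      _ ≤ CW * ‖w‖ * Real.sqrt (∫ g : SUN N, (p n g - w g) ^ 2 ∂(haarSU N)) := by
          rw [hxn]; exact mul_le_mul_of_nonneg_right hφbd (Real.sqrt_nonneg _)
  have hTlim : Tendsto (fun n => ∫ g : SUN N, Real.exp (S g) * Gam (q n) (q n) g ∂(haarSU N)) atTop (𝓝 0) := by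
    have hup : Tendsto (fun n => CW * ‖w‖ * Real.sqrt (∫ g : SUN N, (p n g - w g) ^ 2 ∂(haarSU N))) atTop (𝓝 0) := by
      have := ((Real.continuous_sqrt.tendsto 0).comp hconv).const_mul (CW * ‖w‖)
      simpa using this
    exact tendsto_of_tendsto_of_tendsto_of_le_of_le tendsto_const_nhds hup hT0 hTle
  -- (g) Poincaré for the Haar measure applied to `q n`
  set μn : ℕ → ℝ := fun n => ∫ g : SUN N, q n g ∂(haarSU N) with hμn
  have hD : Tendsto (fun n => ∫ g : SUN N, (q n g - μn n) ^ 2 ∂(haarSU N)) atTop (𝓝 0) := by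
    have hN2 : 0 < (N : ℝ) / 2 := div_pos (Nat.cast_pos.2 (Nat.pos_of_ne_zero hN)) two_pos
    have hle : ∀ n, ∫ g : SUN N, (q n g - μn n) ^ 2 ∂(haarSU N) ≤
        (2 / N * CS) * ∫ g : SUN N, Real.exp (S g) * Gam (q n) (q n) g ∂(haarSU N) := by
      intro n
      have h1 := poincare_haar hN (hq n)
      have h2 : ∫ g : SUN N, Gam (q n) (q n) g ∂(haarSU N) ≤
          CS * ∫ g : SUN N, Real.exp (S g) * Gam (q n) (q n) g ∂(haarSU N) := by
        rw [← integral_const_mul]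
        refine integral_mono (integrable_of_continuous_SUN (continuous_restrict (contDiff_Gam (hq n) (hq n))) _)
          ((integrable_of_continuous_SUN ((Real.continuous_exp.comp hSc).mul
            (continuous_restrict (contDiff_Gam (hq n) (hq n)))) _).const_mul _) fun g => ?_
        have hΓ := Gam_self_nonneg (q n) (g : Matrix (Fin N) (Fin N) ℂ)
        calc Gam (q n) (q n) g = Real.exp (-S g) * (Real.exp (S g) * Gam (q n) (q n) g) := by
              rw [← mul_assoc, ← Real.exp_add, show -S g + S g = 0 by ring, Real.exp_zero, one_mul]
          _ ≤ CS * (Real.exp (S g) * Gam (q n) (q n) g) :=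
              mul_le_mul_of_nonneg_right (hCS g) (mul_nonneg (Real.exp_pos _).le hΓ)
      calc ∫ g : SUN N, (q n g - μn n) ^ 2 ∂(haarSU N)
          = (2 / N) * ((N : ℝ) / 2 * ∫ g : SUN N, (q n g - μn n) ^ 2 ∂(haarSU N)) := by
            field_simp
        _ ≤ (2 / N) * (CS * ∫ g : SUN N, Real.exp (S g) * Gam (q n) (q n) g ∂(haarSU N)) :=
            mul_le_mul_of_nonneg_left (h1.trans h2) (by positivity)
        _ = (2 / N * CS) * ∫ g : SUN N, Real.exp (S g) * Gam (q n) (q n) g ∂(haarSU N) := by ring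
    have hup : Tendsto (fun n => (2 / N * CS) * ∫ g : SUN N, Real.exp (S g) * Gam (q n) (q n) g ∂(haarSU N))
        atTop (𝓝 0) := by simpa using hTlim.const_mul (2 / N * CS)
    exact tendsto_of_tendsto_of_tendsto_of_le_of_le tendsto_const_nhds hup
      (fun n => integral_nonneg fun g => sq_nonneg _) hle
  -- (h) `q n → e^{-S/2} w` in `L²(σ)`
  set qf : SUN N → ℝ := fun g => Real.exp (-S g / 2) * w g with hqf
  have hqf_mem : MemLp qf 2 (haarSU N) := by
    have hb : MemLp (fun g : SUN N => Real.exp (-S g / 2)) (⊤ : ENNReal) (haarSU N) := by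
      have hc : Continuous fun g : SUN N => Real.exp (-S g / 2) := Real.continuous_exp.comp (hSc.neg.div_const 2)
      obtain ⟨C, hC⟩ := (isCompact_univ (X := SUN N)).exists_bound_of_continuousOn hc.continuousOn
      exact memLp_top_of_bound hc.aestronglyMeasurable C (ae_of_all _ fun g => hC g (Set.mem_univ _))
    exact MemLp.mul' (Lp.memLp w) hb
  set Qf : Lp ℝ 2 (haarSU N) := hqf_mem.toLp qf with hQf
  have hQf_coe : (fun g => Qf g) =ᵐ[haarSU N] qf := hqf_mem.coeFn_toLp
  have hQn : Tendsto (fun n => ‖toL2 (resCM (q n) (continuous_restrict (hq n))) - Qf‖ ^ 2) atTop (𝓝 0) := by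
    have hle : ∀ n, ‖toL2 (resCM (q n) (continuous_restrict (hq n))) - Qf‖ ^ 2 ≤
        CS * ∫ g : SUN N, (p n g - w g) ^ 2 ∂(haarSU N) := by
      intro n
      rw [norm_sq_eq_integral, ← integral_const_mul]
      refine integral_mono_ae (integrable_sq_L2 _) ((((integrable_sq_L2 (toL2 (resPoly n ⟨p n, hp n⟩) - w)).const_mul CS)).congr ?_) ?_
      · filter_upwards [Lp.coeFn_sub (toL2 (resPoly n ⟨p n, hp n⟩)) w,
          ContinuousMap.coeFn_toLp (p := 2) (μ := haarSU N) (𝕜 := ℝ) (resPoly n ⟨p n, hp n⟩)] with g hsub hres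
        rw [hsub, Pi.sub_apply, hres, resPoly_apply]
      · filter_upwards [Lp.coeFn_sub (toL2 (resCM (q n) (continuous_restrict (hq n)))) Qf, hQf_coe,
          ContinuousMap.coeFn_toLp (p := 2) (μ := haarSU N) (𝕜 := ℝ) (resCM (q n) (continuous_restrict (hq n)))]
          with g hsub hQ hres
        rw [hsub, Pi.sub_apply, hQ, hres]
        simp only [resCM, ContinuousMap.coe_mk, hqdef, hqf]
        rw [← mul_sub, mul_pow]
        refine mul_le_mul_of_nonneg_right ?_ (sq_nonneg _)
        rw [← Real.exp_nat_mul]; norm_num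
        rw [show (2 : ℝ) * (-S g / 2) = -S g by ring]
        exact hCS g
    have hup : Tendsto (fun n => CS * ∫ g : SUN N, (p n g - w g) ^ 2 ∂(haarSU N)) atTop (𝓝 0) := by
      simpa using hconv.const_mul CS
    exact tendsto_of_tendsto_of_tendsto_of_le_of_le tendsto_const_nhds hup (fun n => sq_nonneg _) hle
  -- (i) the constants `μ n` converge to `Qf` in `L²`
  have hCn : Tendsto (fun n => cL (μn n)) atTop (𝓝 Qf) := by
    rw [tendsto_iff_norm_sub_tendsto_zero]
    have h1 : ∀ n, ‖cL (μn n) - Qf‖ ≤ Real.sqrt (∫ g : SUN N, (q n g - μn n) ^ 2 ∂(haarSU N)) +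
        Real.sqrt (‖toL2 (resCM (q n) (continuous_restrict (hq n))) - Qf‖ ^ 2) := by
      intro n
      have e1 : Real.sqrt (∫ g : SUN N, (q n g - μn n) ^ 2 ∂(haarSU N)) =
          ‖toL2 (resCM (q n) (continuous_restrict (hq n))) - cL (μn n)‖ := by
        rw [← Real.sqrt_sq (norm_nonneg (toL2 (resCM (q n) (continuous_restrict (hq n))) - cL (μn n))),
          norm_toL2_sub_cL_sq]; rfl
      rw [e1, Real.sqrt_sq (norm_nonneg _), ← norm_neg (toL2 _ - cL (μn n)), neg_sub]
      exact norm_sub_le_norm_sub_add_norm_sub _ _ _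
    have h2 : Tendsto (fun n => Real.sqrt (∫ g : SUN N, (q n g - μn n) ^ 2 ∂(haarSU N)) +
        Real.sqrt (‖toL2 (resCM (q n) (continuous_restrict (hq n))) - Qf‖ ^ 2)) atTop (𝓝 0) := by
      have := ((Real.continuous_sqrt.tendsto 0).comp hD).add ((Real.continuous_sqrt.tendsto 0).comp hQn)
      simpa using this
    exact tendsto_of_tendsto_of_tendsto_of_le_of_le tendsto_const_nhds h2 (fun n => norm_nonneg _) h1
  obtain ⟨m, hm⟩ := ae_eq_const_of_tendsto_cL Qf μn hCn
  refine ⟨m, ?_⟩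
  filter_upwards [hm, hQf_coe] with g h1 h2
  have h3 : qf g = m := by rw [← h2]; exact h1
  simp only [hqf] at h3
  calc w g = Real.exp (S g / 2) * (Real.exp (-S g / 2) * w g) := by
        rw [← mul_assoc, exp_half_mul_exp_neg_half, one_mul]
    _ = m * Real.exp (pot c B g / 2) := by rw [h3, mul_comm]

/-- **The Poincaré inequality for the one-link Gibbs measure** (Bakry–Émery; Shen–Zhu–Zhu Cor. 4.4
(4.11) with `Λ_L` replaced by one link `{e}`): for `S = c Re tr(· B)` with `K = N/2 - |c| ‖B‖_op > 0`
and smooth `u`, `K ∫ e^S (u - m)² dσ ≤ ∫ e^S Γ(u,u) dσ`, `m` the `e^S σ`-mean of `u`. [cite: arXiv220412737, Cor. 4.4 (4.11) (p. 19)] -/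
theorem poincare_pot (hN : N ≠ 0) (c : ℝ) (B : Matrix (Fin N) (Fin N) ℂ) (hK : 0 < (N : ℝ) / 2 - |c| * matrixOpNorm B)
    {u : Matrix (Fin N) (Fin N) ℂ → ℝ} (hu : ContDiff ℝ ∞ u) :
    ((N : ℝ) / 2 - |c| * matrixOpNorm B) *
        ∫ g : SUN N, Real.exp (pot c B g) * (u g -
          (∫ g : SUN N, Real.exp (pot c B g) * u g ∂(haarSU N)) / (∫ g : SUN N, Real.exp (pot c B g) ∂(haarSU N))) ^ 2
          ∂(haarSU N) ≤
      ∫ g : SUN N, Real.exp (pot c B g) * Gam u u g ∂(haarSU N) :=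
  poincare_of_thm4 hN c B hK (fun w hw => ae_eq_groundState_of_orthogonal hN c B w hw) hu


/-! ## Part H: Lipschitz functions, smooth approximation, and the one-link Poincaré inequality
(hypothesis `hLP` of `shen_zhu_zhu_of_haarPoincare`); discharge of `shen_zhu_zhu` -/


open scoped Matrix.Norms.Frobenius ContDiff Topology
open Matrix Complex Finset MeasureTheory Filter ProbabilityTheory

variable {N : ℕ}

/-! ### Smooth approximation of Lipschitz functions with control of the carré du champ -/

section Mollify

attribute [local instance 2000] matTop

/-- **Smooth approximation of Frobenius-Lipschitz functions on `SU(N)`**: McShane extension to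
`M_N(ℂ)` and mollification by a smooth bump. The approximants are `M`-Lipschitz, so `Γ ≤ M²` on
`SU(N)` (frame bound), and uniformly `ε`-close. [folklore] -/
theorem exists_smooth_approx {ψ : SUN N → ℝ} {M : ℝ} (hM : 0 ≤ M)
    (hψ : ∀ a b : SUN N, |ψ a - ψ b| ≤ M * suFrobDist a b) {ε : ℝ} (hε : 0 < ε) (hN : N ≠ 0) :
    ∃ F : Matrix (Fin N) (Fin N) ℂ → ℝ, ContDiff ℝ ∞ F ∧ (∀ g : SUN N, Gam F F g ≤ M ^ 2) ∧
      ∀ g : SUN N, |F g - ψ g| ≤ ε := by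
  classical
  set E := Matrix (Fin N) (Fin N) ℂ
  -- McShane extension
  set M' : NNReal := ⟨M, hM⟩ with hM'
  set s : Set (Matrix (Fin N) (Fin N) ℂ) := Set.range (fun g : SUN N => (g : Matrix (Fin N) (Fin N) ℂ)) with hs
  set f : Matrix (Fin N) (Fin N) ℂ → ℝ := fun x =>
    if hx : x ∈ Matrix.specialUnitaryGroup (Fin N) ℂ then ψ ⟨x, hx⟩ else 0 with hf
  have hfψ : ∀ g : SUN N, f g = ψ g := fun g => by
    simp only [hf, dif_pos g.2]
  have hfs : LipschitzOnWith M' f s := by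
    refine LipschitzOnWith.of_dist_le_mul fun x hx y hy => ?_
    obtain ⟨a, rfl⟩ := hx
    obtain ⟨b, rfl⟩ := hy
    rw [hfψ, hfψ, Real.dist_eq, dist_eq_norm, ← frobNorm_eq_norm]
    exact hψ a b
  obtain ⟨ψe, hψe_lip, hψe_eq⟩ := hfs.extend_real
  have hψe_cont : Continuous ψe := hψe_lip.continuous
  have hψeψ : ∀ g : SUN N, ψe g = ψ g := fun g => by
    rw [← hψe_eq ⟨g, rfl⟩, hfψ]
  -- mollification
  borelize (Matrix (Fin N) (Fin N) ℂ)
  set μ : Measure (Matrix (Fin N) (Fin N) ℂ) := Measure.addHaar with hμ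
  have hε2 : 0 < ε / (M + 1) := div_pos hε (by linarith)
  set φ : ContDiffBump (0 : Matrix (Fin N) (Fin N) ℂ) :=
    ⟨ε / (M + 1) / 2, ε / (M + 1), half_pos hε2, half_lt_self hε2⟩ with hφ
  set F : Matrix (Fin N) (Fin N) ℂ → ℝ :=
    MeasureTheory.convolution (φ.normed μ) ψe (ContinuousLinearMap.lsmul ℝ ℝ) μ with hF
  have hFdef : ∀ x, F x = ∫ t, φ.normed μ t * ψe (x - t) ∂μ := fun x => by
    rw [hF, convolution_lsmul]; rfl
  refine ⟨F, ?_, ?_, ?_⟩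
  · exact φ.hasCompactSupport_normed.contDiff_convolution_left _ φ.contDiff_normed
      (hψe_cont.locallyIntegrable (μ := μ))
  · -- Lipschitz, hence `Γ ≤ M²`
    have hFlip : LipschitzWith M' F := by
      refine LipschitzWith.of_dist_le_mul fun x y => ?_
      have hint : ∀ z : Matrix (Fin N) (Fin N) ℂ, Integrable (fun t => φ.normed μ t * ψe (z - t)) μ := fun z =>
        (φ.continuous_normed.mul (hψe_cont.comp (continuous_const.sub continuous_id))).integrable_of_hasCompactSupport
          (φ.hasCompactSupport_normed.mul_right)
      rw [Real.dist_eq, hFdef, hFdef, ← integral_sub (hint x) (hint y)]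
      calc |∫ t, (φ.normed μ t * ψe (x - t) - φ.normed μ t * ψe (y - t)) ∂μ|
          ≤ ∫ t, |φ.normed μ t * ψe (x - t) - φ.normed μ t * ψe (y - t)| ∂μ := abs_integral_le_integral_abs
        _ ≤ ∫ t, φ.normed μ t * (M * dist x y) ∂μ := by
            refine integral_mono ((hint x).sub (hint y)).abs ((φ.continuous_normed.integrable_of_hasCompactSupport
              φ.hasCompactSupport_normed).mul_const _) fun t => ?_
            rw [← mul_sub, abs_mul, abs_of_nonneg (φ.nonneg_normed t)]
            refine mul_le_mul_of_nonneg_left ?_ (φ.nonneg_normed t)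
            have h := hψe_lip.dist_le_mul (x - t) (y - t)
            rw [Real.dist_eq, dist_sub_right] at h
            exact h
        _ = M * dist x y := by rw [integral_mul_const, φ.integral_normed, one_mul]
    intro g
    exact Gam_self_le_of_lipschitz hN hFlip (SUN.mem_unitaryGroup g)
  · -- uniform approximation on `SU(N)`
    intro g
    have h := φ.dist_normed_convolution_le (μ := μ) (x₀ := (g : Matrix (Fin N) (Fin N) ℂ)) (ε := ε)
      hψe_cont.aestronglyMeasurable (fun x hx => ?_)
    · rw [← hψeψ g, ← Real.dist_eq]
      exact h
    · rw [Real.dist_eq]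
      have h1 := hψe_lip.dist_le_mul x (g : Matrix (Fin N) (Fin N) ℂ)
      rw [Real.dist_eq] at h1
      refine h1.trans ?_
      have hx' : dist x (g : Matrix (Fin N) (Fin N) ℂ) < ε / (M + 1) := hx
      calc (M' : ℝ) * dist x (g : Matrix (Fin N) (Fin N) ℂ) ≤ M * (ε / (M + 1)) :=
            mul_le_mul_of_nonneg_left hx'.le hM
        _ ≤ ε := by
            rw [mul_div_assoc']
            rw [div_le_iff₀ (by linarith)]
            nlinarith

end Mollify

/-! ### The one-link Poincaré inequality (hypothesis `hLP`) -/

/-- Frobenius-Lipschitz functions on `SU(N)` are continuous. [folklore] -/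
theorem continuous_of_lipschitz_suFrobDist {ψ : SUN N → ℝ} {M : ℝ}
    (hψ : ∀ a b : SUN N, |ψ a - ψ b| ≤ M * suFrobDist a b) : Continuous ψ := by
  have hfrob : ∀ a : SUN N, Continuous fun b : SUN N => suFrobDist b a := by
    intro a
    have : (fun b : SUN N => suFrobDist b a) =
        fun b : SUN N => ‖(b : Matrix (Fin N) (Fin N) ℂ) - (a : Matrix (Fin N) (Fin N) ℂ)‖ := by
      funext b; rw [suFrobDist, frobNorm_eq_norm]
    rw [this]
    exact (continuous_subtype_val.sub continuous_const).norm
  refine continuous_iff_continuousAt.2 fun a => ?_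
  rw [ContinuousAt, tendsto_iff_norm_sub_tendsto_zero]
  refine squeeze_zero (g := fun b => M * suFrobDist b a) (fun b => norm_nonneg _) (fun b => ?_) ?_
  · exact (Real.norm_eq_abs _).le.trans (hψ b a)
  · have h := ((hfrob a).tendsto a).const_mul M
    rw [suFrobDist_self, mul_zero] at h
    exact h

/-- Integrals against the tilted measure are weighted integrals: `∫ f d(σ^S) = (∫ e^S f dσ) / ∫ e^S dσ`.
[folklore] -/
theorem integral_tilted_eq_div (S : SUN N → ℝ) (f : SUN N → ℝ) :
    ∫ g, f g ∂((haarSU N).tilted S) = (∫ g, Real.exp (S g) * f g ∂(haarSU N)) / ∫ g, Real.exp (S g) ∂(haarSU N) := by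
  rw [integral_tilted]
  simp_rw [smul_eq_mul, div_mul_eq_mul_div]
  exact integral_div _ _

/-- **The one-link Poincaré inequality on `SU(N)`** in the Lipschitz form — exactly the hypothesis
`hLP` of `shen_zhu_zhu_of_haarPoincare` (Shen–Zhu–Zhu, CMP 400 (2023): the Poincaré inequality
Cor. 4.4 (4.11) from the Bakry–Émery condition (4.7), with Lemma 4.1 for one link and
`Ric_{SU(N)} = N/2`, (4.8)): for `N ≥ 2`, `‖B‖_op < 1/2` and `ψ` with `|ψ(a) - ψ(b)| ≤ M ‖a - b‖_F`,
`Var_{ν_B}(ψ) ≤ M² / (N (1/2 - ‖B‖_op))`, `ν_B(dg) ∝ exp(N Re tr(g B)) dg`. Proof: Bakry–Émery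
`Γ₂ ≥ K Γ` (frame Bochner formula), integrated Bochner inequality, Poincaré from approximate solvability
of the Poisson equation (projection argument + ground-state transform), smooth approximation of
Lipschitz functions. [cite: arXiv220412737, Assumption 1.1, Lemma 4.1, (4.7)-(4.8), Cor. 4.4 (4.11)] -/
theorem haarPoincare_SU : 2 ≤ N → ∀ B : Matrix (Fin N) (Fin N) ℂ, matrixOpNorm B < 1 / 2 →
      ∀ (ψ : Matrix.specialUnitaryGroup (Fin N) ℂ → ℝ) (M : ℝ), 0 ≤ M →
        (∀ a b, |ψ a - ψ b| ≤ M * suFrobDist a b) →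
        Var[ψ; (haarProbability (Matrix.specialUnitaryGroup (Fin N) ℂ)).tilted
            fun g => (N : ℝ) * ((g : Matrix (Fin N) (Fin N) ℂ) * B).trace.re] ≤
          M ^ 2 / ((N : ℝ) * (1 / 2 - matrixOpNorm B)) := by
  intro hN2 B hB ψ M hM hψ
  have hN : N ≠ 0 := by omega
  have hN0 : (0 : ℝ) < N := Nat.cast_pos.2 (Nat.pos_of_ne_zero hN)
  set S : Matrix (Fin N) (Fin N) ℂ → ℝ := pot (N : ℝ) B with hSdef
  have hS : ContDiff ℝ ∞ S := contDiff_pot _ B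
  have hSc : Continuous fun g : SUN N => S g := continuous_restrict hS
  have hwc : Continuous fun g : SUN N => Real.exp (S g) := Real.continuous_exp.comp hSc
  set K : ℝ := (N : ℝ) * (1 / 2 - matrixOpNorm B) with hKdef
  have hKpos : 0 < K := mul_pos hN0 (by linarith)
  have hKeq : (N : ℝ) / 2 - |(N : ℝ)| * matrixOpNorm B = K := by
    rw [abs_of_pos hN0, hKdef]; ring
  have hK' : 0 < (N : ℝ) / 2 - |(N : ℝ)| * matrixOpNorm B := by rwa [hKeq]
  set Z : ℝ := ∫ g : SUN N, Real.exp (S g) ∂(haarSU N) with hZ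
  have hZpos : 0 < Z := integral_exp_pos (integrable_of_continuous_SUN hwc _)
  have hψc : Continuous ψ := continuous_of_lipschitz_suFrobDist hψ
  -- the variance as a weighted integral
  set m : ℝ := (∫ g : SUN N, Real.exp (S g) * ψ g ∂(haarSU N)) / Z with hmdef
  have hmean : ∫ g, ψ g ∂((haarSU N).tilted fun g => S g) = m := by rw [integral_tilted_eq_div]
  have hvar : Var[ψ; (haarSU N).tilted fun g => S g] =
      (∫ g : SUN N, Real.exp (S g) * (ψ g - m) ^ 2 ∂(haarSU N)) / Z := by
    rw [ProbabilityTheory.variance_eq_integral hψc.aemeasurable, hmean, integral_tilted_eq_div]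
  change Var[ψ; (haarSU N).tilted fun g => S g] ≤ M ^ 2 / K
  rw [hvar, div_le_div_iff₀ hZpos hKpos]
  -- bounds for `ψ`
  obtain ⟨D, hD⟩ : ∃ D, ∀ g : SUN N, |ψ g| ≤ D := by
    obtain ⟨D, hD⟩ := (isCompact_univ (X := SUN N)).exists_bound_of_continuousOn hψc.continuousOn
    exact ⟨D, fun g => (Real.norm_eq_abs _).symm.le.trans (hD g (Set.mem_univ _))⟩
  have hD0 : 0 ≤ D := (abs_nonneg _).trans (hD 1)
  have hwint : ∀ {f : SUN N → ℝ}, Continuous f → Integrable (fun g : SUN N => Real.exp (S g) * f g) (haarSU N) :=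
    fun hf => integrable_of_continuous_SUN (hwc.mul hf) _
  -- weighted averages are bounded by sup norms
  have havg : ∀ {f : SUN N → ℝ} (hf : Continuous f) {C : ℝ}, (∀ g, |f g| ≤ C) →
      |(∫ g : SUN N, Real.exp (S g) * f g ∂(haarSU N)) / Z| ≤ C := by
    intro f hf C hC
    rw [abs_div, abs_of_pos hZpos, div_le_iff₀ hZpos]
    calc |∫ g : SUN N, Real.exp (S g) * f g ∂(haarSU N)| ≤ ∫ g : SUN N, |Real.exp (S g) * f g| ∂(haarSU N) :=
          abs_integral_le_integral_abs
      _ ≤ ∫ g : SUN N, Real.exp (S g) * C ∂(haarSU N) := by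
          refine integral_mono (hwint hf).abs (hwint continuous_const) fun g => ?_
          rw [abs_mul, abs_of_pos (Real.exp_pos _)]
          exact mul_le_mul_of_nonneg_left (hC g) (Real.exp_pos _).le
      _ = C * Z := by rw [integral_mul_const, hZ, mul_comm]
  have hm : |m| ≤ D := havg hψc hD
  -- the ε-argument
  refine le_of_forall_pos_le_add fun δ hδ => ?_
  have hden : 0 < 2 * (4 * D + 2) * Z * K + 1 := by positivity
  set ε : ℝ := min 1 (δ / (2 * (4 * D + 2) * Z * K + 1)) with hεdef
  have hε : 0 < ε := lt_min one_pos (div_pos hδ hden)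
  have hε1 : ε ≤ 1 := min_le_left _ _
  have hεδ : 2 * ε * (4 * D + 2) * Z * K ≤ δ := by
    have h1 : ε ≤ δ / (2 * (4 * D + 2) * Z * K + 1) := min_le_right _ _
    rw [le_div_iff₀ hden] at h1
    nlinarith [hZpos, hD0, hε, hKpos]
  obtain ⟨F, hF, hΓF, hFψ⟩ := exists_smooth_approx hM hψ hε hN
  have hFc : Continuous fun g : SUN N => F g := continuous_restrict hF
  -- Poincaré for `F`
  set mF : ℝ := (∫ g : SUN N, Real.exp (S g) * F g ∂(haarSU N)) / Z with hmFdef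
  have hPF : K * ∫ g : SUN N, Real.exp (S g) * (F g - mF) ^ 2 ∂(haarSU N) ≤ M ^ 2 * Z := by
    have h := poincare_pot hN (N : ℝ) B hK' hF
    rw [hKeq] at h
    refine h.trans ?_
    calc ∫ g : SUN N, Real.exp (pot (N : ℝ) B g) * Gam F F g ∂(haarSU N)
        ≤ ∫ g : SUN N, Real.exp (S g) * M ^ 2 ∂(haarSU N) := by
          refine integral_mono (hwint (continuous_restrict (contDiff_Gam hF hF))) (hwint continuous_const) fun g => ?_
          exact mul_le_mul_of_nonneg_left (hΓF g) (Real.exp_pos _).le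
      _ = M ^ 2 * Z := by rw [integral_mul_const, hZ, mul_comm]
  -- compare `ψ - m` with `F - mF`
  have hmm : |mF - m| ≤ ε := by
    have h : mF - m = (∫ g : SUN N, Real.exp (S g) * (F g - ψ g) ∂(haarSU N)) / Z := by
      rw [hmFdef, hmdef, ← sub_div, ← integral_sub (hwint hFc) (hwint hψc)]
      congr 1
      exact integral_congr_ae (ae_of_all _ fun g => by ring)
    rw [h]
    exact havg (hFc.sub hψc) fun g => hFψ g
  have hpt : ∀ g : SUN N, Real.exp (S g) * (ψ g - m) ^ 2 ≤
      Real.exp (S g) * (F g - mF) ^ 2 + Real.exp (S g) * (2 * ε * (4 * D + 2)) := by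
    intro g
    rw [← mul_add]
    refine mul_le_mul_of_nonneg_left ?_ (Real.exp_pos _).le
    have ha : |ψ g - m| ≤ 2 * D := by
      have := abs_sub (ψ g) m
      linarith [hD g, hm]
    have hab : |(ψ g - m) - (F g - mF)| ≤ 2 * ε := by
      have e : (ψ g - m) - (F g - mF) = -(F g - ψ g) + (mF - m) := by ring
      rw [e]
      refine (abs_add_le _ _).trans ?_
      rw [abs_neg]
      linarith [hFψ g, hmm]
    have hb : |F g - mF| ≤ 2 * D + 2 * ε := by
      have h1 := abs_sub_abs_le_abs_sub (F g - mF) (ψ g - m)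
      have h2 : |(F g - mF) - (ψ g - m)| ≤ 2 * ε := by rw [abs_sub_comm]; exact hab
      linarith
    have key : (ψ g - m) ^ 2 - (F g - mF) ^ 2 ≤ 2 * ε * (4 * D + 2) := by
      have e : (ψ g - m) ^ 2 - (F g - mF) ^ 2 = ((ψ g - m) - (F g - mF)) * ((ψ g - m) + (F g - mF)) := by ring
      rw [e]
      refine (le_abs_self _).trans ?_
      rw [abs_mul]
      have hsum : |(ψ g - m) + (F g - mF)| ≤ 4 * D + 2 := by
        refine (abs_add_le _ _).trans ?_
        nlinarith [ha, hb, hε1]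
      calc |ψ g - m - (F g - mF)| * |ψ g - m + (F g - mF)| ≤ (2 * ε) * (4 * D + 2) :=
            mul_le_mul hab hsum (abs_nonneg _) (by positivity)
        _ = 2 * ε * (4 * D + 2) := by ring
    linarith
  have j0 : Integrable (fun g : SUN N => Real.exp (S g) * (ψ g - m) ^ 2) (haarSU N) :=
    hwint ((hψc.sub continuous_const).pow 2)
  have j1 : Integrable (fun g : SUN N => Real.exp (S g) * (F g - mF) ^ 2) (haarSU N) :=
    hwint ((hFc.sub continuous_const).pow 2)
  have j2 : Integrable (fun g : SUN N => Real.exp (S g) * (2 * ε * (4 * D + 2))) (haarSU N) := hwint continuous_const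
  have j12 : Integrable (fun g : SUN N => Real.exp (S g) * (F g - mF) ^ 2 + Real.exp (S g) * (2 * ε * (4 * D + 2)))
      (haarSU N) := j1.add j2
  have hmono : ∫ g : SUN N, Real.exp (S g) * (ψ g - m) ^ 2 ∂(haarSU N) ≤
      ∫ g : SUN N, (Real.exp (S g) * (F g - mF) ^ 2 + Real.exp (S g) * (2 * ε * (4 * D + 2))) ∂(haarSU N) :=
    integral_mono j0 j12 hpt
  have hsplit : ∫ g : SUN N, (Real.exp (S g) * (F g - mF) ^ 2 + Real.exp (S g) * (2 * ε * (4 * D + 2))) ∂(haarSU N) =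
      ∫ g : SUN N, Real.exp (S g) * (F g - mF) ^ 2 ∂(haarSU N) + Z * (2 * ε * (4 * D + 2)) := by
    rw [integral_add j1 j2, integral_mul_const]
  have h1 : (∫ g : SUN N, Real.exp (S g) * (F g - mF) ^ 2 ∂(haarSU N)) * K ≤ M ^ 2 * Z := by
    rw [mul_comm]; exact hPF
  have h2 : Z * (2 * ε * (4 * D + 2)) * K ≤ δ := by
    calc Z * (2 * ε * (4 * D + 2)) * K = 2 * ε * (4 * D + 2) * Z * K := by ring
      _ ≤ δ := hεδ
  calc (∫ g : SUN N, Real.exp (S g) * (ψ g - m) ^ 2 ∂(haarSU N)) * K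
      ≤ (∫ g : SUN N, Real.exp (S g) * (F g - mF) ^ 2 ∂(haarSU N) + Z * (2 * ε * (4 * D + 2))) * K := by
        rw [← hsplit]; exact mul_le_mul_of_nonneg_right hmono hKpos.le
    _ = (∫ g : SUN N, Real.exp (S g) * (F g - mF) ^ 2 ∂(haarSU N)) * K + Z * (2 * ε * (4 * D + 2)) * K := add_mul _ _ _
    _ ≤ M ^ 2 * Z + δ := add_le_add h1 h2

end SUNBakryEmery

/-- **Shen–Zhu–Zhu's theorem** (CMP 400 (2023), Thm. 1.2 and Cor. 1.6 "Mass gap"; `constructive-qft.S16`):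
discharge of the named fact `shen_zhu_zhu d N` — for `d ≥ 2`, `N ≥ 2` and every 't Hooft coupling
`|β| < 1/(16(d-1))`, the `SU(N)` lattice Yang–Mills DLR state at bare coupling `N β` is unique and
covariances of Lipschitz cylinder functions decay exponentially. Proof: the Dobrushin route
(`shen_zhu_zhu_of_haarPoincare`, `LatticeGaugeDobrushinPoincare.lean`) and the one-link Poincaré
inequality `SUNBakryEmery.haarPoincare_SU` (Bakry–Émery on `SU(N)`, proved from scratch).
[cite: arXiv220412737, Assumption 1.1, Thm. 1.2, Rem. 1.3 ff., Lemma 4.1, (4.7)-(4.8), Cor. 4.4 (4.11), Cor. 1.6 (Mass gap)] -/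
theorem shen_zhu_zhu_holds : ∀ d N : ℕ, shen_zhu_zhu d N :=
  fun _ _ => shen_zhu_zhu_of_haarPoincare SUNBakryEmery.haarPoincare_SU

namespace SUNBakryEmery
end SUNBakryEmery

end Literature.MathematicalPhysics.QuantumFieldTheory
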